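import Mathlib
import HarnessLib

/-!
# Finite speed of propagation (local uniqueness in acoustic cones) for classical solutions of the
# isentropic compressible Euler equations

Topic `Literature/Analysis/FluidPDE`; namespace `Literature.Analysis.FluidPDE`, auxiliary material in
the sub-namespace `IsentropicEuler`. Theorem-only file (no new definitions, no named facts).

In the variables `(u, σ)`, `σ = α⁻¹ρ^α` (`α = (γ−1)/2`), the isentropic compressible Euler system with
pressure `p = ρ^γ/γ` on `ℝᵈ` reads (Cao-Labora–Gómez-Serrano–Shi–Staffilani, arXiv:2310.05325, §1.3,
first display; Buckmaster–Cao-Labora–Gómez-Serrano, arXiv:2208.09445, §1.3)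

  `∂ₜσ + u·∇σ + α σ div u = 0`,  `∂ₜu + (u·∇)u + α σ ∇σ = 0`,

a quasilinear SYMMETRIC hyperbolic system. The main result of this file,
`IsentropicEuler.eqOn_cone_of_eqOn_ball`, is the classical domain-of-dependence / local-uniqueness
statement for it: two `C¹` solutions on a slab `[0, t₁) × ℝᵈ` which agree at `t = 0` on the ball
`‖x − x₀‖ < R` agree on the backward acoustic cone `‖x − x₀‖ + c t < R`, `0 ≤ t < t₁`, as soon as
`c` dominates the characteristic speed `|u| + |α σ|` of one of them on that cone; its
variable-speed form `IsentropicEuler.eqOn_cone_of_eqOn_ball_var` does the same on the curved cone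
`‖x − x₀‖ + Γ(t) < R`, `Γ(0) = 0`, `Γ' = c(t) ≥ 0` continuous (the form needed near an implosion,
where the characteristic speed is unbounded but integrable in time); the exterior form
`IsentropicEuler.eqOn_const_of_exterior` (a solution whose data are CONSTANT outside a ball
`‖x − x₀‖ ≤ L` stays equal to that constant state for `‖x − x₀‖ > L + (‖ū‖ + |ασ̄|) t`) is the
case of a constant reference solution on the balls of the exterior region. This is the
classical-solution case of Dafermos's local `L²`-stability theorem for systems endowed with a convex
entropy (*Hyperbolic Conservation Laws in Continuum Physics*, 2nd ed. 2005, Thm 5.2.1: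
`∫_{|x|<R} |U − Ū|² dx ≤ a e^{bt} ∫_{|x|<R+st} |U₀ − Ū₀|² dx`, "In particular, `Ū` is the unique
admissible … solution"), and it is the ingredient by which "the Euler result with periodic boundary
conditions … can be easily deduced from the non-periodic one via finite speed of propagation"
(Cao-Labora–Gómez-Serrano–Shi–Staffilani, Rem. 1.5) in the implosion programme of
`CompressibleEulerImplosionRates.lean` / `CompressibleEulerExactSelfSimilarImplosion.lean`.

## The proof (Dafermos, proof of Thm 5.2.1, for two classical solutions)

With `w = u₁ − u₂`, `s = σ₁ − σ₂` and the energy density `e = ½(s² + |w|²)`, subtracting the two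
systems gives `∂ₜe + div(e u₁ + α σ₁ s w) = Q` with `|Q| ≤ M e`, `M` depending on `C¹` bounds of both
solutions (`IsentropicEuler.energy_algebra`). For a nonnegative `C¹` weight `Φ(t, x)` supported in
the cone and decreasing at least at speed `c` along it (`∂ₜΦ + c |∇ₓΦ| ≤ 0`; Dafermos's Lipschitz
cut-off `χθ` of (5.2.11) is replaced by the smooth weight
`Φ_ε(t,x) = χ(R − ct − (ε² + |x − x₀|²)^{1/2})`, `χ` = Mathlib's `Real.smoothTransition`), the
weighted energy `E(t) = ∫ Φ e dx` satisfies `E(t) − E(0) = ∫₀ᵗ∫ ∂ₜ(Φe)` (fundamental theorem of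
calculus and Fubini), the flux terms produced by integrating by parts in `x`
(Mathlib's `integral_mul_fderiv_eq_neg_fderiv_mul_of_integrable`) have the good sign
`e (∂ₜΦ + (|u₁| + |ασ₁|)|∇Φ|) ≤ 0`, so `E(t) ≤ M ∫₀ᵗ E` and Grönwall's inequality
(`eq_zero_of_abs_deriv_le_mul_abs_self_of_eq_zero_right`) gives `E ≡ 0`, i.e. `w = s = 0` wherever
`Φ > 0`; letting `ε → 0` exhausts the open cone. No divergence theorem on cones is needed (the same
device as `Literature.Geometry.Lorentzian.KerrSchildLocalEnergy`).

## References

* C. M. Dafermos, *Hyperbolic Conservation Laws in Continuum Physics*, 2nd ed., Grundlehren 325,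
  Springer 2005, §5.2, Thm 5.2.1 and its proof ((5.2.10)–(5.2.14)) (key `Dafermos2005`; held text,
  PDF pp. 126–128).
* G. Cao-Labora, J. Gómez-Serrano, J. Shi, G. Staffilani, arXiv:2310.05325, §1.3 and Rem. 1.5
  (key `CaolaboraEtAl2025`).
-/

noncomputable section

open Set Filter MeasureTheory Metric
open scoped Topology ContDiff RealInnerProductSpace

namespace Literature.Analysis.FluidPDE

namespace IsentropicEuler

variable {ι : Type*} [Fintype ι]

/-! ### Calculus helpers -/

section Calculus

variable {F : Type*} [NormedAddCommGroup F] [NormedSpace ℝ F]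

/-- Partial derivative in time from the joint Fréchet derivative. [folklore] -/
theorem hasDerivAt_slice_left {U : ℝ × (EuclideanSpace ℝ ι) → F} {L : ℝ × (EuclideanSpace ℝ ι) →L[ℝ] F} {t : ℝ} {x : (EuclideanSpace ℝ ι)}
    (h : HasFDerivAt U L (t, x)) : HasDerivAt (fun τ => U (τ, x)) (L (1, 0)) t := by
  have h1 : HasDerivAt (fun τ : ℝ => (τ, x)) ((1 : ℝ), (0 : (EuclideanSpace ℝ ι))) t :=
    (hasDerivAt_id t).prodMk (hasDerivAt_const t x)
  exact h.comp_hasDerivAt t h1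

/-- Partial (Fréchet) derivative in space from the joint Fréchet derivative. [folklore] -/
theorem hasFDerivAt_slice_right {U : ℝ × (EuclideanSpace ℝ ι) → F} {L : ℝ × (EuclideanSpace ℝ ι) →L[ℝ] F} {t : ℝ} {x : (EuclideanSpace ℝ ι)}
    (h : HasFDerivAt U L (t, x)) :
    HasFDerivAt (fun y => U (t, y)) (L.comp (ContinuousLinearMap.inr ℝ ℝ (EuclideanSpace ℝ ι))) x :=
  h.comp x (hasFDerivAt_prodMk_right t x)

/-- `‖L (1, 0)‖ ≤ ‖L‖`. [folklore] -/
theorem norm_apply_one_zero_le (L : ℝ × (EuclideanSpace ℝ ι) →L[ℝ] F) : ‖L (1, 0)‖ ≤ ‖L‖ := by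
  refine (L.le_opNorm _).trans ?_
  rw [Prod.norm_mk, norm_one, norm_zero, max_eq_left zero_le_one, mul_one]

/-- `‖L ∘ inr‖ ≤ ‖L‖`. [folklore] -/
theorem norm_comp_inr_le (L : ℝ × (EuclideanSpace ℝ ι) →L[ℝ] F) :
    ‖L.comp (ContinuousLinearMap.inr ℝ ℝ (EuclideanSpace ℝ ι))‖ ≤ ‖L‖ := by
  refine ContinuousLinearMap.opNorm_le_bound _ (norm_nonneg _) fun v => ?_
  have hv : ‖(ContinuousLinearMap.inr ℝ ℝ (EuclideanSpace ℝ ι)) v‖ = ‖v‖ := by simp [Prod.norm_def]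
  calc ‖L.comp (ContinuousLinearMap.inr ℝ ℝ (EuclideanSpace ℝ ι)) v‖ = ‖L ((ContinuousLinearMap.inr ℝ ℝ (EuclideanSpace ℝ ι)) v)‖ := rfl
    _ ≤ ‖L‖ * ‖(ContinuousLinearMap.inr ℝ ℝ (EuclideanSpace ℝ ι)) v‖ := L.le_opNorm _
    _ = ‖L‖ * ‖v‖ := by rw [hv]

omit [Fintype ι] in
/-- The slab `[0, t₁) × ℝᵈ` is a neighbourhood of each of its points with `0 < t < t₁`. [folklore] -/
theorem slab_mem_nhds {t₁ t : ℝ} (ht : t ∈ Ioo 0 t₁) (x : (EuclideanSpace ℝ ι)) :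
    (Ico 0 t₁ ×ˢ (univ : Set (EuclideanSpace ℝ ι))) ∈ 𝓝 (t, x) :=
  Filter.mem_of_superset (prod_mem_nhds (Ioo_mem_nhds ht.1 ht.2) univ_mem)
    (prod_mono Ioo_subset_Ico_self le_rfl)

/-- A function `C¹` on the slab `[0,t₁) × ℝᵈ` is differentiable at its points with `0 < t < t₁`,
with derivative the derivative within the slab. [folklore] -/
theorem hasFDerivAt_of_contDiffOn_slab {U : ℝ × (EuclideanSpace ℝ ι) → F} {t₁ t : ℝ}
    (hU : ContDiffOn ℝ 1 U (Ico 0 t₁ ×ˢ univ)) (ht : t ∈ Ioo 0 t₁) (x : (EuclideanSpace ℝ ι)) :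
    HasFDerivAt U (fderivWithin ℝ U (Ico 0 t₁ ×ˢ univ) (t, x)) (t, x) := by
  have hmem : (t, x) ∈ Ico 0 t₁ ×ˢ (univ : Set (EuclideanSpace ℝ ι)) := ⟨Ioo_subset_Ico_self ht, mem_univ _⟩
  have hd : DifferentiableAt ℝ U (t, x) :=
    (hU.differentiableOn one_ne_zero (t, x) hmem).differentiableAt (slab_mem_nhds ht x)
  rw [fderivWithin_of_mem_nhds (slab_mem_nhds ht x)]
  exact hd.hasFDerivAt

/-- The derivative within the slab is continuous on the slab. [folklore] -/
theorem continuousOn_fderivWithin_slab {U : ℝ × (EuclideanSpace ℝ ι) → F} {t₁ : ℝ}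
    (hU : ContDiffOn ℝ 1 U (Ico 0 t₁ ×ˢ univ)) :
    ContinuousOn (fun p => fderivWithin ℝ U (Ico 0 t₁ ×ˢ univ) p) (Ico 0 t₁ ×ˢ univ) :=
  hU.continuousOn_fderivWithin ((uniqueDiffOn_Ico 0 t₁).prod uniqueDiffOn_univ) le_rfl

/-- The time slice `y ↦ U (t, y)` of a function `C¹` on the slab is `C¹` on `ℝᵈ` for `0 < t < t₁`.
[folklore] -/
theorem contDiff_slice_of_contDiffOn_slab {U : ℝ × (EuclideanSpace ℝ ι) → F} {t₁ t : ℝ}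
    (hU : ContDiffOn ℝ 1 U (Ico 0 t₁ ×ˢ univ)) (ht : t ∈ Ioo 0 t₁) :
    ContDiff ℝ 1 fun y => U (t, y) := by
  rw [contDiff_iff_contDiffAt]
  intro y
  have h : ContDiffAt ℝ 1 U (t, y) := (hU (t, y) ⟨Ioo_subset_Ico_self ht, mem_univ _⟩).contDiffAt
    (slab_mem_nhds ht y)
  exact h.comp y (contDiffAt_const.prodMk contDiffAt_id)

/-- Continuity in `y` of the time derivative of a function `C¹` on the slab, at a fixed time
`0 < t < t₁`. [folklore] -/
theorem continuous_fderiv_slice {U : ℝ × (EuclideanSpace ℝ ι) → F} {t₁ t : ℝ}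
    (hU : ContDiffOn ℝ 1 U (Ico 0 t₁ ×ˢ univ)) (ht : t ∈ Ioo 0 t₁) :
    Continuous fun y : (EuclideanSpace ℝ ι) => fderivWithin ℝ U (Ico 0 t₁ ×ˢ univ) (t, y) :=
  (continuousOn_fderivWithin_slab hU).comp_continuous (continuous_const.prodMk continuous_id)
    fun _ => ⟨Ioo_subset_Ico_self ht, mem_univ _⟩

/-- **No boundary terms on `ℝᵈ`.** Integration by parts against a compactly supported factor:
for `f, g : ℝᵈ → ℝ` differentiable, `f` with compact support and all three of `f ∂ᵥg`, `(∂ᵥf) g`,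
`f g` continuous, `∫ f ∂ᵥg = −∫ (∂ᵥf) g` (Mathlib's
`integral_mul_fderiv_eq_neg_fderiv_mul_of_integrable`). [folklore] -/
theorem integral_mul_fderiv_eq_neg {f g : (EuclideanSpace ℝ ι) → ℝ} {v : (EuclideanSpace ℝ ι)} {K : Set (EuclideanSpace ℝ ι)} (hK : IsCompact K)
    (hfK : ∀ x, x ∉ K → f x = 0) (hf'K : ∀ x, x ∉ K → fderiv ℝ f x = 0)
    (hf : Differentiable ℝ f) (hg : Differentiable ℝ g)
    (hc1 : Continuous fun x => fderiv ℝ f x v * g x) (hc2 : Continuous fun x => f x * fderiv ℝ g x v)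
    (hc3 : Continuous fun x => f x * g x) :
    ∫ x, f x * fderiv ℝ g x v = -∫ x, fderiv ℝ f x v * g x := by
  refine integral_mul_fderiv_eq_neg_fderiv_mul_of_integrable ?_ ?_ ?_ (fun x _ => hf x)
    (fun x _ => hg x)
  · refine hc1.integrable_of_hasCompactSupport (HasCompactSupport.intro hK fun x hx => ?_)
    simp [hf'K x hx]
  · refine hc2.integrable_of_hasCompactSupport (HasCompactSupport.intro hK fun x hx => ?_)
    simp [hfK x hx]
  · refine hc3.integrable_of_hasCompactSupport (HasCompactSupport.intro hK fun x hx => ?_)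
    simp [hfK x hx]

/-- `⟪∇f(x), v⟫ = Df(x) v`. [folklore] -/
theorem inner_gradient_eq_fderiv (f : (EuclideanSpace ℝ ι) → ℝ) (x v : (EuclideanSpace ℝ ι)) : ⟪gradient f x, v⟫ = fderiv ℝ f x v := by
  rw [gradient, InnerProductSpace.toDual_symm_apply]

/-- A vector of `ℝᵈ` is the sum of its coordinates times the standard basis vectors. [folklore] -/
theorem sum_coord_smul_single [DecidableEq ι] (x : (EuclideanSpace ℝ ι)) :
    ∑ i, x i • (EuclideanSpace.single i (1 : ℝ) : (EuclideanSpace ℝ ι)) = x := by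
  have h := (EuclideanSpace.basisFun ι ℝ).sum_repr x
  simpa using h

/-- A linear functional evaluated at `w` is `∑ᵢ wᵢ ℓ(eᵢ)`. [folklore] -/
theorem clm_apply_eq_sum [DecidableEq ι] (ℓ : (EuclideanSpace ℝ ι) →L[ℝ] F) (w : (EuclideanSpace ℝ ι)) :
    ℓ w = ∑ i, w i • ℓ (EuclideanSpace.single i 1) := by
  conv_lhs => rw [← sum_coord_smul_single w]
  rw [map_sum]
  simp_rw [map_smul]

/-- `|xᵢ| ≤ ‖x‖` on `ℝᵈ`. [folklore] -/
theorem abs_coord_le_norm (x : (EuclideanSpace ℝ ι)) (i : ι) : |x i| ≤ ‖x‖ := by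
  simpa using PiLp.norm_apply_le x i

/-- The trace `∑ᵢ (A eᵢ)ᵢ` of `A` is bounded by `card ι · ‖A‖`. [folklore] -/
theorem abs_sum_apply_single_le [DecidableEq ι] (A : (EuclideanSpace ℝ ι) →L[ℝ] (EuclideanSpace ℝ ι)) :
    |∑ i, A (EuclideanSpace.single i 1) i| ≤ Fintype.card ι * ‖A‖ := by
  refine (Finset.abs_sum_le_sum_abs _ _).trans ?_
  have h : ∀ i ∈ (Finset.univ : Finset ι), |A (EuclideanSpace.single i 1) i| ≤ ‖A‖ := by
    intro i _
    refine (abs_coord_le_norm _ i).trans ?_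
    refine (A.le_opNorm _).trans ?_
    rw [PiLp.norm_single, norm_one, mul_one]
  refine (Finset.sum_le_sum h).trans ?_
  simp

end Calculus

/-! ### The pointwise energy algebra -/

section Algebra

/-- **The energy identity, pointwise algebra.** At a point where two solutions of the `(u,σ)`-system
have values `a₁, a₂` (velocity), `b₁, b₂` (rescaled sound speed), time derivatives `a₁', a₂', b₁', b₂'`,
space derivatives `A₁, A₂` (of `u`) and `L₁, L₂` (of `σ`, with gradients `g₁, g₂`), the time
derivative of the energy density `e = ½((b₁−b₂)² + |a₁−a₂|²)` of the difference is
`−[s (L₁−L₂) a₁ + ⟪w, (A₁−A₂) a₁⟫] − α b₁ [s tr(A₁−A₂) + (L₁−L₂) w] + q` with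
`w = a₁ − a₂`, `s = b₁ − b₂` and the quadratic remainder
`q = −(1+α) s L₂ w − α s² tr A₂ − ⟪w, A₂ w⟫` (transport + flux + lower order).
[cite: Dafermos2005, §5.2, proof of Thm 5.2.1, (5.2.9)–(5.2.10)] -/
theorem energy_algebra [DecidableEq ι] {α : ℝ} {a₁ a₂ a₁' a₂' g₁ g₂ : (EuclideanSpace ℝ ι)} {b₁ b₂ b₁' b₂' : ℝ}
    {A₁ A₂ : (EuclideanSpace ℝ ι) →L[ℝ] (EuclideanSpace ℝ ι)} {L₁ L₂ : (EuclideanSpace ℝ ι) →L[ℝ] ℝ}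
    (hg₁ : ∀ v, ⟪g₁, v⟫ = L₁ v) (hg₂ : ∀ v, ⟪g₂, v⟫ = L₂ v)
    (hZ₁ : b₁' + L₁ a₁ + α * b₁ * ∑ i, A₁ (EuclideanSpace.single i 1) i = 0)
    (hM₁ : a₁' + A₁ a₁ + (α * b₁) • g₁ = 0)
    (hZ₂ : b₂' + L₂ a₂ + α * b₂ * ∑ i, A₂ (EuclideanSpace.single i 1) i = 0)
    (hM₂ : a₂' + A₂ a₂ + (α * b₂) • g₂ = 0) :
    (b₁ - b₂) * (b₁' - b₂') + ⟪a₁ - a₂, a₁' - a₂'⟫ =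
      -((b₁ - b₂) * ((L₁ - L₂) a₁) + ⟪a₁ - a₂, (A₁ - A₂) a₁⟫) -
        α * b₁ * ((b₁ - b₂) * ∑ i, (A₁ - A₂) (EuclideanSpace.single i 1) i +
          (L₁ - L₂) (a₁ - a₂)) +
      (-(1 + α) * (b₁ - b₂) * L₂ (a₁ - a₂) -
          α * (b₁ - b₂) ^ 2 * ∑ i, A₂ (EuclideanSpace.single i 1) i -
        ⟪a₁ - a₂, A₂ (a₁ - a₂)⟫) := by
  have hb₁ : b₁' = -(L₁ a₁) - α * b₁ * ∑ i, A₁ (EuclideanSpace.single i 1) i := by linarith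
  have hb₂ : b₂' = -(L₂ a₂) - α * b₂ * ∑ i, A₂ (EuclideanSpace.single i 1) i := by linarith
  have ha₁ : a₁' = -(A₁ a₁) - (α * b₁) • g₁ := by
    rw [← sub_eq_zero]; rw [← hM₁]; abel
  have ha₂ : a₂' = -(A₂ a₂) - (α * b₂) • g₂ := by
    rw [← sub_eq_zero]; rw [← hM₂]; abel
  have hsum : ∑ i, (A₁ - A₂) (EuclideanSpace.single i 1) i =
      ∑ i, A₁ (EuclideanSpace.single i 1) i - ∑ i, A₂ (EuclideanSpace.single i 1) i := by
    rw [← Finset.sum_sub_distrib]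
    rfl
  have hg₁' : ∀ v, ⟪v, g₁⟫ = L₁ v := fun v => (real_inner_comm g₁ v).trans (hg₁ v)
  have hg₂' : ∀ v, ⟪v, g₂⟫ = L₂ v := fun v => (real_inner_comm g₂ v).trans (hg₂ v)
  rw [hb₁, hb₂, ha₁, ha₂, hsum]
  simp only [inner_sub_left, inner_sub_right, inner_neg_right, inner_smul_right,
    hg₁', hg₂', map_sub, FunLike.coe_sub, Pi.sub_apply]
  ring

/-- `|s| ‖w‖ ≤ e = ½(s² + ‖w‖²)`. [folklore] -/
theorem abs_mul_norm_le_energy (s : ℝ) (w : (EuclideanSpace ℝ ι)) : |s| * ‖w‖ ≤ (s ^ 2 + ‖w‖ ^ 2) / 2 := by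
  nlinarith [sq_nonneg (|s| - ‖w‖), sq_abs s, norm_nonneg w, abs_nonneg s]

/-- **Bound on the lower-order term.** With `‖A₁‖, ‖A₂‖, ‖L₁‖, ‖L₂‖ ≤ B`, the source term
`Q = tr A₁ · e + α s L₁ w + q` of the energy identity satisfies `|Q| ≤ M e`,
`M = B (card ι + |α| + |1+α| + 2|α| card ι + 2)`. [cite: Dafermos2005, §5.2, proof of Thm 5.2.1] -/
theorem abs_source_le [DecidableEq ι] {α B : ℝ} {w : (EuclideanSpace ℝ ι)} {s : ℝ} {A₁ A₂ : (EuclideanSpace ℝ ι) →L[ℝ] (EuclideanSpace ℝ ι)}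
    {L₁ L₂ : (EuclideanSpace ℝ ι) →L[ℝ] ℝ} (hA₁ : ‖A₁‖ ≤ B) (hA₂ : ‖A₂‖ ≤ B) (hL₁ : ‖L₁‖ ≤ B) (hL₂ : ‖L₂‖ ≤ B) :
    |(∑ i, A₁ (EuclideanSpace.single i 1) i) * ((s ^ 2 + ‖w‖ ^ 2) / 2) + α * s * L₁ w +
        (-(1 + α) * s * L₂ w - α * s ^ 2 * ∑ i, A₂ (EuclideanSpace.single i 1) i - ⟪w, A₂ w⟫)| ≤
      B * (Fintype.card ι + |α| + |1 + α| + 2 * |α| * Fintype.card ι + 2) *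
        ((s ^ 2 + ‖w‖ ^ 2) / 2) := by
  set e : ℝ := (s ^ 2 + ‖w‖ ^ 2) / 2 with he
  set n : ℝ := (Fintype.card ι : ℝ) with hn
  have hB : 0 ≤ B := (norm_nonneg _).trans hA₁
  have he0 : 0 ≤ e := by positivity
  have hsw : |s| * ‖w‖ ≤ e := abs_mul_norm_le_energy s w
  have hs2 : s ^ 2 ≤ 2 * e := by rw [he]; nlinarith [norm_nonneg w]
  have hw2 : ‖w‖ ^ 2 ≤ 2 * e := by rw [he]; nlinarith [sq_nonneg s]
  have htr₁ : |∑ i, A₁ (EuclideanSpace.single i 1) i| ≤ n * B :=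
    (abs_sum_apply_single_le A₁).trans (by rw [hn]; gcongr)
  have htr₂ : |∑ i, A₂ (EuclideanSpace.single i 1) i| ≤ n * B :=
    (abs_sum_apply_single_le A₂).trans (by rw [hn]; gcongr)
  have hL₁w : |L₁ w| ≤ B * ‖w‖ := by
    rw [← Real.norm_eq_abs]; exact (L₁.le_opNorm w).trans (by gcongr)
  have hL₂w : |L₂ w| ≤ B * ‖w‖ := by
    rw [← Real.norm_eq_abs]; exact (L₂.le_opNorm w).trans (by gcongr)
  have hAw : |⟪w, A₂ w⟫| ≤ B * ‖w‖ ^ 2 := by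
    refine (abs_real_inner_le_norm _ _).trans ?_
    calc ‖w‖ * ‖A₂ w‖ ≤ ‖w‖ * (B * ‖w‖) := by
          gcongr; exact (A₂.le_opNorm w).trans (by gcongr)
      _ = B * ‖w‖ ^ 2 := by ring
  -- term by term
  have h1 : |(∑ i, A₁ (EuclideanSpace.single i 1) i) * e| ≤ n * B * e := by
    rw [abs_mul, abs_of_nonneg he0]; gcongr
  have h2 : |α * s * L₁ w| ≤ |α| * B * e := by
    rw [abs_mul, abs_mul]
    calc |α| * |s| * |L₁ w| ≤ |α| * |s| * (B * ‖w‖) := by gcongr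
      _ = |α| * B * (|s| * ‖w‖) := by ring
      _ ≤ |α| * B * e := by gcongr
  have h3 : |-(1 + α) * s * L₂ w| ≤ |1 + α| * B * e := by
    rw [abs_mul, abs_mul, abs_neg]
    calc |1 + α| * |s| * |L₂ w| ≤ |1 + α| * |s| * (B * ‖w‖) := by gcongr
      _ = |1 + α| * B * (|s| * ‖w‖) := by ring
      _ ≤ |1 + α| * B * e := by gcongr
  have h4 : |α * s ^ 2 * ∑ i, A₂ (EuclideanSpace.single i 1) i| ≤ 2 * |α| * n * B * e := by
    rw [abs_mul, abs_mul, abs_of_nonneg (sq_nonneg s)]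
    calc |α| * s ^ 2 * |∑ i, A₂ (EuclideanSpace.single i 1) i| ≤ |α| * (2 * e) * (n * B) := by
          gcongr
      _ = 2 * |α| * n * B * e := by ring
  have h5 : |⟪w, A₂ w⟫| ≤ 2 * B * e := by
    calc |⟪w, A₂ w⟫| ≤ B * ‖w‖ ^ 2 := hAw
      _ ≤ B * (2 * e) := by gcongr
      _ = 2 * B * e := by ring
  calc |(∑ i, A₁ (EuclideanSpace.single i 1) i) * e + α * s * L₁ w +
        (-(1 + α) * s * L₂ w - α * s ^ 2 * ∑ i, A₂ (EuclideanSpace.single i 1) i - ⟪w, A₂ w⟫)|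
      ≤ |(∑ i, A₁ (EuclideanSpace.single i 1) i) * e| + |α * s * L₁ w| +
        (|-(1 + α) * s * L₂ w| + |α * s ^ 2 * ∑ i, A₂ (EuclideanSpace.single i 1) i| +
          |⟪w, A₂ w⟫|) := by
        refine (abs_add_le _ _).trans (add_le_add (abs_add_le _ _) ?_)
        exact (abs_sub _ _).trans (add_le_add (abs_sub _ _) le_rfl)
    _ ≤ n * B * e + |α| * B * e + (|1 + α| * B * e + 2 * |α| * n * B * e + 2 * B * e) := by
        gcongr
    _ = B * (n + |α| + |1 + α| + 2 * |α| * n + 2) * e := by ring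

/-- **Sign of the boundary flux.** If `∂ₜΦ + c ‖∇Φ‖ ≤ 0` and `‖a₁‖ + |α b₁| ≤ c`, then
`(∂ₜΦ) e + (∇Φ·a₁) e + α b₁ s (∇Φ·w) ≤ 0` (`e = ½(s² + |w|²)`): the lateral boundary of the cone
recedes faster than the characteristic speed. [cite: Dafermos2005, §5.2, proof of Thm 5.2.1, (5.2.5) and (5.2.13)] -/
theorem flux_nonpos {α c Φt : ℝ} {D : (EuclideanSpace ℝ ι) →L[ℝ] ℝ} {a₁ w : (EuclideanSpace ℝ ι)} {b₁ s : ℝ}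
    (hΦ : Φt + c * ‖D‖ ≤ 0) (hc : ‖a₁‖ + |α * b₁| ≤ c) :
    Φt * ((s ^ 2 + ‖w‖ ^ 2) / 2) + D a₁ * ((s ^ 2 + ‖w‖ ^ 2) / 2) + α * b₁ * s * D w ≤ 0 := by
  set e : ℝ := (s ^ 2 + ‖w‖ ^ 2) / 2 with he
  have he0 : 0 ≤ e := by positivity
  have hsw : |s| * ‖w‖ ≤ e := abs_mul_norm_le_energy s w
  have h1 : D a₁ * e ≤ ‖D‖ * ‖a₁‖ * e := by
    gcongr
    exact (le_abs_self _).trans (by simpa [Real.norm_eq_abs] using D.le_opNorm a₁)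
  have h2 : α * b₁ * s * D w ≤ |α * b₁| * ‖D‖ * e := by
    calc α * b₁ * s * D w ≤ |α * b₁ * s * D w| := le_abs_self _
      _ = |α * b₁| * (|s| * |D w|) := by rw [abs_mul, abs_mul]; ring
      _ ≤ |α * b₁| * (|s| * (‖D‖ * ‖w‖)) := by
          gcongr; simpa [Real.norm_eq_abs] using D.le_opNorm w
      _ = |α * b₁| * ‖D‖ * (|s| * ‖w‖) := by ring
      _ ≤ |α * b₁| * ‖D‖ * e := by gcongr
  calc Φt * e + D a₁ * e + α * b₁ * s * D w ≤ Φt * e + ‖D‖ * ‖a₁‖ * e + |α * b₁| * ‖D‖ * e := by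
        linarith
    _ = (Φt + (‖a₁‖ + |α * b₁|) * ‖D‖) * e := by ring
    _ ≤ (Φt + c * ‖D‖) * e := by gcongr
    _ ≤ 0 := mul_nonpos_of_nonpos_of_nonneg hΦ he0

end Algebra

/-! ### Functions `C¹` on the slab `[0, t₁) × ℝᵈ`: partial derivatives and uniform bounds -/

section Slab

variable {F : Type*} [NormedAddCommGroup F] [NormedSpace ℝ F]

/-- Time derivative of a (curried) function `C¹` on the slab, at `0 < t < t₁`. [folklore] -/
theorem hasDerivAt_time {u : ℝ → (EuclideanSpace ℝ ι) → F} {t₁ t : ℝ}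
    (hu : ContDiffOn ℝ 1 (fun p : ℝ × (EuclideanSpace ℝ ι) => u p.1 p.2) (Ico 0 t₁ ×ˢ univ)) (ht : t ∈ Ioo 0 t₁)
    (x : (EuclideanSpace ℝ ι)) :
    HasDerivAt (fun τ => u τ x)
      (fderivWithin ℝ (fun p : ℝ × (EuclideanSpace ℝ ι) => u p.1 p.2) (Ico 0 t₁ ×ˢ univ) (t, x) (1, 0)) t :=
  hasDerivAt_slice_left (hasFDerivAt_of_contDiffOn_slab hu ht x)

/-- Space derivative of a (curried) function `C¹` on the slab, at `0 < t < t₁`. [folklore] -/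
theorem hasFDerivAt_space {u : ℝ → (EuclideanSpace ℝ ι) → F} {t₁ t : ℝ}
    (hu : ContDiffOn ℝ 1 (fun p : ℝ × (EuclideanSpace ℝ ι) => u p.1 p.2) (Ico 0 t₁ ×ˢ univ)) (ht : t ∈ Ioo 0 t₁)
    (x : (EuclideanSpace ℝ ι)) :
    HasFDerivAt (u t)
      ((fderivWithin ℝ (fun p : ℝ × (EuclideanSpace ℝ ι) => u p.1 p.2) (Ico 0 t₁ ×ˢ univ) (t, x)).comp
        (ContinuousLinearMap.inr ℝ ℝ (EuclideanSpace ℝ ι))) x :=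
  hasFDerivAt_slice_right (hasFDerivAt_of_contDiffOn_slab hu ht x)

/-- The time slice `u t` of a function `C¹` on the slab is `C¹`, `0 < t < t₁`. [folklore] -/
theorem contDiff_space {u : ℝ → (EuclideanSpace ℝ ι) → F} {t₁ t : ℝ}
    (hu : ContDiffOn ℝ 1 (fun p : ℝ × (EuclideanSpace ℝ ι) => u p.1 p.2) (Ico 0 t₁ ×ˢ univ)) (ht : t ∈ Ioo 0 t₁) :
    ContDiff ℝ 1 (u t) :=
  contDiff_slice_of_contDiffOn_slab hu ht

/-- The time slice `u t` of a function `C¹` on the slab is continuous for every `0 ≤ t < t₁`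
(including `t = 0`). [folklore] -/
theorem continuous_space {u : ℝ → (EuclideanSpace ℝ ι) → F} {t₁ t : ℝ}
    (hu : ContDiffOn ℝ 1 (fun p : ℝ × (EuclideanSpace ℝ ι) => u p.1 p.2) (Ico 0 t₁ ×ˢ univ)) (ht : t ∈ Ico 0 t₁) :
    Continuous (u t) :=
  hu.continuousOn.comp_continuous (continuous_const.prodMk continuous_id)
    fun _ => ⟨ht, mem_univ _⟩

/-- Continuity in `x` of the time derivative, `0 < t < t₁`. [folklore] -/
theorem continuous_deriv_time {u : ℝ → (EuclideanSpace ℝ ι) → F} {t₁ t : ℝ}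
    (hu : ContDiffOn ℝ 1 (fun p : ℝ × (EuclideanSpace ℝ ι) => u p.1 p.2) (Ico 0 t₁ ×ˢ univ)) (ht : t ∈ Ioo 0 t₁) :
    Continuous fun x => deriv (fun τ => u τ x) t := by
  have h : (fun x => deriv (fun τ => u τ x) t) = fun x =>
      fderivWithin ℝ (fun p : ℝ × (EuclideanSpace ℝ ι) => u p.1 p.2) (Ico 0 t₁ ×ˢ univ) (t, x) (1, 0) :=
    funext fun x => (hasDerivAt_time hu ht x).deriv
  rw [h]
  exact (continuous_fderiv_slice hu ht).clm_apply continuous_const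

/-- Continuity in `t` of a slice `τ ↦ u τ x` on `[0, t₁)`. [folklore] -/
theorem continuousOn_time {u : ℝ → (EuclideanSpace ℝ ι) → F} {t₁ : ℝ}
    (hu : ContDiffOn ℝ 1 (fun p : ℝ × (EuclideanSpace ℝ ι) => u p.1 p.2) (Ico 0 t₁ ×ˢ univ)) (x : (EuclideanSpace ℝ ι)) :
    ContinuousOn (fun τ => u τ x) (Ico 0 t₁) :=
  hu.continuousOn.comp (continuous_id.prodMk continuous_const).continuousOn
    fun _ hτ => ⟨hτ, mem_univ _⟩

/-- Joint continuity on the open slab of the time derivative. [folklore] -/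
theorem continuousOn_deriv_time {u : ℝ → (EuclideanSpace ℝ ι) → F} {t₁ : ℝ}
    (hu : ContDiffOn ℝ 1 (fun p : ℝ × (EuclideanSpace ℝ ι) => u p.1 p.2) (Ico 0 t₁ ×ˢ univ)) :
    ContinuousOn (fun p : ℝ × (EuclideanSpace ℝ ι) => deriv (fun τ => u τ p.2) p.1) (Ioo 0 t₁ ×ˢ univ) := by
  have h : ∀ p ∈ Ioo 0 t₁ ×ˢ (univ : Set (EuclideanSpace ℝ ι)), deriv (fun τ => u τ p.2) p.1 =
      fderivWithin ℝ (fun p : ℝ × (EuclideanSpace ℝ ι) => u p.1 p.2) (Ico 0 t₁ ×ˢ univ) p (1, 0) :=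
    fun p hp => (hasDerivAt_time hu hp.1 p.2).deriv
  refine ContinuousOn.congr ?_ h
  exact ((continuousOn_fderivWithin_slab hu).mono (prod_mono Ioo_subset_Ico_self le_rfl)).clm_apply
    continuousOn_const

/-- Joint continuity on the open slab of the space derivative. [folklore] -/
theorem continuousOn_fderiv_space {u : ℝ → (EuclideanSpace ℝ ι) → F} {t₁ : ℝ}
    (hu : ContDiffOn ℝ 1 (fun p : ℝ × (EuclideanSpace ℝ ι) => u p.1 p.2) (Ico 0 t₁ ×ˢ univ)) :
    ContinuousOn (fun p : ℝ × (EuclideanSpace ℝ ι) => fderiv ℝ (u p.1) p.2) (Ioo 0 t₁ ×ˢ univ) := by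
  have h : ∀ p ∈ Ioo 0 t₁ ×ˢ (univ : Set (EuclideanSpace ℝ ι)), fderiv ℝ (u p.1) p.2 =
      (fderivWithin ℝ (fun p : ℝ × (EuclideanSpace ℝ ι) => u p.1 p.2) (Ico 0 t₁ ×ˢ univ) p).comp
        (ContinuousLinearMap.inr ℝ ℝ (EuclideanSpace ℝ ι)) :=
    fun p hp => (hasFDerivAt_space hu hp.1 p.2).fderiv
  refine ContinuousOn.congr ?_ h
  exact ((ContinuousLinearMap.compL ℝ (EuclideanSpace ℝ ι) (ℝ × (EuclideanSpace ℝ ι)) F).flip (ContinuousLinearMap.inr ℝ ℝ (EuclideanSpace ℝ ι))).continuous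
    |>.comp_continuousOn ((continuousOn_fderivWithin_slab hu).mono (prod_mono Ioo_subset_Ico_self le_rfl))

/-- **Uniform bounds up to `t = 0`.** A function `C¹` on the slab `[0,t₁) × ℝᵈ`, its time derivative
and its space derivative are bounded on `(0, τ] × B̄(x₀, R)` for every `τ < t₁` (continuity of the
derivative within the slab on the compact `[0, τ] × B̄(x₀, R)`). [folklore] -/
theorem exists_bound_slab {u : ℝ → (EuclideanSpace ℝ ι) → F} {t₁ τ : ℝ}
    (hu : ContDiffOn ℝ 1 (fun p : ℝ × (EuclideanSpace ℝ ι) => u p.1 p.2) (Ico 0 t₁ ×ˢ univ)) (hτ : τ < t₁) (x₀ : (EuclideanSpace ℝ ι))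
    (R : ℝ) :
    ∃ B : ℝ, 0 ≤ B ∧ ∀ t ∈ Icc 0 τ, ∀ x ∈ closedBall x₀ R, ‖u t x‖ ≤ B ∧
      (t ∈ Ioo 0 t₁ → ‖deriv (fun s => u s x) t‖ ≤ B ∧ ‖fderiv ℝ (u t) x‖ ≤ B) := by
  set S : Set (ℝ × (EuclideanSpace ℝ ι)) := Ico 0 t₁ ×ˢ univ with hS
  set K : Set (ℝ × (EuclideanSpace ℝ ι)) := Icc 0 τ ×ˢ closedBall x₀ R with hK
  have hKc : IsCompact K := isCompact_Icc.prod (isCompact_closedBall x₀ R)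
  have hKS : K ⊆ S := prod_mono (Icc_subset_Ico_right hτ) (subset_univ _)
  obtain ⟨B₁, hB₁⟩ := hKc.exists_bound_of_continuousOn (hu.continuousOn.mono hKS)
  obtain ⟨B₂, hB₂⟩ := hKc.exists_bound_of_continuousOn ((continuousOn_fderivWithin_slab hu).mono hKS)
  refine ⟨max (max B₁ B₂) 0, le_max_right _ _, fun t ht x hx => ?_⟩
  have hmem : (t, x) ∈ K := ⟨ht, hx⟩
  refine ⟨(hB₁ _ hmem).trans ((le_max_left _ _).trans (le_max_left _ _)), fun ht' => ⟨?_, ?_⟩⟩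
  · rw [(hasDerivAt_time hu ht' x).deriv]
    exact ((norm_apply_one_zero_le _).trans (hB₂ _ hmem)).trans
      ((le_max_right _ _).trans (le_max_left _ _))
  · rw [(hasFDerivAt_space hu ht' x).fderiv]
    exact ((norm_comp_inr_le _).trans (hB₂ _ hmem)).trans
      ((le_max_right _ _).trans (le_max_left _ _))

end Slab

/-! ### The smooth cone weight `Φ_ε(t, x) = χ(R − ct − (ε² + |x − x₀|²)^{1/2})` -/

section Weight

/-- `‖z‖ ≤ (ε² + ‖z‖²)^{1/2}`. [folklore] -/
theorem norm_le_sqrt_sq_add (ε : ℝ) (z : (EuclideanSpace ℝ ι)) : ‖z‖ ≤ √(ε ^ 2 + ‖z‖ ^ 2) :=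
  (Real.le_sqrt (norm_nonneg z) (by positivity)).2 (by nlinarith [sq_nonneg ε])

/-- The cone weight is `C¹` (indeed smooth) for `ε ≠ 0`. [folklore] -/
theorem contDiff_coneWeight {ε c R : ℝ} {x₀ : (EuclideanSpace ℝ ι)} (hε : ε ≠ 0) :
    ContDiff ℝ 1 fun p : ℝ × (EuclideanSpace ℝ ι) =>
      Real.smoothTransition (R - c * p.1 - √(ε ^ 2 + ‖p.2 - x₀‖ ^ 2)) := by
  refine Real.smoothTransition.contDiff.comp ?_
  refine ((contDiff_const.sub (contDiff_const.mul contDiff_fst)).sub ?_)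
  refine ContDiff.sqrt (contDiff_const.add ((contDiff_norm_sq ℝ).comp (contDiff_snd.sub contDiff_const)))
    fun p => ?_
  positivity

/-- The cone weight is nonnegative. [folklore] -/
theorem coneWeight_nonneg (ε c R : ℝ) (x₀ : (EuclideanSpace ℝ ι)) (p : ℝ × (EuclideanSpace ℝ ι)) :
    0 ≤ Real.smoothTransition (R - c * p.1 - √(ε ^ 2 + ‖p.2 - x₀‖ ^ 2)) :=
  Real.smoothTransition.nonneg _

/-- The cone weight is supported in the open cone `‖x − x₀‖ + ct < R`. [folklore] -/
theorem cone_of_coneWeight_ne_zero {ε c R : ℝ} {x₀ : (EuclideanSpace ℝ ι)} {p : ℝ × (EuclideanSpace ℝ ι)}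
    (h : Real.smoothTransition (R - c * p.1 - √(ε ^ 2 + ‖p.2 - x₀‖ ^ 2)) ≠ 0) :
    ‖p.2 - x₀‖ + c * p.1 < R := by
  have h1 : ¬(R - c * p.1 - √(ε ^ 2 + ‖p.2 - x₀‖ ^ 2) ≤ 0) := fun h' =>
    h (Real.smoothTransition.zero_of_nonpos h')
  have h2 := norm_le_sqrt_sq_add ε (p.2 - x₀)
  linarith

/-- The cone weight is positive at `(t, x)` with `‖x − x₀‖ + ct < R` once `ε` is small:
`ε = (R − ct − ‖x − x₀‖)/2` will do. [folklore] -/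
theorem coneWeight_pos {c R : ℝ} {x₀ : (EuclideanSpace ℝ ι)} {p : ℝ × (EuclideanSpace ℝ ι)} (h : ‖p.2 - x₀‖ + c * p.1 < R) :
    0 < Real.smoothTransition
      (R - c * p.1 - √(((R - c * p.1 - ‖p.2 - x₀‖) / 2) ^ 2 + ‖p.2 - x₀‖ ^ 2)) := by
  refine Real.smoothTransition.pos_of_pos ?_
  set δ : ℝ := (R - c * p.1 - ‖p.2 - x₀‖) / 2 with hδ
  have hδ0 : 0 < δ := by rw [hδ]; linarith
  have hs : √(δ ^ 2 + ‖p.2 - x₀‖ ^ 2) ≤ δ + ‖p.2 - x₀‖ := by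
    rw [Real.sqrt_le_iff]
    constructor
    · positivity
    · nlinarith [norm_nonneg (p.2 - x₀)]
  linarith

/-- **The derivative of the cone weight.** [folklore] -/
theorem hasFDerivAt_coneWeight {ε c R : ℝ} {x₀ : (EuclideanSpace ℝ ι)} (hε : ε ≠ 0) (p : ℝ × (EuclideanSpace ℝ ι)) :
    HasFDerivAt (fun q : ℝ × (EuclideanSpace ℝ ι) => Real.smoothTransition (R - c * q.1 - √(ε ^ 2 + ‖q.2 - x₀‖ ^ 2)))
      (deriv Real.smoothTransition (R - c * p.1 - √(ε ^ 2 + ‖p.2 - x₀‖ ^ 2)) •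
        (-(c • ContinuousLinearMap.fst ℝ ℝ (EuclideanSpace ℝ ι)) -
          (1 / (2 * √(ε ^ 2 + ‖p.2 - x₀‖ ^ 2))) •
            ((2 : ℕ) • (innerSL ℝ (p.2 - x₀)).comp (ContinuousLinearMap.snd ℝ ℝ (EuclideanSpace ℝ ι))))) p := by
  have hpos : 0 < ε ^ 2 + ‖p.2 - x₀‖ ^ 2 := by positivity
  have h1 : HasFDerivAt (fun q : ℝ × (EuclideanSpace ℝ ι) => ‖q.2 - x₀‖ ^ 2)
      ((2 : ℕ) • (innerSL ℝ (p.2 - x₀)).comp (ContinuousLinearMap.snd ℝ ℝ (EuclideanSpace ℝ ι))) p :=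
    ((hasFDerivAt_snd (p := p)).sub_const x₀).norm_sq
  have h2 : HasFDerivAt (fun q : ℝ × (EuclideanSpace ℝ ι) => ε ^ 2 + ‖q.2 - x₀‖ ^ 2)
      ((2 : ℕ) • (innerSL ℝ (p.2 - x₀)).comp (ContinuousLinearMap.snd ℝ ℝ (EuclideanSpace ℝ ι))) p :=
    h1.const_add _
  have h3 := h2.sqrt hpos.ne'
  have h4 : HasFDerivAt (fun q : ℝ × (EuclideanSpace ℝ ι) => R - c * q.1) (-(c • ContinuousLinearMap.fst ℝ ℝ (EuclideanSpace ℝ ι))) p := by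
    have hf : HasFDerivAt (fun q : ℝ × (EuclideanSpace ℝ ι) => q.1) (ContinuousLinearMap.fst ℝ ℝ (EuclideanSpace ℝ ι)) p := hasFDerivAt_fst
    have := (hf.const_smul c).const_sub R
    simpa [smul_eq_mul] using this
  have h5 := h4.sub h3
  have hχ : HasDerivAt Real.smoothTransition
      (deriv Real.smoothTransition (R - c * p.1 - √(ε ^ 2 + ‖p.2 - x₀‖ ^ 2)))
      (R - c * p.1 - √(ε ^ 2 + ‖p.2 - x₀‖ ^ 2)) :=
    ((Real.smoothTransition.contDiff (n := 1)).differentiable one_ne_zero _).hasDerivAt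
  exact hχ.comp_hasFDerivAt p h5

/-- **The cone weight recedes at speed `c`:** `∂ₜΦ + c ‖∇ₓΦ‖ ≤ 0` for `c ≥ 0`. [folklore] -/
theorem coneWeight_flux_le {ε c R : ℝ} {x₀ : (EuclideanSpace ℝ ι)} (hε : ε ≠ 0) (hc : 0 ≤ c) (p : ℝ × (EuclideanSpace ℝ ι)) :
    fderiv ℝ (fun q : ℝ × (EuclideanSpace ℝ ι) => Real.smoothTransition (R - c * q.1 - √(ε ^ 2 + ‖q.2 - x₀‖ ^ 2)))
        p (1, 0) +
      c * ‖(fderiv ℝ (fun q : ℝ × (EuclideanSpace ℝ ι) =>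
          Real.smoothTransition (R - c * q.1 - √(ε ^ 2 + ‖q.2 - x₀‖ ^ 2))) p).comp
            (ContinuousLinearMap.inr ℝ ℝ (EuclideanSpace ℝ ι))‖ ≤ 0 := by
  rw [(hasFDerivAt_coneWeight (c := c) (R := R) (x₀ := x₀) hε p).fderiv]
  set χ' : ℝ := deriv Real.smoothTransition (R - c * p.1 - √(ε ^ 2 + ‖p.2 - x₀‖ ^ 2)) with hχ'
  set N : ℝ := √(ε ^ 2 + ‖p.2 - x₀‖ ^ 2) with hN
  have hχ0 : 0 ≤ χ' := Real.smoothTransition.monotone.deriv_nonneg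
  have hN0 : 0 < N := Real.sqrt_pos.mpr (by positivity)
  have hzN : ‖p.2 - x₀‖ ≤ N := norm_le_sqrt_sq_add ε _
  -- the time derivative
  have ht : (χ' • (-(c • ContinuousLinearMap.fst ℝ ℝ (EuclideanSpace ℝ ι)) -
      (1 / (2 * N)) • ((2 : ℕ) • (innerSL ℝ (p.2 - x₀)).comp (ContinuousLinearMap.snd ℝ ℝ (EuclideanSpace ℝ ι)))))
        ((1 : ℝ), (0 : (EuclideanSpace ℝ ι))) = -(c * χ') := by
    simp
    ring
  -- the space derivative
  have hx : ‖(χ' • (-(c • ContinuousLinearMap.fst ℝ ℝ (EuclideanSpace ℝ ι)) -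
      (1 / (2 * N)) • ((2 : ℕ) • (innerSL ℝ (p.2 - x₀)).comp (ContinuousLinearMap.snd ℝ ℝ (EuclideanSpace ℝ ι))))).comp
        (ContinuousLinearMap.inr ℝ ℝ (EuclideanSpace ℝ ι))‖ ≤ χ' := by
    refine ContinuousLinearMap.opNorm_le_bound _ hχ0 fun v => ?_
    have hv : ((χ' • (-(c • ContinuousLinearMap.fst ℝ ℝ (EuclideanSpace ℝ ι)) -
        (1 / (2 * N)) • ((2 : ℕ) • (innerSL ℝ (p.2 - x₀)).comp (ContinuousLinearMap.snd ℝ ℝ (EuclideanSpace ℝ ι))))).comp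
          (ContinuousLinearMap.inr ℝ ℝ (EuclideanSpace ℝ ι))) v = -(χ' * (⟪p.2 - x₀, v⟫ / N)) := by
      simp [inner_sub_left]
      left
      field_simp
    rw [hv, norm_neg, norm_mul, Real.norm_of_nonneg hχ0]
    gcongr
    rw [norm_div, Real.norm_of_nonneg hN0.le, div_le_iff₀ hN0]
    calc ‖⟪p.2 - x₀, v⟫‖ ≤ ‖p.2 - x₀‖ * ‖v‖ := norm_inner_le_norm _ _
      _ ≤ N * ‖v‖ := by gcongr
      _ = ‖v‖ * N := mul_comm _ _
  rw [ht]
  nlinarith [mul_le_mul_of_nonneg_left hx hc]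

end Weight

/-! ### Spatial integration by parts at a fixed time -/

section Spatial

variable [DecidableEq ι]

omit [DecidableEq ι] in
/-- The derivative of a nonnegative differentiable function vanishes at its zeros. [folklore] -/
theorem fderiv_eq_zero_of_nonneg {X : Type*} [NormedAddCommGroup X] [NormedSpace ℝ X] {f : X → ℝ}
    (h0 : ∀ y, 0 ≤ f y) {y : X} (hy : f y = 0) : fderiv ℝ f y = 0 :=
  IsLocalMin.fderiv_eq_zero (Filter.Eventually.of_forall fun z => by rw [hy]; exact h0 z)

omit [DecidableEq ι] in
/-- A function vanishing for `‖y − x₀‖ > R` has vanishing derivative there. [folklore] -/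
theorem fderiv_eq_zero_of_far {F : Type*} [NormedAddCommGroup F] [NormedSpace ℝ F] {f : (EuclideanSpace ℝ ι) → F}
    {x₀ : (EuclideanSpace ℝ ι)} {R : ℝ} (h0 : ∀ y, R < ‖y - x₀‖ → f y = 0) {y : (EuclideanSpace ℝ ι)} (hy : R < ‖y - x₀‖) :
    fderiv ℝ f y = 0 := by
  have hO : IsOpen {z : (EuclideanSpace ℝ ι) | R < ‖z - x₀‖} := isOpen_lt continuous_const (continuous_id.sub continuous_const).norm
  have h : f =ᶠ[𝓝 y] fun _ => 0 := Filter.eventually_of_mem (hO.mem_nhds hy) fun z hz => h0 z hz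
  rw [h.fderiv_eq]; simp

omit [DecidableEq ι] in
/-- A continuous function vanishing for `‖y − x₀‖ > R` is integrable. [folklore] -/
theorem integrable_of_far {F : Type*} [NormedAddCommGroup F] [NormedSpace ℝ F] {f : (EuclideanSpace ℝ ι) → F}
    {x₀ : (EuclideanSpace ℝ ι)} {R : ℝ} (hf : Continuous f) (h0 : ∀ y, R < ‖y - x₀‖ → f y = 0) : Integrable f :=
  hf.integrable_of_hasCompactSupport (HasCompactSupport.intro (isCompact_closedBall x₀ R)
    fun y hy => h0 y (by rwa [mem_closedBall, dist_eq_norm, not_le] at hy))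

omit [DecidableEq ι] in
/-- **The derivative of the energy density** `e = ½((b₁−b₂)² + |a₁−a₂|²)`:
`De = (b₁−b₂) (Db₁ − Db₂) + ⟪a₁ − a₂, (Da₁ − Da₂) ·⟫`. [folklore] -/
theorem hasFDerivAt_energy {a₁ a₂ : (EuclideanSpace ℝ ι) → (EuclideanSpace ℝ ι)} {b₁ b₂ : (EuclideanSpace ℝ ι) → ℝ} {A₁ A₂ : (EuclideanSpace ℝ ι) →L[ℝ] (EuclideanSpace ℝ ι)}
    {L₁ L₂ : (EuclideanSpace ℝ ι) →L[ℝ] ℝ} {y : (EuclideanSpace ℝ ι)} (ha₁ : HasFDerivAt a₁ A₁ y) (ha₂ : HasFDerivAt a₂ A₂ y)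
    (hb₁ : HasFDerivAt b₁ L₁ y) (hb₂ : HasFDerivAt b₂ L₂ y) :
    HasFDerivAt (fun z => ((b₁ z - b₂ z) ^ 2 + ‖a₁ z - a₂ z‖ ^ 2) / 2)
      ((b₁ y - b₂ y) • (L₁ - L₂) + (innerSL ℝ (a₁ y - a₂ y)).comp (A₁ - A₂)) y := by
  have hs := hb₁.sub hb₂
  have hs2 := hs.mul hs
  have hw2 := (ha₁.sub ha₂).norm_sq
  have h := (hs2.add hw2).const_smul (1 / 2 : ℝ)
  have hfun : (fun z => ((b₁ z - b₂ z) ^ 2 + ‖a₁ z - a₂ z‖ ^ 2) / 2) =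
      fun z => (1 / 2 : ℝ) • ((b₁ z - b₂ z) * (b₁ z - b₂ z) + ‖a₁ z - a₂ z‖ ^ 2) := by
    funext z; simp only [smul_eq_mul]; ring
  rw [hfun]
  refine h.congr_fderiv ?_
  ext v
  simp only [smul_apply, add_apply, ContinuousLinearMap.coe_comp, Function.comp_apply,
    innerSL_apply_apply, smul_eq_mul, Pi.sub_apply, FunLike.coe_sub, nsmul_eq_mul, Nat.cast_ofNat]
  ring

omit [DecidableEq ι] in
/-- The energy density of `C¹` fields is `C¹`. [folklore] -/
theorem contDiff_energy {a₁ a₂ : (EuclideanSpace ℝ ι) → (EuclideanSpace ℝ ι)} {b₁ b₂ : (EuclideanSpace ℝ ι) → ℝ} (ha₁ : ContDiff ℝ 1 a₁)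
    (ha₂ : ContDiff ℝ 1 a₂) (hb₁ : ContDiff ℝ 1 b₁) (hb₂ : ContDiff ℝ 1 b₂) :
    ContDiff ℝ 1 fun z => ((b₁ z - b₂ z) ^ 2 + ‖a₁ z - a₂ z‖ ^ 2) / 2 :=
  (((hb₁.sub hb₂).pow 2).add ((ha₁.sub ha₂).norm_sq ℝ)).div_const _

/-- **Integration by parts of the transport term.** For `φ ∈ C¹` vanishing for `‖y − x₀‖ > R` and
`C¹` fields, `∫ φ De(a₁) = −∫ (Dφ(a₁) + φ div a₁) e`. [cite: Dafermos2005, §5.2, proof of Thm 5.2.1, (5.2.7)] -/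
theorem integral_transport {φ : (EuclideanSpace ℝ ι) → ℝ} {a₁ a₂ : (EuclideanSpace ℝ ι) → (EuclideanSpace ℝ ι)} {b₁ b₂ : (EuclideanSpace ℝ ι) → ℝ} {x₀ : (EuclideanSpace ℝ ι)} {R : ℝ}
    (hφ : ContDiff ℝ 1 φ) (hφ0 : ∀ y, R < ‖y - x₀‖ → φ y = 0) (ha₁ : ContDiff ℝ 1 a₁)
    (ha₂ : ContDiff ℝ 1 a₂) (hb₁ : ContDiff ℝ 1 b₁) (hb₂ : ContDiff ℝ 1 b₂) :
    ∫ y, φ y * ((b₁ y - b₂ y) * (fderiv ℝ b₁ y - fderiv ℝ b₂ y) (a₁ y) +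
        ⟪a₁ y - a₂ y, (fderiv ℝ a₁ y - fderiv ℝ a₂ y) (a₁ y)⟫) =
      -∫ y, (fderiv ℝ φ y (a₁ y) + φ y * ∑ i, fderiv ℝ a₁ y (EuclideanSpace.single i 1) i) *
        (((b₁ y - b₂ y) ^ 2 + ‖a₁ y - a₂ y‖ ^ 2) / 2) := by
  set e : (EuclideanSpace ℝ ι) → ℝ := fun z => ((b₁ z - b₂ z) ^ 2 + ‖a₁ z - a₂ z‖ ^ 2) / 2 with he
  have he1 : ContDiff ℝ 1 e := contDiff_energy ha₁ ha₂ hb₁ hb₂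
  have hed : Differentiable ℝ e := he1.differentiable one_ne_zero
  have hφd : Differentiable ℝ φ := hφ.differentiable one_ne_zero
  have ha₁d : Differentiable ℝ a₁ := ha₁.differentiable one_ne_zero
  have ha₂d : Differentiable ℝ a₂ := ha₂.differentiable one_ne_zero
  have hb₁d : Differentiable ℝ b₁ := hb₁.differentiable one_ne_zero
  have hb₂d : Differentiable ℝ b₂ := hb₂.differentiable one_ne_zero
  have hfe : ∀ y, fderiv ℝ e y = (b₁ y - b₂ y) • (fderiv ℝ b₁ y - fderiv ℝ b₂ y) +
      (innerSL ℝ (a₁ y - a₂ y)).comp (fderiv ℝ a₁ y - fderiv ℝ a₂ y) := fun y =>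
    (hasFDerivAt_energy (ha₁d y).hasFDerivAt (ha₂d y).hasFDerivAt (hb₁d y).hasFDerivAt
      (hb₂d y).hasFDerivAt).fderiv
  -- the coordinate functions `φ a₁ⱼ`
  have hf1 : ∀ j, ContDiff ℝ 1 fun y => φ y * a₁ y j := fun j =>
    hφ.mul (contDiff_euclidean.1 ha₁ j)
  have hproj : ∀ j y, HasFDerivAt (fun y => a₁ y j)
      (PiLp.proj 2 (fun _ : ι => ℝ) j ∘L fderiv ℝ a₁ y) y := fun j y => by
    have h := (ha₁d y).hasFDerivAt
    rw [← hasFDerivWithinAt_univ, hasFDerivWithinAt_euclidean] at h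
    exact hasFDerivWithinAt_univ.1 (h j)
  have hfd : ∀ j y, HasFDerivAt (fun y => φ y * a₁ y j)
      (φ y • (PiLp.proj 2 (fun _ : ι => ℝ) j ∘L fderiv ℝ a₁ y) + a₁ y j • fderiv ℝ φ y) y :=
    fun j y => (hφd y).hasFDerivAt.mul (hproj j y)
  have hf0 : ∀ j y, R < ‖y - x₀‖ → φ y * a₁ y j = 0 := fun j y hy => by rw [hφ0 y hy, zero_mul]
  -- continuity facts
  have hec : Continuous e := he1.continuous
  have hfec : Continuous fun y => fderiv ℝ e y := he1.continuous_fderiv one_ne_zero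
  have hφc : Continuous φ := hφ.continuous
  have hfφc : Continuous fun y => fderiv ℝ φ y := hφ.continuous_fderiv one_ne_zero
  have hfa₁c : Continuous fun y => fderiv ℝ a₁ y := ha₁.continuous_fderiv one_ne_zero
  -- integration by parts, coordinate by coordinate
  have hibp : ∀ j, ∫ y, (φ y * a₁ y j) * fderiv ℝ e y (EuclideanSpace.single j 1) =
      -∫ y, fderiv ℝ (fun y => φ y * a₁ y j) y (EuclideanSpace.single j 1) * e y := by
    intro j
    have hK : ∀ y, y ∉ closedBall x₀ R → R < ‖y - x₀‖ := fun y hy => by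
      rwa [mem_closedBall, dist_eq_norm, not_le] at hy
    exact integral_mul_fderiv_eq_neg (isCompact_closedBall x₀ R) (fun y hy => hf0 j y (hK y hy))
      (fun y hy => fderiv_eq_zero_of_far (hf0 j) (hK y hy)) ((hf1 j).differentiable one_ne_zero) hed
      ((((hf1 j).continuous_fderiv one_ne_zero).clm_apply continuous_const).mul hec)
      ((hf1 j).continuous.mul (hfec.clm_apply continuous_const))
      ((hf1 j).continuous.mul hec)
  -- pointwise: the integrand on the left is `∑ⱼ (φ a₁ⱼ) ∂ⱼe`
  have hL : ∀ y, φ y * ((b₁ y - b₂ y) * (fderiv ℝ b₁ y - fderiv ℝ b₂ y) (a₁ y) +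
      ⟪a₁ y - a₂ y, (fderiv ℝ a₁ y - fderiv ℝ a₂ y) (a₁ y)⟫) =
      ∑ j, (φ y * a₁ y j) * fderiv ℝ e y (EuclideanSpace.single j 1) := by
    intro y
    have h1 := clm_apply_eq_sum (fderiv ℝ e y) (a₁ y)
    have h2 : fderiv ℝ e y (a₁ y) = (b₁ y - b₂ y) * (fderiv ℝ b₁ y - fderiv ℝ b₂ y) (a₁ y) +
        ⟪a₁ y - a₂ y, (fderiv ℝ a₁ y - fderiv ℝ a₂ y) (a₁ y)⟫ := by
      rw [hfe y]
      simp only [smul_apply, add_apply, ContinuousLinearMap.coe_comp, Function.comp_apply,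
        innerSL_apply_apply, smul_eq_mul]
    rw [← h2, h1, Finset.mul_sum]
    refine Finset.sum_congr rfl fun j _ => ?_
    rw [smul_eq_mul]; ring
  -- pointwise: `∑ⱼ ∂ⱼ(φ a₁ⱼ) = Dφ(a₁) + φ div a₁`
  have hR : ∀ y, (fderiv ℝ φ y (a₁ y) + φ y * ∑ i, fderiv ℝ a₁ y (EuclideanSpace.single i 1) i) * e y =
      ∑ j, fderiv ℝ (fun y => φ y * a₁ y j) y (EuclideanSpace.single j 1) * e y := by
    intro y
    rw [← Finset.sum_mul]
    congr 1
    rw [clm_apply_eq_sum (fderiv ℝ φ y) (a₁ y), Finset.mul_sum, ← Finset.sum_add_distrib]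
    refine Finset.sum_congr rfl fun j _ => ?_
    rw [(hfd j y).fderiv]
    simp only [add_apply, smul_apply, ContinuousLinearMap.coe_comp, Function.comp_apply,
      PiLp.proj_apply, smul_eq_mul]
    ring
  -- integrability
  have hK : ∀ y, y ∉ closedBall x₀ R → R < ‖y - x₀‖ := fun y hy => by
    rwa [mem_closedBall, dist_eq_norm, not_le] at hy
  have hi1 : ∀ j, Integrable fun y => (φ y * a₁ y j) * fderiv ℝ e y (EuclideanSpace.single j 1) :=
    fun j => integrable_of_far ((hf1 j).continuous.mul (hfec.clm_apply continuous_const))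
      fun y hy => by rw [hf0 j y hy, zero_mul]
  have hi2 : ∀ j, Integrable fun y =>
      fderiv ℝ (fun y => φ y * a₁ y j) y (EuclideanSpace.single j 1) * e y :=
    fun j => integrable_of_far ((((hf1 j).continuous_fderiv one_ne_zero).clm_apply
      continuous_const).mul hec) fun y hy => by rw [fderiv_eq_zero_of_far (hf0 j) hy]; simp
  calc ∫ y, φ y * ((b₁ y - b₂ y) * (fderiv ℝ b₁ y - fderiv ℝ b₂ y) (a₁ y) +
          ⟪a₁ y - a₂ y, (fderiv ℝ a₁ y - fderiv ℝ a₂ y) (a₁ y)⟫)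
        = ∫ y, ∑ j, (φ y * a₁ y j) * fderiv ℝ e y (EuclideanSpace.single j 1) :=
          integral_congr_ae (Filter.Eventually.of_forall hL)
    _ = ∑ j, ∫ y, (φ y * a₁ y j) * fderiv ℝ e y (EuclideanSpace.single j 1) :=
          integral_finsetSum _ fun j _ => hi1 j
    _ = ∑ j, -∫ y, fderiv ℝ (fun y => φ y * a₁ y j) y (EuclideanSpace.single j 1) * e y :=
          Finset.sum_congr rfl fun j _ => hibp j
    _ = -∫ y, ∑ j, fderiv ℝ (fun y => φ y * a₁ y j) y (EuclideanSpace.single j 1) * e y := by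
          rw [Finset.sum_neg_distrib, integral_finsetSum _ fun j _ => hi2 j]
    _ = _ := by rw [integral_congr_ae (Filter.Eventually.of_forall hR)]

/-- **Integration by parts of the acoustic flux term.** For `φ ∈ C¹` vanishing for `‖y − x₀‖ > R`
and `C¹` fields, `∫ φ b₁ (s div w + Ds(w)) = −∫ (b₁ s Dφ(w) + φ s Db₁(w))`, `w = a₁ − a₂`,
`s = b₁ − b₂`. [cite: Dafermos2005, §5.2, proof of Thm 5.2.1, (5.2.7)] -/
theorem integral_flux {φ : (EuclideanSpace ℝ ι) → ℝ} {a₁ a₂ : (EuclideanSpace ℝ ι) → (EuclideanSpace ℝ ι)} {b₁ b₂ : (EuclideanSpace ℝ ι) → ℝ} {x₀ : (EuclideanSpace ℝ ι)} {R : ℝ}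
    (hφ : ContDiff ℝ 1 φ) (hφ0 : ∀ y, R < ‖y - x₀‖ → φ y = 0) (ha₁ : ContDiff ℝ 1 a₁)
    (ha₂ : ContDiff ℝ 1 a₂) (hb₁ : ContDiff ℝ 1 b₁) (hb₂ : ContDiff ℝ 1 b₂) :
    ∫ y, φ y * b₁ y * ((b₁ y - b₂ y) * ∑ i, (fderiv ℝ a₁ y - fderiv ℝ a₂ y) (EuclideanSpace.single i 1) i
        + (fderiv ℝ b₁ y - fderiv ℝ b₂ y) (a₁ y - a₂ y)) =
      -∫ y, (b₁ y * (b₁ y - b₂ y) * fderiv ℝ φ y (a₁ y - a₂ y) +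
        φ y * (b₁ y - b₂ y) * fderiv ℝ b₁ y (a₁ y - a₂ y)) := by
  have hφd : Differentiable ℝ φ := hφ.differentiable one_ne_zero
  have ha₁d : Differentiable ℝ a₁ := ha₁.differentiable one_ne_zero
  have ha₂d : Differentiable ℝ a₂ := ha₂.differentiable one_ne_zero
  have hb₁d : Differentiable ℝ b₁ := hb₁.differentiable one_ne_zero
  have hb₂d : Differentiable ℝ b₂ := hb₂.differentiable one_ne_zero
  -- `f = φ b₁`
  have hf1 : ContDiff ℝ 1 fun y => φ y * b₁ y := hφ.mul hb₁
  have hfd : ∀ y, HasFDerivAt (fun y => φ y * b₁ y) (φ y • fderiv ℝ b₁ y + b₁ y • fderiv ℝ φ y) y :=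
    fun y => (hφd y).hasFDerivAt.mul (hb₁d y).hasFDerivAt
  have hf0 : ∀ y, R < ‖y - x₀‖ → φ y * b₁ y = 0 := fun y hy => by rw [hφ0 y hy, zero_mul]
  -- `gⱼ = (b₁ - b₂) (a₁ - a₂)ⱼ`
  have hproj : ∀ j y, HasFDerivAt (fun y => (a₁ y - a₂ y) j)
      (PiLp.proj 2 (fun _ : ι => ℝ) j ∘L (fderiv ℝ a₁ y - fderiv ℝ a₂ y)) y := fun j y => by
    have h := ((ha₁d y).hasFDerivAt.sub (ha₂d y).hasFDerivAt)
    rw [← hasFDerivWithinAt_univ, hasFDerivWithinAt_euclidean] at h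
    exact hasFDerivWithinAt_univ.1 (h j)
  have hg1 : ∀ j, ContDiff ℝ 1 fun y => (b₁ y - b₂ y) * (a₁ y - a₂ y) j := fun j =>
    (hb₁.sub hb₂).mul (contDiff_euclidean.1 (ha₁.sub ha₂) j)
  have hgd : ∀ j y, HasFDerivAt (fun y => (b₁ y - b₂ y) * (a₁ y - a₂ y) j)
      ((b₁ y - b₂ y) • (PiLp.proj 2 (fun _ : ι => ℝ) j ∘L (fderiv ℝ a₁ y - fderiv ℝ a₂ y)) +
        (a₁ y - a₂ y) j • (fderiv ℝ b₁ y - fderiv ℝ b₂ y)) y := fun j y =>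
    ((hb₁d y).hasFDerivAt.sub (hb₂d y).hasFDerivAt).mul (hproj j y)
  -- continuity
  have hφc : Continuous φ := hφ.continuous
  -- integration by parts, coordinate by coordinate
  have hK : ∀ y, y ∉ closedBall x₀ R → R < ‖y - x₀‖ := fun y hy => by
    rwa [mem_closedBall, dist_eq_norm, not_le] at hy
  have hibp : ∀ j, ∫ y, (φ y * b₁ y) *
      fderiv ℝ (fun y => (b₁ y - b₂ y) * (a₁ y - a₂ y) j) y (EuclideanSpace.single j 1) =
      -∫ y, fderiv ℝ (fun y => φ y * b₁ y) y (EuclideanSpace.single j 1) *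
        ((b₁ y - b₂ y) * (a₁ y - a₂ y) j) := fun j =>
    integral_mul_fderiv_eq_neg (isCompact_closedBall x₀ R) (fun y hy => hf0 y (hK y hy))
      (fun y hy => fderiv_eq_zero_of_far hf0 (hK y hy)) (hf1.differentiable one_ne_zero)
      ((hg1 j).differentiable one_ne_zero)
      (((hf1.continuous_fderiv one_ne_zero).clm_apply continuous_const).mul (hg1 j).continuous)
      (hf1.continuous.mul (((hg1 j).continuous_fderiv one_ne_zero).clm_apply continuous_const))
      (hf1.continuous.mul (hg1 j).continuous)
  -- pointwise identities
  have hL : ∀ y, φ y * b₁ y * ((b₁ y - b₂ y) *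
      ∑ i, (fderiv ℝ a₁ y - fderiv ℝ a₂ y) (EuclideanSpace.single i 1) i +
        (fderiv ℝ b₁ y - fderiv ℝ b₂ y) (a₁ y - a₂ y)) =
      ∑ j, (φ y * b₁ y) *
        fderiv ℝ (fun y => (b₁ y - b₂ y) * (a₁ y - a₂ y) j) y (EuclideanSpace.single j 1) := by
    intro y
    rw [clm_apply_eq_sum (fderiv ℝ b₁ y - fderiv ℝ b₂ y) (a₁ y - a₂ y), Finset.mul_sum,
      ← Finset.sum_add_distrib, Finset.mul_sum]
    refine Finset.sum_congr rfl fun j _ => ?_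
    rw [(hgd j y).fderiv]
    simp only [add_apply, smul_apply, ContinuousLinearMap.coe_comp, Function.comp_apply,
      PiLp.proj_apply, smul_eq_mul]
  have hR : ∀ y, (b₁ y * (b₁ y - b₂ y) * fderiv ℝ φ y (a₁ y - a₂ y) +
      φ y * (b₁ y - b₂ y) * fderiv ℝ b₁ y (a₁ y - a₂ y)) =
      ∑ j, fderiv ℝ (fun y => φ y * b₁ y) y (EuclideanSpace.single j 1) *
        ((b₁ y - b₂ y) * (a₁ y - a₂ y) j) := by
    intro y
    rw [clm_apply_eq_sum (fderiv ℝ φ y) (a₁ y - a₂ y), clm_apply_eq_sum (fderiv ℝ b₁ y) (a₁ y - a₂ y),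
      Finset.mul_sum, Finset.mul_sum, ← Finset.sum_add_distrib]
    refine Finset.sum_congr rfl fun j _ => ?_
    rw [(hfd y).fderiv]
    simp only [add_apply, smul_apply, smul_eq_mul]
    ring
  have hi1 : ∀ j, Integrable fun y => (φ y * b₁ y) *
      fderiv ℝ (fun y => (b₁ y - b₂ y) * (a₁ y - a₂ y) j) y (EuclideanSpace.single j 1) :=
    fun j => integrable_of_far (hf1.continuous.mul
      (((hg1 j).continuous_fderiv one_ne_zero).clm_apply continuous_const))
      fun y hy => by rw [hf0 y hy, zero_mul]
  have hi2 : ∀ j, Integrable fun y => fderiv ℝ (fun y => φ y * b₁ y) y (EuclideanSpace.single j 1) *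
      ((b₁ y - b₂ y) * (a₁ y - a₂ y) j) :=
    fun j => integrable_of_far (((hf1.continuous_fderiv one_ne_zero).clm_apply continuous_const).mul
      (hg1 j).continuous) fun y hy => by rw [fderiv_eq_zero_of_far hf0 hy]; simp
  calc ∫ y, φ y * b₁ y * ((b₁ y - b₂ y) *
        ∑ i, (fderiv ℝ a₁ y - fderiv ℝ a₂ y) (EuclideanSpace.single i 1) i +
          (fderiv ℝ b₁ y - fderiv ℝ b₂ y) (a₁ y - a₂ y))
        = ∫ y, ∑ j, (φ y * b₁ y) *
            fderiv ℝ (fun y => (b₁ y - b₂ y) * (a₁ y - a₂ y) j) y (EuclideanSpace.single j 1) :=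
          integral_congr_ae (Filter.Eventually.of_forall hL)
    _ = ∑ j, ∫ y, (φ y * b₁ y) *
            fderiv ℝ (fun y => (b₁ y - b₂ y) * (a₁ y - a₂ y) j) y (EuclideanSpace.single j 1) :=
          integral_finsetSum _ fun j _ => hi1 j
    _ = ∑ j, -∫ y, fderiv ℝ (fun y => φ y * b₁ y) y (EuclideanSpace.single j 1) *
            ((b₁ y - b₂ y) * (a₁ y - a₂ y) j) := Finset.sum_congr rfl fun j _ => hibp j
    _ = -∫ y, ∑ j, fderiv ℝ (fun y => φ y * b₁ y) y (EuclideanSpace.single j 1) *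
            ((b₁ y - b₂ y) * (a₁ y - a₂ y) j) := by
          rw [Finset.sum_neg_distrib, integral_finsetSum _ fun j _ => hi2 j]
    _ = _ := by rw [integral_congr_ae (Filter.Eventually.of_forall hR)]

/-- **The weighted energy inequality on a time slice** (the heart of the energy method). At a fixed
time, let `φ ≥ 0` be a `C¹` weight supported in `‖y − x₀‖ < R`, `ψ` (the time derivative of the
space–time weight) a continuous function vanishing with `φ` and satisfying the recession condition
`ψ + c ‖Dφ‖ ≤ 0`, and let `(a₁, b₁)`, `(a₂, b₂)` be `C¹` fields whose "time derivatives"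
`a₁', b₁', a₂', b₂'` satisfy the `(u,σ)`-system wherever `φ ≠ 0`, with `‖a₁‖ + |α b₁| ≤ c` and
`‖Daᵢ‖, ‖Dbᵢ‖ ≤ B` there. Then
`∫ (ψ e + φ ∂ₜe) ≤ M ∫ φ e`, `e = ½((b₁−b₂)² + |a₁−a₂|²)`, `∂ₜe = (b₁−b₂)(b₁'−b₂') + ⟪a₁−a₂, a₁'−a₂'⟫`,
`M = B (card ι + |α| + |1+α| + 2|α| card ι + 2)`.
[cite: Dafermos2005, §5.2, proof of Thm 5.2.1, (5.2.10)–(5.2.14)] -/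
theorem slice_integral_le {φ ψ : (EuclideanSpace ℝ ι) → ℝ} {a₁ a₂ a₁' a₂' : (EuclideanSpace ℝ ι) → (EuclideanSpace ℝ ι)} {b₁ b₂ b₁' b₂' : (EuclideanSpace ℝ ι) → ℝ}
    {x₀ : (EuclideanSpace ℝ ι)} {R α c B : ℝ}
    (hφ : ContDiff ℝ 1 φ) (hφ0 : ∀ y, 0 ≤ φ y) (hφR : ∀ y, φ y ≠ 0 → ‖y - x₀‖ < R)
    (hψ : Continuous ψ) (hψ0 : ∀ y, φ y = 0 → ψ y = 0)
    (hsign : ∀ y, ψ y + c * ‖fderiv ℝ φ y‖ ≤ 0)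
    (ha₁ : ContDiff ℝ 1 a₁) (ha₂ : ContDiff ℝ 1 a₂) (hb₁ : ContDiff ℝ 1 b₁) (hb₂ : ContDiff ℝ 1 b₂)
    (ha₁' : Continuous a₁') (ha₂' : Continuous a₂') (hb₁' : Continuous b₁')
    (hb₂' : Continuous b₂')
    (hpde : ∀ y, φ y ≠ 0 →
      (b₁' y + fderiv ℝ b₁ y (a₁ y) + α * b₁ y * ∑ i, fderiv ℝ a₁ y (EuclideanSpace.single i 1) i = 0 ∧
        a₁' y + fderiv ℝ a₁ y (a₁ y) + (α * b₁ y) • gradient b₁ y = 0) ∧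
      (b₂' y + fderiv ℝ b₂ y (a₂ y) + α * b₂ y * ∑ i, fderiv ℝ a₂ y (EuclideanSpace.single i 1) i = 0 ∧
        a₂' y + fderiv ℝ a₂ y (a₂ y) + (α * b₂ y) • gradient b₂ y = 0))
    (hspeed : ∀ y, φ y ≠ 0 → ‖a₁ y‖ + |α * b₁ y| ≤ c)
    (hB : ∀ y, φ y ≠ 0 →
      ‖fderiv ℝ a₁ y‖ ≤ B ∧ ‖fderiv ℝ a₂ y‖ ≤ B ∧ ‖fderiv ℝ b₁ y‖ ≤ B ∧ ‖fderiv ℝ b₂ y‖ ≤ B) :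
    ∫ y, (ψ y * (((b₁ y - b₂ y) ^ 2 + ‖a₁ y - a₂ y‖ ^ 2) / 2) +
        φ y * ((b₁ y - b₂ y) * (b₁' y - b₂' y) + ⟪a₁ y - a₂ y, a₁' y - a₂' y⟫)) ≤
      B * (Fintype.card ι + |α| + |1 + α| + 2 * |α| * Fintype.card ι + 2) *
        ∫ y, φ y * (((b₁ y - b₂ y) ^ 2 + ‖a₁ y - a₂ y‖ ^ 2) / 2) := by
  set M : ℝ := B * (Fintype.card ι + |α| + |1 + α| + 2 * |α| * Fintype.card ι + 2) with hM
  -- the energy density, the remainder, the transport / flux / boundary / source integrands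
  set e : (EuclideanSpace ℝ ι) → ℝ := fun y => ((b₁ y - b₂ y) ^ 2 + ‖a₁ y - a₂ y‖ ^ 2) / 2 with he
  set q : (EuclideanSpace ℝ ι) → ℝ := fun y => -(1 + α) * (b₁ y - b₂ y) * fderiv ℝ b₂ y (a₁ y - a₂ y) -
      α * (b₁ y - b₂ y) ^ 2 * ∑ i, fderiv ℝ a₂ y (EuclideanSpace.single i 1) i -
    ⟪a₁ y - a₂ y, fderiv ℝ a₂ y (a₁ y - a₂ y)⟫ with hq
  set T₁ : (EuclideanSpace ℝ ι) → ℝ := fun y => φ y * ((b₁ y - b₂ y) * (fderiv ℝ b₁ y - fderiv ℝ b₂ y) (a₁ y) +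
      ⟪a₁ y - a₂ y, (fderiv ℝ a₁ y - fderiv ℝ a₂ y) (a₁ y)⟫) with hT₁
  set T₂ : (EuclideanSpace ℝ ι) → ℝ := fun y => φ y * b₁ y * ((b₁ y - b₂ y) *
      ∑ i, (fderiv ℝ a₁ y - fderiv ℝ a₂ y) (EuclideanSpace.single i 1) i +
        (fderiv ℝ b₁ y - fderiv ℝ b₂ y) (a₁ y - a₂ y)) with hT₂
  set G₁ : (EuclideanSpace ℝ ι) → ℝ := fun y => (fderiv ℝ φ y (a₁ y) +
      φ y * ∑ i, fderiv ℝ a₁ y (EuclideanSpace.single i 1) i) * e y with hG₁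
  set G₂ : (EuclideanSpace ℝ ι) → ℝ := fun y => b₁ y * (b₁ y - b₂ y) * fderiv ℝ φ y (a₁ y - a₂ y) +
      φ y * (b₁ y - b₂ y) * fderiv ℝ b₁ y (a₁ y - a₂ y) with hG₂
  -- supports
  have hφfar : ∀ y, R < ‖y - x₀‖ → φ y = 0 := fun y hy => by
    by_contra h
    exact lt_asymm (hφR y h) hy
  have hDφ0 : ∀ y, φ y = 0 → fderiv ℝ φ y = 0 := fun y hy => fderiv_eq_zero_of_nonneg hφ0 hy
  -- the pointwise energy identity `φ ∂ₜe = −T₁ − α T₂ + φ q`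
  have hpt : ∀ y, φ y * ((b₁ y - b₂ y) * (b₁' y - b₂' y) + ⟪a₁ y - a₂ y, a₁' y - a₂' y⟫) =
      -T₁ y - α * T₂ y + φ y * q y := by
    intro y
    by_cases hy : φ y = 0
    · simp [hT₁, hT₂, hy]
    · obtain ⟨⟨hZ₁, hM₁⟩, hZ₂, hM₂⟩ := hpde y hy
      rw [energy_algebra (fun v => inner_gradient_eq_fderiv b₁ y v)
        (fun v => inner_gradient_eq_fderiv b₂ y v) hZ₁ hM₁ hZ₂ hM₂]
      simp only [hT₁, hT₂, hq]
      ring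
  -- the pointwise bound `ψ e + G₁ + α G₂ + φ q ≤ M φ e`
  have hbound : ∀ y, ψ y * e y + G₁ y + α * G₂ y + φ y * q y ≤ M * (φ y * e y) := by
    intro y
    have he0 : 0 ≤ e y := by simp only [he]; positivity
    -- boundary flux
    have hflux : ψ y * e y + fderiv ℝ φ y (a₁ y) * e y +
        α * b₁ y * (b₁ y - b₂ y) * fderiv ℝ φ y (a₁ y - a₂ y) ≤ 0 := by
      by_cases hy : φ y = 0
      · rw [hψ0 y hy, hDφ0 y hy]; simp
      · exact flux_nonpos (hsign y) (hspeed y hy)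
    -- source
    have hsrc : φ y * ((∑ i, fderiv ℝ a₁ y (EuclideanSpace.single i 1) i) * e y +
        α * (b₁ y - b₂ y) * fderiv ℝ b₁ y (a₁ y - a₂ y) + q y) ≤ φ y * (M * e y) := by
      by_cases hy : φ y = 0
      · rw [hy]; simp
      · obtain ⟨hA₁, hA₂, hL₁, hL₂⟩ := hB y hy
        refine mul_le_mul_of_nonneg_left ((le_abs_self _).trans ?_) (hφ0 y)
        have h := abs_source_le (α := α) (w := a₁ y - a₂ y) (s := b₁ y - b₂ y) hA₁ hA₂ hL₁ hL₂
        simpa only [hq, hM, he] using h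
    have hexp : ψ y * e y + G₁ y + α * G₂ y + φ y * q y =
        (ψ y * e y + fderiv ℝ φ y (a₁ y) * e y +
          α * b₁ y * (b₁ y - b₂ y) * fderiv ℝ φ y (a₁ y - a₂ y)) +
        φ y * ((∑ i, fderiv ℝ a₁ y (EuclideanSpace.single i 1) i) * e y +
          α * (b₁ y - b₂ y) * fderiv ℝ b₁ y (a₁ y - a₂ y) + q y) := by
      simp only [hG₁, hG₂]; ring
    rw [hexp]
    nlinarith [hflux, hsrc]
  -- continuity of everything
  have hφc : Continuous φ := hφ.continuous
  have hDφc : Continuous fun y => fderiv ℝ φ y := hφ.continuous_fderiv one_ne_zero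
  have ha₁c : Continuous a₁ := ha₁.continuous
  have ha₂c : Continuous a₂ := ha₂.continuous
  have hb₁c : Continuous b₁ := hb₁.continuous
  have hb₂c : Continuous b₂ := hb₂.continuous
  have hA₁c : Continuous fun y => fderiv ℝ a₁ y := ha₁.continuous_fderiv one_ne_zero
  have hA₂c : Continuous fun y => fderiv ℝ a₂ y := ha₂.continuous_fderiv one_ne_zero
  have hL₁c : Continuous fun y => fderiv ℝ b₁ y := hb₁.continuous_fderiv one_ne_zero
  have hL₂c : Continuous fun y => fderiv ℝ b₂ y := hb₂.continuous_fderiv one_ne_zero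
  have hec : Continuous e := (contDiff_energy ha₁ ha₂ hb₁ hb₂).continuous
  have htr₁c : Continuous fun y => ∑ i, fderiv ℝ a₁ y (EuclideanSpace.single i 1) i :=
    continuous_finsetSum _ fun i _ => (EuclideanSpace.proj i).continuous.comp
      (hA₁c.clm_apply continuous_const)
  have htr₂c : Continuous fun y => ∑ i, fderiv ℝ a₂ y (EuclideanSpace.single i 1) i :=
    continuous_finsetSum _ fun i _ => (EuclideanSpace.proj i).continuous.comp
      (hA₂c.clm_apply continuous_const)
  have htr₁₂c : Continuous fun y => ∑ i, (fderiv ℝ a₁ y - fderiv ℝ a₂ y) (EuclideanSpace.single i 1) i :=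
    continuous_finsetSum _ fun i _ => (EuclideanSpace.proj i).continuous.comp
      ((hA₁c.sub hA₂c).clm_apply continuous_const)
  have hqc : Continuous q := by
    simp only [hq]
    exact (((continuous_const.mul (hb₁c.sub hb₂c)).mul (hL₂c.clm_apply (ha₁c.sub ha₂c))).sub
      ((continuous_const.mul ((hb₁c.sub hb₂c).pow 2)).mul htr₂c)).sub
      ((ha₁c.sub ha₂c).inner (hA₂c.clm_apply (ha₁c.sub ha₂c)))
  have hT₁c : Continuous T₁ := by
    simp only [hT₁]
    exact hφc.mul (((hb₁c.sub hb₂c).mul ((hL₁c.sub hL₂c).clm_apply ha₁c)).add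
      ((ha₁c.sub ha₂c).inner ((hA₁c.sub hA₂c).clm_apply ha₁c)))
  have hT₂c : Continuous T₂ := by
    simp only [hT₂]
    exact (hφc.mul hb₁c).mul (((hb₁c.sub hb₂c).mul htr₁₂c).add
      ((hL₁c.sub hL₂c).clm_apply (ha₁c.sub ha₂c)))
  have hG₁c : Continuous G₁ := by
    simp only [hG₁]
    exact ((hDφc.clm_apply ha₁c).add (hφc.mul htr₁c)).mul hec
  have hG₂c : Continuous G₂ := by
    simp only [hG₂]
    exact ((hb₁c.mul (hb₁c.sub hb₂c)).mul (hDφc.clm_apply (ha₁c.sub ha₂c))).add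
      ((hφc.mul (hb₁c.sub hb₂c)).mul (hL₁c.clm_apply (ha₁c.sub ha₂c)))
  have hdtc : Continuous fun y => (b₁ y - b₂ y) * (b₁' y - b₂' y) + ⟪a₁ y - a₂ y, a₁' y - a₂' y⟫ :=
    ((hb₁c.sub hb₂c).mul (hb₁'.sub hb₂')).add ((ha₁c.sub ha₂c).inner (ha₁'.sub ha₂'))
  -- integrability (every integrand carries a factor `φ`, `ψ` or `Dφ`, all vanishing far out)
  have hiψe : Integrable fun y => ψ y * e y :=
    integrable_of_far (hψ.mul hec) fun y hy => by rw [hψ0 y (hφfar y hy), zero_mul]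
  have hiφdt : Integrable fun y => φ y * ((b₁ y - b₂ y) * (b₁' y - b₂' y) +
      ⟪a₁ y - a₂ y, a₁' y - a₂' y⟫) :=
    integrable_of_far (hφc.mul hdtc) fun y hy => by rw [hφfar y hy, zero_mul]
  have hiT₁ : Integrable T₁ := integrable_of_far hT₁c fun y hy => by
    simp only [hT₁]; rw [hφfar y hy, zero_mul]
  have hiT₂ : Integrable T₂ := integrable_of_far hT₂c fun y hy => by
    simp only [hT₂]; rw [hφfar y hy]; ring
  have hiφq : Integrable fun y => φ y * q y :=
    integrable_of_far (hφc.mul hqc) fun y hy => by rw [hφfar y hy, zero_mul]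
  have hiG₁ : Integrable G₁ := integrable_of_far hG₁c fun y hy => by
    simp only [hG₁]; rw [hφfar y hy, hDφ0 y (hφfar y hy)]; simp
  have hiG₂ : Integrable G₂ := integrable_of_far hG₂c fun y hy => by
    simp only [hG₂]; rw [hφfar y hy, hDφ0 y (hφfar y hy)]; simp
  have hiφe : Integrable fun y => φ y * e y :=
    integrable_of_far (hφc.mul hec) fun y hy => by rw [hφfar y hy, zero_mul]
  -- the two integrations by parts
  have hI₁ : ∫ y, T₁ y = -∫ y, G₁ y := integral_transport hφ hφfar ha₁ ha₂ hb₁ hb₂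
  have hI₂ : ∫ y, T₂ y = -∫ y, G₂ y := integral_flux hφ hφfar ha₁ ha₂ hb₁ hb₂
  -- assemble
  have hsplit : (fun y => ψ y * e y + φ y * ((b₁ y - b₂ y) * (b₁' y - b₂' y) +
      ⟪a₁ y - a₂ y, a₁' y - a₂' y⟫)) = fun y => ψ y * e y - T₁ y - α * T₂ y + φ y * q y := by
    funext y; rw [hpt y]; ring
  have h12 : Integrable fun y => ψ y * e y - T₁ y := hiψe.sub hiT₁
  have hαT₂ : Integrable fun y => α * T₂ y := hiT₂.const_mul α
  have h123 : Integrable fun y => ψ y * e y - T₁ y - α * T₂ y := h12.sub hαT₂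
  have g12 : Integrable fun y => ψ y * e y + G₁ y := hiψe.add hiG₁
  have hαG₂ : Integrable fun y => α * G₂ y := hiG₂.const_mul α
  have g123 : Integrable fun y => ψ y * e y + G₁ y + α * G₂ y := g12.add hαG₂
  have g1234 : Integrable fun y => ψ y * e y + G₁ y + α * G₂ y + φ y * q y := g123.add hiφq
  have hMφe : Integrable fun y => M * (φ y * e y) := hiφe.const_mul M
  calc ∫ y, (ψ y * e y + φ y * ((b₁ y - b₂ y) * (b₁' y - b₂' y) + ⟪a₁ y - a₂ y, a₁' y - a₂' y⟫))
      = ∫ y, (ψ y * e y - T₁ y - α * T₂ y + φ y * q y) := by rw [hsplit]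
    _ = (∫ y, ψ y * e y) - (∫ y, T₁ y) - α * (∫ y, T₂ y) + ∫ y, φ y * q y := by
        rw [integral_add h123 hiφq, integral_sub h12 hαT₂, integral_sub hiψe hiT₁,
          integral_const_mul]
    _ = (∫ y, ψ y * e y) + (∫ y, G₁ y) + α * (∫ y, G₂ y) + ∫ y, φ y * q y := by
        rw [hI₁, hI₂]; ring
    _ = ∫ y, (ψ y * e y + G₁ y + α * G₂ y + φ y * q y) := by
        rw [integral_add g123 hiφq, integral_add g12 hαG₂, integral_add hiψe hiG₁,
          integral_const_mul]
    _ ≤ ∫ y, M * (φ y * e y) := integral_mono g1234 hMφe hbound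
    _ = M * ∫ y, φ y * e y := integral_const_mul _ _

end Spatial

/-! ### The weighted energy in time: fundamental theorem of calculus, Fubini, Grönwall -/

section Time

/-- The time derivative of the weighted energy density `Φ e` at `0 < t < t₁`:
`∂ₜ(Φ e) = (∂ₜΦ) e + Φ ((σ₁−σ₂) ∂ₜ(σ₁−σ₂) + ⟪u₁−u₂, ∂ₜ(u₁−u₂)⟫)`. [folklore] -/
theorem hasDerivAt_weightedDensity {t₁ : ℝ} {u₁ u₂ : ℝ → (EuclideanSpace ℝ ι) → (EuclideanSpace ℝ ι)} {σ₁ σ₂ : ℝ → (EuclideanSpace ℝ ι) → ℝ}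
    {Φ : ℝ × (EuclideanSpace ℝ ι) → ℝ} {e F' : ℝ → (EuclideanSpace ℝ ι) → ℝ}
    (hu₁ : ContDiffOn ℝ 1 (fun p : ℝ × (EuclideanSpace ℝ ι) => u₁ p.1 p.2) (Ico 0 t₁ ×ˢ univ))
    (hu₂ : ContDiffOn ℝ 1 (fun p : ℝ × (EuclideanSpace ℝ ι) => u₂ p.1 p.2) (Ico 0 t₁ ×ˢ univ))
    (hσ₁ : ContDiffOn ℝ 1 (fun p : ℝ × (EuclideanSpace ℝ ι) => σ₁ p.1 p.2) (Ico 0 t₁ ×ˢ univ))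
    (hσ₂ : ContDiffOn ℝ 1 (fun p : ℝ × (EuclideanSpace ℝ ι) => σ₂ p.1 p.2) (Ico 0 t₁ ×ˢ univ))
    (hΦ : ContDiff ℝ 1 Φ)
    (he : ∀ t y, e t y = ((σ₁ t y - σ₂ t y) ^ 2 + ‖u₁ t y - u₂ t y‖ ^ 2) / 2)
    (hF' : ∀ t y, F' t y = fderiv ℝ Φ (t, y) (1, 0) * e t y + Φ (t, y) *
      ((σ₁ t y - σ₂ t y) * (deriv (fun s => σ₁ s y) t - deriv (fun s => σ₂ s y) t) +
        ⟪u₁ t y - u₂ t y, deriv (fun s => u₁ s y) t - deriv (fun s => u₂ s y) t⟫))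
    {t : ℝ} (ht : t ∈ Ioo 0 t₁) (y : (EuclideanSpace ℝ ι)) :
    HasDerivAt (fun τ => Φ (τ, y) * e τ y) (F' t y) t := by
  have hΦt : HasDerivAt (fun τ => Φ (τ, y)) (fderiv ℝ Φ (t, y) (1, 0)) t :=
    hasDerivAt_slice_left ((hΦ.differentiable one_ne_zero) _).hasFDerivAt
  have hσ₁' : HasDerivAt (fun τ => σ₁ τ y) (deriv (fun s => σ₁ s y) t) t :=
    (hasDerivAt_time hσ₁ ht y).differentiableAt.hasDerivAt
  have hσ₂' : HasDerivAt (fun τ => σ₂ τ y) (deriv (fun s => σ₂ s y) t) t :=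
    (hasDerivAt_time hσ₂ ht y).differentiableAt.hasDerivAt
  have hu₁' : HasDerivAt (fun τ => u₁ τ y) (deriv (fun s => u₁ s y) t) t :=
    (hasDerivAt_time hu₁ ht y).differentiableAt.hasDerivAt
  have hu₂' : HasDerivAt (fun τ => u₂ τ y) (deriv (fun s => u₂ s y) t) t :=
    (hasDerivAt_time hu₂ ht y).differentiableAt.hasDerivAt
  have hs : HasDerivAt (fun τ => σ₁ τ y - σ₂ τ y)
      (deriv (fun s => σ₁ s y) t - deriv (fun s => σ₂ s y) t) t := hσ₁'.sub hσ₂'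
  have hs2 : HasDerivAt (fun τ => (σ₁ τ y - σ₂ τ y) * (σ₁ τ y - σ₂ τ y))
      ((deriv (fun s => σ₁ s y) t - deriv (fun s => σ₂ s y) t) * (σ₁ t y - σ₂ t y) +
        (σ₁ t y - σ₂ t y) * (deriv (fun s => σ₁ s y) t - deriv (fun s => σ₂ s y) t)) t :=
    hs.mul hs
  have hw2 : HasDerivAt (fun τ => ‖u₁ τ y - u₂ τ y‖ ^ 2)
      (2 * ⟪u₁ t y - u₂ t y, deriv (fun s => u₁ s y) t - deriv (fun s => u₂ s y) t⟫) t :=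
    (hu₁'.sub hu₂').norm_sq
  have hsum : HasDerivAt
      (fun τ => ((σ₁ τ y - σ₂ τ y) * (σ₁ τ y - σ₂ τ y) + ‖u₁ τ y - u₂ τ y‖ ^ 2) / 2)
      ((((deriv (fun s => σ₁ s y) t - deriv (fun s => σ₂ s y) t) * (σ₁ t y - σ₂ t y) +
        (σ₁ t y - σ₂ t y) * (deriv (fun s => σ₁ s y) t - deriv (fun s => σ₂ s y) t)) +
        2 * ⟪u₁ t y - u₂ t y, deriv (fun s => u₁ s y) t - deriv (fun s => u₂ s y) t⟫) / 2) t :=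
    (hs2.add hw2).div_const 2
  have hfun : (fun τ => Φ (τ, y) * e τ y) = fun τ => Φ (τ, y) *
      (((σ₁ τ y - σ₂ τ y) * (σ₁ τ y - σ₂ τ y) + ‖u₁ τ y - u₂ τ y‖ ^ 2) / 2) := by
    funext τ; rw [he]; ring
  rw [hfun, hF' t y, he t y]
  refine (hΦt.mul hsum).congr_deriv ?_
  ring

/-- The weighted energy density `Φ e` is continuous on the slab `[0, t₁) × ℝᵈ`. [folklore] -/
theorem continuousOn_weightedDensity {t₁ : ℝ} {u₁ u₂ : ℝ → (EuclideanSpace ℝ ι) → (EuclideanSpace ℝ ι)} {σ₁ σ₂ : ℝ → (EuclideanSpace ℝ ι) → ℝ}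
    {Φ : ℝ × (EuclideanSpace ℝ ι) → ℝ} {e : ℝ → (EuclideanSpace ℝ ι) → ℝ}
    (hu₁ : ContDiffOn ℝ 1 (fun p : ℝ × (EuclideanSpace ℝ ι) => u₁ p.1 p.2) (Ico 0 t₁ ×ˢ univ))
    (hu₂ : ContDiffOn ℝ 1 (fun p : ℝ × (EuclideanSpace ℝ ι) => u₂ p.1 p.2) (Ico 0 t₁ ×ˢ univ))
    (hσ₁ : ContDiffOn ℝ 1 (fun p : ℝ × (EuclideanSpace ℝ ι) => σ₁ p.1 p.2) (Ico 0 t₁ ×ˢ univ))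
    (hσ₂ : ContDiffOn ℝ 1 (fun p : ℝ × (EuclideanSpace ℝ ι) => σ₂ p.1 p.2) (Ico 0 t₁ ×ˢ univ))
    (hΦ : ContDiff ℝ 1 Φ)
    (he : ∀ t y, e t y = ((σ₁ t y - σ₂ t y) ^ 2 + ‖u₁ t y - u₂ t y‖ ^ 2) / 2) :
    ContinuousOn (fun p : ℝ × (EuclideanSpace ℝ ι) => Φ p * e p.1 p.2) (Ico 0 t₁ ×ˢ univ) := by
  have h : (fun p : ℝ × (EuclideanSpace ℝ ι) => Φ p * e p.1 p.2) = fun p => Φ p *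
      (((σ₁ p.1 p.2 - σ₂ p.1 p.2) ^ 2 + ‖u₁ p.1 p.2 - u₂ p.1 p.2‖ ^ 2) / 2) := by
    funext p; rw [he]
  rw [h]
  exact hΦ.continuous.continuousOn.mul ((((hσ₁.continuousOn.sub hσ₂.continuousOn).pow 2).add
    ((hu₁.continuousOn.sub hu₂.continuousOn).norm.pow 2)).div_const _)

/-- The time derivative of the weighted energy density is continuous on the open slab. [folklore] -/
theorem continuousOn_densityDeriv {t₁ : ℝ} {u₁ u₂ : ℝ → (EuclideanSpace ℝ ι) → (EuclideanSpace ℝ ι)} {σ₁ σ₂ : ℝ → (EuclideanSpace ℝ ι) → ℝ}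
    {Φ : ℝ × (EuclideanSpace ℝ ι) → ℝ} {e F' : ℝ → (EuclideanSpace ℝ ι) → ℝ}
    (hu₁ : ContDiffOn ℝ 1 (fun p : ℝ × (EuclideanSpace ℝ ι) => u₁ p.1 p.2) (Ico 0 t₁ ×ˢ univ))
    (hu₂ : ContDiffOn ℝ 1 (fun p : ℝ × (EuclideanSpace ℝ ι) => u₂ p.1 p.2) (Ico 0 t₁ ×ˢ univ))
    (hσ₁ : ContDiffOn ℝ 1 (fun p : ℝ × (EuclideanSpace ℝ ι) => σ₁ p.1 p.2) (Ico 0 t₁ ×ˢ univ))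
    (hσ₂ : ContDiffOn ℝ 1 (fun p : ℝ × (EuclideanSpace ℝ ι) => σ₂ p.1 p.2) (Ico 0 t₁ ×ˢ univ))
    (hΦ : ContDiff ℝ 1 Φ)
    (he : ∀ t y, e t y = ((σ₁ t y - σ₂ t y) ^ 2 + ‖u₁ t y - u₂ t y‖ ^ 2) / 2)
    (hF' : ∀ t y, F' t y = fderiv ℝ Φ (t, y) (1, 0) * e t y + Φ (t, y) *
      ((σ₁ t y - σ₂ t y) * (deriv (fun s => σ₁ s y) t - deriv (fun s => σ₂ s y) t) +
        ⟪u₁ t y - u₂ t y, deriv (fun s => u₁ s y) t - deriv (fun s => u₂ s y) t⟫)) :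
    ContinuousOn (fun p : ℝ × (EuclideanSpace ℝ ι) => F' p.1 p.2) (Ioo 0 t₁ ×ˢ univ) := by
  have h : (fun p : ℝ × (EuclideanSpace ℝ ι) => F' p.1 p.2) = fun p => fderiv ℝ Φ p (1, 0) *
      (((σ₁ p.1 p.2 - σ₂ p.1 p.2) ^ 2 + ‖u₁ p.1 p.2 - u₂ p.1 p.2‖ ^ 2) / 2) + Φ p *
      ((σ₁ p.1 p.2 - σ₂ p.1 p.2) *
          (deriv (fun s => σ₁ s p.2) p.1 - deriv (fun s => σ₂ s p.2) p.1) +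
        ⟪u₁ p.1 p.2 - u₂ p.1 p.2,
          deriv (fun s => u₁ s p.2) p.1 - deriv (fun s => u₂ s p.2) p.1⟫) := by
    funext p; rw [hF', he]
  rw [h]
  have hsub : Ioo 0 t₁ ×ˢ (univ : Set (EuclideanSpace ℝ ι)) ⊆ Ico 0 t₁ ×ˢ univ := prod_mono Ioo_subset_Ico_self le_rfl
  have hu₁c := hu₁.continuousOn.mono hsub
  have hu₂c := hu₂.continuousOn.mono hsub
  have hσ₁c := hσ₁.continuousOn.mono hsub
  have hσ₂c := hσ₂.continuousOn.mono hsub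
  refine (((hΦ.continuous_fderiv one_ne_zero).clm_apply continuous_const).continuousOn.mul
    ((((hσ₁c.sub hσ₂c).pow 2).add ((hu₁c.sub hu₂c).norm.pow 2)).div_const _)).add
    (hΦ.continuous.continuousOn.mul (((hσ₁c.sub hσ₂c).mul
      ((continuousOn_deriv_time hσ₁).sub (continuousOn_deriv_time hσ₂))).add
      ((hu₁c.sub hu₂c).inner ((continuousOn_deriv_time hu₁).sub (continuousOn_deriv_time hu₂)))))

/-- **Uniform bound on `∂ₜ(Φ e)` down to `t = 0`.** For `τ < t₁` there is `C` with
`|∂ₜ(Φe)(t, y)| ≤ C` for `0 < t ≤ τ` and all `y`, and `∂ₜ(Φe)(t,y) = 0` for `‖y − x₀‖ > R`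
(`Φ ≥ 0` is supported in the cone over `B(x₀, R)`, so `Φ` and `dΦ` vanish off it). [folklore] -/
theorem exists_bound_densityDeriv {c R t₁ : ℝ} {x₀ : (EuclideanSpace ℝ ι)} {u₁ u₂ : ℝ → (EuclideanSpace ℝ ι) → (EuclideanSpace ℝ ι)} {σ₁ σ₂ : ℝ → (EuclideanSpace ℝ ι) → ℝ}
    {Φ : ℝ × (EuclideanSpace ℝ ι) → ℝ} {e F' : ℝ → (EuclideanSpace ℝ ι) → ℝ}
    (hu₁ : ContDiffOn ℝ 1 (fun p : ℝ × (EuclideanSpace ℝ ι) => u₁ p.1 p.2) (Ico 0 t₁ ×ˢ univ))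
    (hu₂ : ContDiffOn ℝ 1 (fun p : ℝ × (EuclideanSpace ℝ ι) => u₂ p.1 p.2) (Ico 0 t₁ ×ˢ univ))
    (hσ₁ : ContDiffOn ℝ 1 (fun p : ℝ × (EuclideanSpace ℝ ι) => σ₁ p.1 p.2) (Ico 0 t₁ ×ˢ univ))
    (hσ₂ : ContDiffOn ℝ 1 (fun p : ℝ × (EuclideanSpace ℝ ι) => σ₂ p.1 p.2) (Ico 0 t₁ ×ˢ univ))
    (hΦ : ContDiff ℝ 1 Φ) (hΦ0 : ∀ p, 0 ≤ Φ p) (hc0 : 0 ≤ c)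
    (hΦs : ∀ p, Φ p ≠ 0 → ‖p.2 - x₀‖ + c * p.1 < R)
    (he : ∀ t y, e t y = ((σ₁ t y - σ₂ t y) ^ 2 + ‖u₁ t y - u₂ t y‖ ^ 2) / 2)
    (hF' : ∀ t y, F' t y = fderiv ℝ Φ (t, y) (1, 0) * e t y + Φ (t, y) *
      ((σ₁ t y - σ₂ t y) * (deriv (fun s => σ₁ s y) t - deriv (fun s => σ₂ s y) t) +
        ⟪u₁ t y - u₂ t y, deriv (fun s => u₁ s y) t - deriv (fun s => u₂ s y) t⟫))
    {τ : ℝ} (hτ : τ < t₁) :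
    (∀ t, 0 ≤ t → ∀ y, R < ‖y - x₀‖ → F' t y = 0) ∧
      ∃ C : ℝ, ∀ t ∈ Ioc 0 τ, t < t₁ → ∀ y, |F' t y| ≤ C := by
  -- `Φ` and `dΦ` vanish off the ball for `t ≥ 0`
  have hΦfar : ∀ t, 0 ≤ t → ∀ y, R < ‖y - x₀‖ → Φ (t, y) = 0 := by
    intro t ht y hy
    by_contra h
    have h1 := hΦs (t, y) h
    have h2 : 0 ≤ c * t := mul_nonneg hc0 ht
    simp only at h1
    linarith
  have hDΦ0 : ∀ p, Φ p = 0 → fderiv ℝ Φ p = 0 := fun p hp => fderiv_eq_zero_of_nonneg hΦ0 hp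
  refine ⟨fun t ht y hy => ?_, ?_⟩
  · rw [hF', hΦfar t ht y hy, hDΦ0 _ (hΦfar t ht y hy)]; simp
  -- bounds
  obtain ⟨B₁, -, hB₁⟩ := exists_bound_slab hu₁ hτ x₀ R
  obtain ⟨B₂, -, hB₂⟩ := exists_bound_slab hu₂ hτ x₀ R
  obtain ⟨B₃, -, hB₃⟩ := exists_bound_slab hσ₁ hτ x₀ R
  obtain ⟨B₄, -, hB₄⟩ := exists_bound_slab hσ₂ hτ x₀ R
  have hK : IsCompact (Icc 0 τ ×ˢ closedBall x₀ R) := isCompact_Icc.prod (isCompact_closedBall x₀ R)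
  obtain ⟨C₁'', hC₁''⟩ := hK.exists_bound_of_continuousOn hΦ.continuous.continuousOn
  obtain ⟨C₂'', hC₂''⟩ := hK.exists_bound_of_continuousOn
    (hΦ.continuous_fderiv one_ne_zero).continuousOn
  set C₁ : ℝ := max C₁'' 0 with hC₁def
  set C₂ : ℝ := max C₂'' 0 with hC₂def
  have hC₁ : ∀ p ∈ Icc 0 τ ×ˢ closedBall x₀ R, ‖Φ p‖ ≤ C₁ := fun p hp =>
    (hC₁'' p hp).trans (le_max_left _ _)
  have hC₂ : ∀ p ∈ Icc 0 τ ×ˢ closedBall x₀ R, ‖fderiv ℝ Φ p‖ ≤ C₂ := fun p hp =>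
    (hC₂'' p hp).trans (le_max_left _ _)
  have hC₁0 : 0 ≤ C₁ := le_max_right _ _
  have hC₂0 : 0 ≤ C₂ := le_max_right _ _
  set B : ℝ := max (max B₁ B₂) (max B₃ B₄) with hBdef
  have h1B : B₁ ≤ B := (le_max_left _ _).trans (le_max_left _ _)
  have h2B : B₂ ≤ B := (le_max_right _ _).trans (le_max_left _ _)
  have h3B : B₃ ≤ B := (le_max_left _ _).trans (le_max_right _ _)
  have h4B : B₄ ≤ B := (le_max_right _ _).trans (le_max_right _ _)
  refine ⟨C₂ * (((B + B) ^ 2 + (B + B) ^ 2) / 2) + C₁ * ((B + B) * (B + B) + (B + B) * (B + B)),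
    fun t ht ht₁ y => ?_⟩
  by_cases hy : y ∈ closedBall x₀ R
  · have htI : t ∈ Icc 0 τ := ⟨ht.1.le, ht.2⟩
    have htO : t ∈ Ioo 0 t₁ := ⟨ht.1, ht₁⟩
    have hmem : (t, y) ∈ Icc 0 τ ×ˢ closedBall x₀ R := ⟨htI, hy⟩
    obtain ⟨hu₁v, hu₁d⟩ := hB₁ t htI y hy
    obtain ⟨hu₂v, hu₂d⟩ := hB₂ t htI y hy
    obtain ⟨hσ₁v, hσ₁d⟩ := hB₃ t htI y hy
    obtain ⟨hσ₂v, hσ₂d⟩ := hB₄ t htI y hy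
    have hu₁t := (hu₁d htO).1
    have hu₂t := (hu₂d htO).1
    have hσ₁t := (hσ₁d htO).1
    have hσ₂t := (hσ₂d htO).1
    -- elementary bounds
    have hs : ‖σ₁ t y - σ₂ t y‖ ≤ B + B :=
      (norm_sub_le _ _).trans (add_le_add (hσ₁v.trans h3B) (hσ₂v.trans h4B))
    have hw : ‖u₁ t y - u₂ t y‖ ≤ B + B :=
      (norm_sub_le _ _).trans (add_le_add (hu₁v.trans h1B) (hu₂v.trans h2B))
    have hst : ‖deriv (fun s => σ₁ s y) t - deriv (fun s => σ₂ s y) t‖ ≤ B + B :=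
      (norm_sub_le _ _).trans (add_le_add (hσ₁t.trans h3B) (hσ₂t.trans h4B))
    have hwt : ‖deriv (fun s => u₁ s y) t - deriv (fun s => u₂ s y) t‖ ≤ B + B :=
      (norm_sub_le _ _).trans (add_le_add (hu₁t.trans h1B) (hu₂t.trans h2B))
    have hB0 : 0 ≤ B + B := (norm_nonneg _).trans hs
    have he0 : 0 ≤ e t y := by rw [he]; positivity
    have heB : e t y ≤ ((B + B) ^ 2 + (B + B) ^ 2) / 2 := by
      rw [he]
      have h1 : (σ₁ t y - σ₂ t y) ^ 2 ≤ (B + B) ^ 2 := by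
        rw [← sq_abs, ← Real.norm_eq_abs]; exact pow_le_pow_left₀ (norm_nonneg _) hs 2
      have h2 : ‖u₁ t y - u₂ t y‖ ^ 2 ≤ (B + B) ^ 2 := pow_le_pow_left₀ (norm_nonneg _) hw 2
      linarith
    have hΦt : ‖fderiv ℝ Φ (t, y) (1, 0)‖ ≤ C₂ := (norm_apply_one_zero_le _).trans (hC₂ _ hmem)
    have hΦv : ‖Φ (t, y)‖ ≤ C₁ := hC₁ _ hmem
    have hin : ‖(σ₁ t y - σ₂ t y) * (deriv (fun s => σ₁ s y) t - deriv (fun s => σ₂ s y) t) +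
        ⟪u₁ t y - u₂ t y, deriv (fun s => u₁ s y) t - deriv (fun s => u₂ s y) t⟫‖ ≤
        (B + B) * (B + B) + (B + B) * (B + B) := by
      refine (norm_add_le _ _).trans (add_le_add ?_ ?_)
      · rw [norm_mul]; exact mul_le_mul hs hst (norm_nonneg _) hB0
      · exact (norm_inner_le_norm _ _).trans (mul_le_mul hw hwt (norm_nonneg _) hB0)
    rw [hF', ← Real.norm_eq_abs]
    refine (norm_add_le _ _).trans (add_le_add ?_ ?_)
    · rw [norm_mul, Real.norm_of_nonneg he0]
      exact mul_le_mul hΦt heB he0 hC₂0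
    · rw [norm_mul]
      exact mul_le_mul hΦv hin (norm_nonneg _) hC₁0
  · rw [mem_closedBall, dist_eq_norm, not_le] at hy
    have h0 : F' t y = 0 := by
      rw [hF', hΦfar t ht.1.le y hy, hDΦ0 _ (hΦfar t ht.1.le y hy)]; simp
    rw [h0, abs_zero]
    exact add_nonneg (mul_nonneg hC₂0 (by positivity))
      (mul_nonneg hC₁0 (add_nonneg (mul_self_nonneg _) (mul_self_nonneg _)))

/-- `Φ ≥ 0` supported in the cone vanishes for `t ≥ 0`, `‖y − x₀‖ > R` (`c ≥ 0`). [folklore] -/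
theorem weight_eq_zero_far {c R : ℝ} {x₀ : (EuclideanSpace ℝ ι)} {Φ : ℝ × (EuclideanSpace ℝ ι) → ℝ} (hc0 : 0 ≤ c)
    (hΦs : ∀ p, Φ p ≠ 0 → ‖p.2 - x₀‖ + c * p.1 < R) {t : ℝ} (ht : 0 ≤ t) {y : (EuclideanSpace ℝ ι)}
    (hy : R < ‖y - x₀‖) : Φ (t, y) = 0 := by
  by_contra h
  have h1 := hΦs (t, y) h
  have h2 : 0 ≤ c * t := mul_nonneg hc0 ht
  simp only at h1
  linarith

/-- **The weighted energy is continuous on `[0, τ]`**, `τ < t₁` (dominated convergence: the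
integrand is jointly continuous on the compact `[0, τ] × B̄(x₀, R)` and vanishes off it). [folklore] -/
theorem continuousOn_weightedEnergy {c R t₁ : ℝ} {x₀ : (EuclideanSpace ℝ ι)} {u₁ u₂ : ℝ → (EuclideanSpace ℝ ι) → (EuclideanSpace ℝ ι)}
    {σ₁ σ₂ : ℝ → (EuclideanSpace ℝ ι) → ℝ} {Φ : ℝ × (EuclideanSpace ℝ ι) → ℝ} {e : ℝ → (EuclideanSpace ℝ ι) → ℝ}
    (hu₁ : ContDiffOn ℝ 1 (fun p : ℝ × (EuclideanSpace ℝ ι) => u₁ p.1 p.2) (Ico 0 t₁ ×ˢ univ))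
    (hu₂ : ContDiffOn ℝ 1 (fun p : ℝ × (EuclideanSpace ℝ ι) => u₂ p.1 p.2) (Ico 0 t₁ ×ˢ univ))
    (hσ₁ : ContDiffOn ℝ 1 (fun p : ℝ × (EuclideanSpace ℝ ι) => σ₁ p.1 p.2) (Ico 0 t₁ ×ˢ univ))
    (hσ₂ : ContDiffOn ℝ 1 (fun p : ℝ × (EuclideanSpace ℝ ι) => σ₂ p.1 p.2) (Ico 0 t₁ ×ˢ univ))
    (hΦ : ContDiff ℝ 1 Φ) (hc0 : 0 ≤ c) (hΦs : ∀ p, Φ p ≠ 0 → ‖p.2 - x₀‖ + c * p.1 < R)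
    (he : ∀ t y, e t y = ((σ₁ t y - σ₂ t y) ^ 2 + ‖u₁ t y - u₂ t y‖ ^ 2) / 2)
    {τ : ℝ} (hτ : τ < t₁) :
    ContinuousOn (fun t => ∫ y, Φ (t, y) * e t y) (Icc 0 τ) := by
  have hK : IsCompact (Icc 0 τ ×ˢ closedBall x₀ R) := isCompact_Icc.prod (isCompact_closedBall x₀ R)
  have hcont := continuousOn_weightedDensity hu₁ hu₂ hσ₁ hσ₂ hΦ he
  have hKS : Icc 0 τ ×ˢ closedBall x₀ R ⊆ Ico 0 t₁ ×ˢ univ :=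
    prod_mono (Icc_subset_Ico_right hτ) (subset_univ _)
  obtain ⟨C, hC⟩ := hK.exists_bound_of_continuousOn (hcont.mono hKS)
  refine continuousOn_of_dominated (bound := (closedBall x₀ R).indicator fun _ => C) ?_ ?_ ?_ ?_
  · intro t ht
    have htI : t ∈ Ico 0 t₁ := ⟨ht.1, ht.2.trans_lt hτ⟩
    exact (hcont.comp_continuous (continuous_const.prodMk continuous_id)
      fun y => ⟨htI, mem_univ _⟩).aestronglyMeasurable
  · intro t ht
    refine Filter.Eventually.of_forall fun y => ?_
    by_cases hy : y ∈ closedBall x₀ R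
    · rw [indicator_of_mem hy]
      exact hC (t, y) ⟨ht, hy⟩
    · rw [indicator_of_notMem hy]
      rw [mem_closedBall, dist_eq_norm, not_le] at hy
      rw [weight_eq_zero_far hc0 hΦs ht.1 hy, zero_mul, norm_zero]
  · exact (integrableOn_const (hs := measure_closedBall_lt_top.ne)).integrable_indicator
      measurableSet_closedBall
  · refine Filter.Eventually.of_forall fun y => ?_
    exact hcont.comp (continuous_id.prodMk continuous_const).continuousOn
      fun t ht => ⟨⟨ht.1, ht.2.trans_lt hτ⟩, mem_univ _⟩

/-- **The weighted energy identity** `E(τ') − E(0) = ∫₀^{τ'} ∫ ∂ₜ(Φ e) dy dt`, `0 ≤ τ' ≤ τ < t₁`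
(fundamental theorem of calculus pointwise in `y`, then Fubini; the time integrand is integrable
on `(0, τ']`). [cite: Dafermos2005, §5.2, proof of Thm 5.2.1, (5.2.13)–(5.2.14)] -/
theorem weightedEnergy_sub_eq {c R t₁ : ℝ} {x₀ : (EuclideanSpace ℝ ι)} {u₁ u₂ : ℝ → (EuclideanSpace ℝ ι) → (EuclideanSpace ℝ ι)}
    {σ₁ σ₂ : ℝ → (EuclideanSpace ℝ ι) → ℝ} {Φ : ℝ × (EuclideanSpace ℝ ι) → ℝ} {e F' : ℝ → (EuclideanSpace ℝ ι) → ℝ}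
    (hu₁ : ContDiffOn ℝ 1 (fun p : ℝ × (EuclideanSpace ℝ ι) => u₁ p.1 p.2) (Ico 0 t₁ ×ˢ univ))
    (hu₂ : ContDiffOn ℝ 1 (fun p : ℝ × (EuclideanSpace ℝ ι) => u₂ p.1 p.2) (Ico 0 t₁ ×ˢ univ))
    (hσ₁ : ContDiffOn ℝ 1 (fun p : ℝ × (EuclideanSpace ℝ ι) => σ₁ p.1 p.2) (Ico 0 t₁ ×ˢ univ))
    (hσ₂ : ContDiffOn ℝ 1 (fun p : ℝ × (EuclideanSpace ℝ ι) => σ₂ p.1 p.2) (Ico 0 t₁ ×ˢ univ))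
    (hΦ : ContDiff ℝ 1 Φ) (hΦ0 : ∀ p, 0 ≤ Φ p) (hc0 : 0 ≤ c)
    (hΦs : ∀ p, Φ p ≠ 0 → ‖p.2 - x₀‖ + c * p.1 < R)
    (he : ∀ t y, e t y = ((σ₁ t y - σ₂ t y) ^ 2 + ‖u₁ t y - u₂ t y‖ ^ 2) / 2)
    (hF' : ∀ t y, F' t y = fderiv ℝ Φ (t, y) (1, 0) * e t y + Φ (t, y) *
      ((σ₁ t y - σ₂ t y) * (deriv (fun s => σ₁ s y) t - deriv (fun s => σ₂ s y) t) +
        ⟪u₁ t y - u₂ t y, deriv (fun s => u₁ s y) t - deriv (fun s => u₂ s y) t⟫))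
    {τ τ' : ℝ} (hτ : τ < t₁) (hτ'0 : 0 ≤ τ') (hτ'τ : τ' ≤ τ) :
    (∫ y, Φ (τ', y) * e τ' y) - (∫ y, Φ (0, y) * e 0 y) = ∫ t in Ioc 0 τ', ∫ y, F' t y ∧
      IntegrableOn (fun t => ∫ y, F' t y) (Ioc 0 τ') := by
  obtain ⟨hF0, C, hC⟩ := exists_bound_densityDeriv hu₁ hu₂ hσ₁ hσ₂ hΦ hΦ0 hc0 hΦs he hF' hτ
  have hGc := continuousOn_densityDeriv hu₁ hu₂ hσ₁ hσ₂ hΦ he hF'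
  have hDc := continuousOn_weightedDensity hu₁ hu₂ hσ₁ hσ₂ hΦ he
  have hτ't₁ : τ' < t₁ := hτ'τ.trans_lt hτ
  -- the fundamental theorem of calculus, pointwise in `y`
  have hFTC : ∀ y, ∫ t in (0 : ℝ)..τ', F' t y = Φ (τ', y) * e τ' y - Φ (0, y) * e 0 y := by
    intro y
    apply intervalIntegral.integral_eq_sub_of_hasDerivAt_of_le hτ'0
    · exact hDc.comp (continuous_id.prodMk continuous_const).continuousOn
        fun t ht => ⟨⟨ht.1, ht.2.trans_lt hτ't₁⟩, mem_univ _⟩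
    · intro t ht
      exact hasDerivAt_weightedDensity hu₁ hu₂ hσ₁ hσ₂ hΦ he hF' ⟨ht.1, ht.2.trans hτ't₁⟩ y
    · rw [intervalIntegrable_iff_integrableOn_Ioc_of_le hτ'0]
      refine IntegrableOn.of_bound measure_Ioc_lt_top ?_ C ?_
      · refine ContinuousOn.aestronglyMeasurable ?_ measurableSet_Ioc
        exact hGc.comp (continuous_id.prodMk continuous_const).continuousOn
          fun t ht => ⟨⟨ht.1, ht.2.trans_lt hτ't₁⟩, mem_univ _⟩
      · exact ae_restrict_of_forall_mem measurableSet_Ioc fun t ht => by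
          rw [Real.norm_eq_abs]
          exact hC t ⟨ht.1, ht.2.trans hτ'τ⟩ (ht.2.trans_lt hτ't₁) y
  -- integrability on the product `(0, τ'] × ℝᵈ`
  have hprod : IntegrableOn (fun p : ℝ × (EuclideanSpace ℝ ι) => F' p.1 p.2) (Ioc 0 τ' ×ˢ univ) volume := by
    have h1 : IntegrableOn (fun p : ℝ × (EuclideanSpace ℝ ι) => F' p.1 p.2) (Ioc 0 τ' ×ˢ closedBall x₀ R) volume := by
      refine IntegrableOn.of_bound ?_ ?_ C ?_
      · calc volume (Ioc 0 τ' ×ˢ closedBall x₀ R)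
            ≤ volume (Icc 0 τ' ×ˢ closedBall x₀ R) := measure_mono (prod_mono Ioc_subset_Icc_self le_rfl)
          _ < ⊤ := (isCompact_Icc.prod (isCompact_closedBall x₀ R)).measure_lt_top
      · refine ContinuousOn.aestronglyMeasurable ?_ (measurableSet_Ioc.prod measurableSet_closedBall)
        exact hGc.mono (prod_mono (fun t ht => ⟨ht.1, ht.2.trans_lt hτ't₁⟩) (subset_univ _))
      · exact ae_restrict_of_forall_mem (measurableSet_Ioc.prod measurableSet_closedBall)
          fun p hp => by
            rw [Real.norm_eq_abs]
            exact hC p.1 ⟨hp.1.1, hp.1.2.trans hτ'τ⟩ (hp.1.2.trans_lt hτ't₁) p.2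
    refine h1.of_forall_sdiff_eq_zero (measurableSet_Ioc.prod MeasurableSet.univ) fun p hp => ?_
    have hp1 : p.1 ∈ Ioc 0 τ' := hp.1.1
    have hp2 : p.2 ∉ closedBall x₀ R := fun h => hp.2 ⟨hp1, h⟩
    rw [mem_closedBall, dist_eq_norm, not_le] at hp2
    exact hF0 p.1 hp1.1.le p.2 hp2
  have hprod' : Integrable (Function.uncurry fun t y => F' t y)
      ((volume.restrict (Ioc 0 τ')).prod (volume : Measure (EuclideanSpace ℝ ι))) := by
    rw [← Measure.restrict_univ (μ := (volume : Measure (EuclideanSpace ℝ ι))), Measure.prod_restrict,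
      ← Measure.volume_eq_prod]
    exact hprod
  refine ⟨?_, hprod'.integral_prod_left⟩
  have hEτ : Integrable fun y => Φ (τ', y) * e τ' y :=
    integrable_of_far (hDc.comp_continuous (continuous_const.prodMk continuous_id)
      fun y => ⟨⟨hτ'0, hτ't₁⟩, mem_univ _⟩)
      fun y hy => by rw [weight_eq_zero_far hc0 hΦs hτ'0 hy, zero_mul]
  have hE0 : Integrable fun y => Φ (0, y) * e 0 y :=
    integrable_of_far (hDc.comp_continuous (continuous_const.prodMk continuous_id)
      fun y => ⟨⟨le_rfl, hτ'0.trans_lt hτ't₁⟩, mem_univ _⟩)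
      fun y hy => by rw [weight_eq_zero_far hc0 hΦs le_rfl hy, zero_mul]
  calc (∫ y, Φ (τ', y) * e τ' y) - ∫ y, Φ (0, y) * e 0 y
      = ∫ y, (Φ (τ', y) * e τ' y - Φ (0, y) * e 0 y) := (integral_sub hEτ hE0).symm
    _ = ∫ y, ∫ t in Ioc 0 τ', F' t y := integral_congr_ae (Filter.Eventually.of_forall fun y => by
        simp only
        rw [← hFTC y, intervalIntegral.integral_of_le hτ'0])
    _ = ∫ t in Ioc 0 τ', ∫ y, F' t y := (integral_integral_swap hprod').symm

/-- **The energy method with an abstract weight.** Let `(u₁, σ₁)`, `(u₂, σ₂)` be `C¹` on the slab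
`[0, t₁) × ℝᵈ`, solve the `(u,σ)`-system on the open cone `‖x − x₀‖ + ct < R`, `0 < t < t₁`, with
`‖u₁‖ + |α σ₁| ≤ c` there, and agree at `t = 0` on `‖x − x₀‖ < R`. Let `Φ ≥ 0` be a `C¹` weight
supported in the cone and receding at speed `c` (`∂ₜΦ + c ‖∇ₓΦ‖ ≤ 0`). Then the two solutions agree
wherever `Φ ≠ 0`. [cite: Dafermos2005, §5.2, Thm 5.2.1 and its proof] -/
theorem eqOn_of_weight [DecidableEq ι] {α c R t₁ : ℝ} {x₀ : (EuclideanSpace ℝ ι)} {u₁ u₂ : ℝ → (EuclideanSpace ℝ ι) → (EuclideanSpace ℝ ι)}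
    {σ₁ σ₂ : ℝ → (EuclideanSpace ℝ ι) → ℝ} {Φ : ℝ × (EuclideanSpace ℝ ι) → ℝ}
    (hu₁ : ContDiffOn ℝ 1 (fun p : ℝ × (EuclideanSpace ℝ ι) => u₁ p.1 p.2) (Ico 0 t₁ ×ˢ univ))
    (hu₂ : ContDiffOn ℝ 1 (fun p : ℝ × (EuclideanSpace ℝ ι) => u₂ p.1 p.2) (Ico 0 t₁ ×ˢ univ))
    (hσ₁ : ContDiffOn ℝ 1 (fun p : ℝ × (EuclideanSpace ℝ ι) => σ₁ p.1 p.2) (Ico 0 t₁ ×ˢ univ))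
    (hσ₂ : ContDiffOn ℝ 1 (fun p : ℝ × (EuclideanSpace ℝ ι) => σ₂ p.1 p.2) (Ico 0 t₁ ×ˢ univ))
    (hE₁ : ∀ t ∈ Ioo 0 t₁, ∀ x, ‖x - x₀‖ + c * t < R →
      deriv (fun s => σ₁ s x) t + fderiv ℝ (σ₁ t) x (u₁ t x) +
          α * σ₁ t x * ∑ i, fderiv ℝ (u₁ t) x (EuclideanSpace.single i 1) i = 0 ∧
        deriv (fun s => u₁ s x) t + fderiv ℝ (u₁ t) x (u₁ t x) + (α * σ₁ t x) • gradient (σ₁ t) x = 0)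
    (hE₂ : ∀ t ∈ Ioo 0 t₁, ∀ x, ‖x - x₀‖ + c * t < R →
      deriv (fun s => σ₂ s x) t + fderiv ℝ (σ₂ t) x (u₂ t x) +
          α * σ₂ t x * ∑ i, fderiv ℝ (u₂ t) x (EuclideanSpace.single i 1) i = 0 ∧
        deriv (fun s => u₂ s x) t + fderiv ℝ (u₂ t) x (u₂ t x) + (α * σ₂ t x) • gradient (σ₂ t) x = 0)
    (hc : ∀ t ∈ Ioo 0 t₁, ∀ x, ‖x - x₀‖ + c * t < R → ‖u₁ t x‖ + |α * σ₁ t x| ≤ c)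
    (hc0 : 0 ≤ c) (h0 : ∀ x, ‖x - x₀‖ < R → u₁ 0 x = u₂ 0 x ∧ σ₁ 0 x = σ₂ 0 x)
    (hΦ : ContDiff ℝ 1 Φ) (hΦ0 : ∀ p, 0 ≤ Φ p) (hΦs : ∀ p, Φ p ≠ 0 → ‖p.2 - x₀‖ + c * p.1 < R)
    (hΦd : ∀ p, fderiv ℝ Φ p (1, 0) +
      c * ‖(fderiv ℝ Φ p).comp (ContinuousLinearMap.inr ℝ ℝ (EuclideanSpace ℝ ι))‖ ≤ 0)
    {t : ℝ} (ht : t ∈ Ico 0 t₁) {x : (EuclideanSpace ℝ ι)} (hx : Φ (t, x) ≠ 0) :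
    u₁ t x = u₂ t x ∧ σ₁ t x = σ₂ t x := by
  -- name the energy density, its weighted time derivative and the weighted energy
  obtain ⟨e, he⟩ : ∃ e : ℝ → (EuclideanSpace ℝ ι) → ℝ,
      ∀ t y, e t y = ((σ₁ t y - σ₂ t y) ^ 2 + ‖u₁ t y - u₂ t y‖ ^ 2) / 2 := ⟨_, fun _ _ => rfl⟩
  obtain ⟨F', hF'⟩ : ∃ F' : ℝ → (EuclideanSpace ℝ ι) → ℝ, ∀ t y, F' t y = fderiv ℝ Φ (t, y) (1, 0) * e t y +
      Φ (t, y) * ((σ₁ t y - σ₂ t y) * (deriv (fun s => σ₁ s y) t - deriv (fun s => σ₂ s y) t) +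
        ⟪u₁ t y - u₂ t y, deriv (fun s => u₁ s y) t - deriv (fun s => u₂ s y) t⟫) :=
    ⟨_, fun _ _ => rfl⟩
  -- it suffices to show that the energy density vanishes at `(t, x)`
  suffices hex : e t x = 0 by
    rw [he] at hex
    have h1 : (σ₁ t x - σ₂ t x) ^ 2 = 0 := by
      nlinarith [sq_nonneg (σ₁ t x - σ₂ t x), sq_nonneg ‖u₁ t x - u₂ t x‖]
    have h2 : ‖u₁ t x - u₂ t x‖ ^ 2 = 0 := by
      nlinarith [sq_nonneg (σ₁ t x - σ₂ t x), sq_nonneg ‖u₁ t x - u₂ t x‖]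
    rw [sq_eq_zero_iff, sub_eq_zero] at h1
    rw [sq_eq_zero_iff, norm_eq_zero, sub_eq_zero] at h2
    exact ⟨h2, h1⟩
  -- data: the energy density vanishes at `t = 0` wherever `Φ ≠ 0`
  have he0 : ∀ y, Φ (0, y) * e 0 y = 0 := by
    intro y
    by_cases hy : Φ (0, y) = 0
    · rw [hy, zero_mul]
    · have h := hΦs (0, y) hy
      simp only [mul_zero, add_zero] at h
      obtain ⟨hu, hσ⟩ := h0 y h
      rw [he, hu, hσ]; simp
  rcases ht.1.eq_or_lt with h | htpos
  · -- `t = 0`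
    subst h
    have h := he0 x
    rcases mul_eq_zero.1 h with h | h
    · exact absurd h hx
    · exact h
  -- `0 < t =: τ`
  set τ := t with hτdef
  have hτ : τ < t₁ := ht.2
  -- uniform bounds on `[0, τ] × B̄(x₀, R)`
  obtain ⟨B₁, hB₁0, hB₁⟩ := exists_bound_slab hu₁ hτ x₀ R
  obtain ⟨B₂, -, hB₂⟩ := exists_bound_slab hu₂ hτ x₀ R
  obtain ⟨B₃, -, hB₃⟩ := exists_bound_slab hσ₁ hτ x₀ R
  obtain ⟨B₄, -, hB₄⟩ := exists_bound_slab hσ₂ hτ x₀ R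
  set B : ℝ := max (max B₁ B₂) (max B₃ B₄) with hBdef
  have h1B : B₁ ≤ B := (le_max_left _ _).trans (le_max_left _ _)
  have h2B : B₂ ≤ B := (le_max_right _ _).trans (le_max_left _ _)
  have h3B : B₃ ≤ B := (le_max_left _ _).trans (le_max_right _ _)
  have h4B : B₄ ≤ B := (le_max_right _ _).trans (le_max_right _ _)
  have hB0 : 0 ≤ B := hB₁0.trans h1B
  set M : ℝ := B * (Fintype.card ι + |α| + |1 + α| + 2 * |α| * Fintype.card ι + 2) with hM
  have hM0 : 0 ≤ M := by positivity
  -- the weighted energy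
  set E : ℝ → ℝ := fun s => ∫ y, Φ (s, y) * e s y with hE
  have hEnn : ∀ s, 0 ≤ E s := fun s => integral_nonneg fun y => mul_nonneg (hΦ0 _)
    (by rw [he]; positivity)
  have hE0 : E 0 = 0 := by simp only [hE, he0, integral_zero]
  have hEc : ContinuousOn E (Icc 0 τ) :=
    continuousOn_weightedEnergy hu₁ hu₂ hσ₁ hσ₂ hΦ hc0 hΦs he hτ
  -- ### the slice inequality `∫ ∂ₜ(Φe)(t', ·) ≤ M E(t')` for `0 < t' ≤ τ`
  have hslice : ∀ t' ∈ Ioc 0 τ, ∫ y, F' t' y ≤ M * E t' := by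
    intro t' ht'
    have ht'O : t' ∈ Ioo 0 t₁ := ⟨ht'.1, ht'.2.trans_lt hτ⟩
    have ht'I : t' ∈ Icc 0 τ := ⟨ht'.1.le, ht'.2⟩
    have hcone : ∀ y, Φ (t', y) ≠ 0 → ‖y - x₀‖ + c * t' < R := fun y hy => hΦs (t', y) hy
    have hball : ∀ y, Φ (t', y) ≠ 0 → y ∈ closedBall x₀ R := fun y hy => by
      rw [mem_closedBall, dist_eq_norm]
      nlinarith [hcone y hy, mul_nonneg hc0 ht'.1.le]
    have hφ1 : ContDiff ℝ 1 fun y => Φ (t', y) := hΦ.comp (contDiff_const.prodMk contDiff_id)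
    have hslice_fderiv : ∀ y, fderiv ℝ (fun y => Φ (t', y)) y =
        (fderiv ℝ Φ (t', y)).comp (ContinuousLinearMap.inr ℝ ℝ (EuclideanSpace ℝ ι)) := fun y =>
      (hasFDerivAt_slice_right ((hΦ.differentiable one_ne_zero) _).hasFDerivAt).fderiv
    simp only [hE, hF', he]
    refine slice_integral_le (φ := fun y => Φ (t', y)) (ψ := fun y => fderiv ℝ Φ (t', y) (1, 0))
      (x₀ := x₀) (R := R) (a₁ := u₁ t') (a₂ := u₂ t') (b₁ := σ₁ t') (b₂ := σ₂ t')
      (a₁' := fun y => deriv (fun s => u₁ s y) t') (a₂' := fun y => deriv (fun s => u₂ s y) t')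
      (b₁' := fun y => deriv (fun s => σ₁ s y) t') (b₂' := fun y => deriv (fun s => σ₂ s y) t')
      hφ1 (fun y => hΦ0 _) (fun y hy => ?_)
      (((hΦ.continuous_fderiv one_ne_zero).comp (continuous_const.prodMk continuous_id)).clm_apply
        continuous_const)
      (fun y hy => ?_) (fun y => ?_)
      (contDiff_space hu₁ ht'O) (contDiff_space hu₂ ht'O) (contDiff_space hσ₁ ht'O)
      (contDiff_space hσ₂ ht'O)
      (continuous_deriv_time hu₁ ht'O) (continuous_deriv_time hu₂ ht'O)
      (continuous_deriv_time hσ₁ ht'O) (continuous_deriv_time hσ₂ ht'O)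
      (fun y hy => ⟨hE₁ t' ht'O y (hcone y hy), hE₂ t' ht'O y (hcone y hy)⟩)
      (fun y hy => hc t' ht'O y (hcone y hy)) (fun y hy => ?_)
    · -- support in the ball
      nlinarith [hcone y hy, mul_nonneg hc0 ht'.1.le]
    · -- `∂ₜΦ` vanishes with `Φ`
      rw [fderiv_eq_zero_of_nonneg hΦ0 hy]; simp
    · -- recession condition
      rw [hslice_fderiv y]
      exact hΦd (t', y)
    · -- derivative bounds
      have hy' := hball y hy
      exact ⟨((hB₁ t' ht'I y hy').2 ht'O).2.trans h1B, ((hB₂ t' ht'I y hy').2 ht'O).2.trans h2B,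
        ((hB₃ t' ht'I y hy').2 ht'O).2.trans h3B, ((hB₄ t' ht'I y hy').2 ht'O).2.trans h4B⟩
  -- ### `E(τ') ≤ M ∫₀^{τ'} E` for `0 ≤ τ' ≤ τ`
  have hineq : ∀ τ' ∈ Icc 0 τ, E τ' ≤ M * ∫ s in (0 : ℝ)..τ', E s := by
    intro τ' hτ'
    obtain ⟨hid, hint⟩ := weightedEnergy_sub_eq hu₁ hu₂ hσ₁ hσ₂ hΦ hΦ0 hc0 hΦs he hF' hτ hτ'.1 hτ'.2
    have hEI : IntegrableOn (fun s => M * E s) (Ioc 0 τ') :=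
      ((hEc.mono (Icc_subset_Icc_right hτ'.2)).integrableOn_Icc.mono_set Ioc_subset_Icc_self).const_mul M
    have hmono : ∫ s in Ioc 0 τ', (∫ y, F' s y) ≤ ∫ s in Ioc 0 τ', M * E s :=
      setIntegral_mono_on hint hEI measurableSet_Ioc fun s hs => hslice s ⟨hs.1, hs.2.trans hτ'.2⟩
    rw [intervalIntegral.integral_of_le hτ'.1, ← integral_const_mul]
    have h : E τ' - E 0 = ∫ s in Ioc 0 τ', ∫ y, F' s y := hid
    rw [hE0, sub_zero] at h
    calc E τ' = ∫ s in Ioc 0 τ', ∫ y, F' s y := h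
      _ ≤ _ := hmono
  -- ### Grönwall: `E ≡ 0` on `[0, τ]`
  have hEr : Continuous ((Icc 0 τ).restrict E) := continuousOn_iff_continuous_restrict.1 hEc
  set Et : ℝ → ℝ := Set.IccExtend htpos.le ((Icc 0 τ).restrict E) with hEt
  have hEtc : Continuous Et := hEr.Icc_extend'
  have hEteq : ∀ s ∈ Icc 0 τ, Et s = E s := fun s hs => by
    rw [hEt, Set.IccExtend_of_mem _ _ hs]; rfl
  set G : ℝ → ℝ := fun r => ∫ s in (0 : ℝ)..r, Et s with hG
  have hGderiv : ∀ r, HasDerivAt G (Et r) r := fun r =>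
    intervalIntegral.integral_hasDerivAt_right (hEtc.intervalIntegrable _ _)
      (hEtc.stronglyMeasurableAtFilter _ _) hEtc.continuousAt
  have hGc : Continuous G := continuous_iff_continuousAt.mpr fun r => (hGderiv r).continuousAt
  have hGE : ∀ r ∈ Icc 0 τ, G r = ∫ s in (0 : ℝ)..r, E s := fun r hr =>
    intervalIntegral.integral_congr fun s hs => hEteq s (by
      rw [uIcc_of_le hr.1] at hs; exact ⟨hs.1, hs.2.trans hr.2⟩)
  have hGnn : ∀ r ∈ Icc 0 τ, 0 ≤ G r := fun r hr => by
    rw [hGE r hr]; exact intervalIntegral.integral_nonneg hr.1 fun s _ => hEnn s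
  have hG0 : ∀ r ∈ Icc 0 τ, G r = 0 :=
    eq_zero_of_abs_deriv_le_mul_abs_self_of_eq_zero_right (K := M) hGc.continuousOn
      (fun r _ => (hGderiv r).hasDerivWithinAt) (by simp [hG]) fun r hr => by
        have hrI : r ∈ Icc 0 τ := ⟨hr.1, hr.2.le⟩
        rw [hEteq r hrI, Real.norm_of_nonneg (hEnn r), Real.norm_of_nonneg (hGnn r hrI), hGE r hrI]
        exact hineq r hrI
  have hEτ : E τ = 0 := by
    have h1 := hineq τ ⟨htpos.le, le_rfl⟩
    rw [← hGE τ ⟨htpos.le, le_rfl⟩, hG0 τ ⟨htpos.le, le_rfl⟩, mul_zero] at h1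
    exact le_antisymm h1 (hEnn τ)
  -- ### conclusion: the (continuous, nonnegative) integrand vanishes identically at time `τ`
  have hslc : Continuous fun y => Φ (τ, y) * e τ y :=
    (continuousOn_weightedDensity hu₁ hu₂ hσ₁ hσ₂ hΦ he).comp_continuous
      (continuous_const.prodMk continuous_id) fun y => ⟨⟨htpos.le, hτ⟩, mem_univ _⟩
  have hsli : Integrable fun y => Φ (τ, y) * e τ y :=
    integrable_of_far hslc fun y hy => by rw [weight_eq_zero_far hc0 hΦs htpos.le hy, zero_mul]
  have hnn : 0 ≤ fun y => Φ (τ, y) * e τ y := fun y => mul_nonneg (hΦ0 _) (by rw [he]; positivity)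
  have hae := (integral_eq_zero_iff_of_nonneg hnn hsli).1 hEτ
  have hzero : (fun y => Φ (τ, y) * e τ y) = fun _ => 0 :=
    (hslc.ae_eq_iff_eq volume continuous_const).1 hae
  have hx0 : Φ (τ, x) * e τ x = 0 := congr_fun hzero x
  rcases mul_eq_zero.1 hx0 with h | h
  · exact absurd h hx
  · exact h

end Time

/-! ### The main theorem -/

section Main

/-- **Finite speed of propagation — local uniqueness in acoustic cones — for classical solutions of
the isentropic compressible Euler equations** (the classical-solution case of Dafermos,
*Hyperbolic Conservation Laws in Continuum Physics*, 2nd ed. 2005, Thm 5.2.1: local `L²` stability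
`∫_{|x|<R}|U − Ū|² ≤ a e^{bt} ∫_{|x|<R+st}|U₀ − Ū₀|²`, "in particular `Ū` is the unique … solution",
for systems with a convex entropy — of which the symmetric `(u, σ)`-form of isentropic Euler is the
prototype). Let `(u₁, σ₁)` and `(u₂, σ₂)` be `C¹` on the slab `[0, t₁) × ℝᵈ` (jointly in `(t,x)`,
one-sided at `t = 0`) and solve, on the open backward cone `‖x − x₀‖ + c t < R`, `0 < t < t₁`,
the isentropic Euler system in the variables `(u, σ = α⁻¹ρ^α)`,
`∂ₜσ + u·∇σ + α σ div u = 0`, `∂ₜu + (u·∇)u + α σ ∇σ = 0` (Cao-Labora–Gómez-Serrano–Shi–Staffilani,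
§1.3; here `div u = ∑ᵢ (∂ᵢu)ᵢ`, `(u·∇)u = Du(u)`, `∇σ` = Mathlib's `gradient`). If
`‖u₁‖ + |α σ₁| ≤ c` on that cone (`c ≥ 0` bounds the characteristic speeds `|u·n ± ασ|` of the
first solution) and the two solutions agree at `t = 0` on the ball `‖x − x₀‖ < R`, then they agree
on the whole cone `‖x − x₀‖ + c t < R`, `0 ≤ t < t₁`.
[cite: Dafermos2005, §5.2, Thm 5.2.1 and its proof (5.2.10)–(5.2.14)]
[cite: CaolaboraEtAl2025, §1.3 first display ((u,σ)-system) and Rem. 1.5 (finite speed of propagation)] -/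
theorem eqOn_cone_of_eqOn_ball [DecidableEq ι] {α c R t₁ : ℝ} {x₀ : (EuclideanSpace ℝ ι)} {u₁ u₂ : ℝ → (EuclideanSpace ℝ ι) → (EuclideanSpace ℝ ι)}
    {σ₁ σ₂ : ℝ → (EuclideanSpace ℝ ι) → ℝ}
    (hu₁ : ContDiffOn ℝ 1 (fun p : ℝ × (EuclideanSpace ℝ ι) => u₁ p.1 p.2) (Ico 0 t₁ ×ˢ univ))
    (hu₂ : ContDiffOn ℝ 1 (fun p : ℝ × (EuclideanSpace ℝ ι) => u₂ p.1 p.2) (Ico 0 t₁ ×ˢ univ))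
    (hσ₁ : ContDiffOn ℝ 1 (fun p : ℝ × (EuclideanSpace ℝ ι) => σ₁ p.1 p.2) (Ico 0 t₁ ×ˢ univ))
    (hσ₂ : ContDiffOn ℝ 1 (fun p : ℝ × (EuclideanSpace ℝ ι) => σ₂ p.1 p.2) (Ico 0 t₁ ×ˢ univ))
    (hE₁ : ∀ t ∈ Ioo 0 t₁, ∀ x, ‖x - x₀‖ + c * t < R →
      deriv (fun s => σ₁ s x) t + fderiv ℝ (σ₁ t) x (u₁ t x) +
          α * σ₁ t x * ∑ i, fderiv ℝ (u₁ t) x (EuclideanSpace.single i 1) i = 0 ∧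
        deriv (fun s => u₁ s x) t + fderiv ℝ (u₁ t) x (u₁ t x) + (α * σ₁ t x) • gradient (σ₁ t) x = 0)
    (hE₂ : ∀ t ∈ Ioo 0 t₁, ∀ x, ‖x - x₀‖ + c * t < R →
      deriv (fun s => σ₂ s x) t + fderiv ℝ (σ₂ t) x (u₂ t x) +
          α * σ₂ t x * ∑ i, fderiv ℝ (u₂ t) x (EuclideanSpace.single i 1) i = 0 ∧
        deriv (fun s => u₂ s x) t + fderiv ℝ (u₂ t) x (u₂ t x) + (α * σ₂ t x) • gradient (σ₂ t) x = 0)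
    (hc : ∀ t ∈ Ioo 0 t₁, ∀ x, ‖x - x₀‖ + c * t < R → ‖u₁ t x‖ + |α * σ₁ t x| ≤ c)
    (hc0 : 0 ≤ c) (h0 : ∀ x, ‖x - x₀‖ < R → u₁ 0 x = u₂ 0 x ∧ σ₁ 0 x = σ₂ 0 x)
    {t : ℝ} (ht : t ∈ Ico 0 t₁) {x : (EuclideanSpace ℝ ι)} (hx : ‖x - x₀‖ + c * t < R) :
    u₁ t x = u₂ t x ∧ σ₁ t x = σ₂ t x := by
  set ε : ℝ := (R - c * t - ‖x - x₀‖) / 2 with hε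
  have hε0 : 0 < ε := by rw [hε]; linarith
  refine eqOn_of_weight hu₁ hu₂ hσ₁ hσ₂ hE₁ hE₂ hc hc0 h0
    (Φ := fun p : ℝ × (EuclideanSpace ℝ ι) => Real.smoothTransition (R - c * p.1 - √(ε ^ 2 + ‖p.2 - x₀‖ ^ 2)))
    (contDiff_coneWeight hε0.ne') (fun p => coneWeight_nonneg ε c R x₀ p)
    (fun p hp => cone_of_coneWeight_ne_zero hp) (fun p => coneWeight_flux_le hε0.ne' hc0 p) ht ?_
  have h := coneWeight_pos (c := c) (R := R) (x₀ := x₀) (p := (t, x)) hx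
  exact h.ne'

end Main

/-! ### Variable (integrable) characteristic speed: the curved cone `‖x − x₀‖ + Γ(t) < R` -/

section VariableSpeed

/-- **Uniform bound on `∂ₜ(Φ e)` down to `t = 0`** (support hypothesis in "far-field" form). For `τ < t₁` there is `C` with
`|∂ₜ(Φe)(t, y)| ≤ C` for `0 < t ≤ τ` and all `y`, and `∂ₜ(Φe)(t,y) = 0` for `‖y − x₀‖ > R`
(`Φ ≥ 0` is supported in the cone over `B(x₀, R)`, so `Φ` and `dΦ` vanish off it). [folklore] -/
theorem exists_bound_densityDeriv' {R t₁ : ℝ} {x₀ : (EuclideanSpace ℝ ι)} {u₁ u₂ : ℝ → (EuclideanSpace ℝ ι) → (EuclideanSpace ℝ ι)} {σ₁ σ₂ : ℝ → (EuclideanSpace ℝ ι) → ℝ}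
    {Φ : ℝ × (EuclideanSpace ℝ ι) → ℝ} {e F' : ℝ → (EuclideanSpace ℝ ι) → ℝ}
    (hu₁ : ContDiffOn ℝ 1 (fun p : ℝ × (EuclideanSpace ℝ ι) => u₁ p.1 p.2) (Ico 0 t₁ ×ˢ univ))
    (hu₂ : ContDiffOn ℝ 1 (fun p : ℝ × (EuclideanSpace ℝ ι) => u₂ p.1 p.2) (Ico 0 t₁ ×ˢ univ))
    (hσ₁ : ContDiffOn ℝ 1 (fun p : ℝ × (EuclideanSpace ℝ ι) => σ₁ p.1 p.2) (Ico 0 t₁ ×ˢ univ))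
    (hσ₂ : ContDiffOn ℝ 1 (fun p : ℝ × (EuclideanSpace ℝ ι) => σ₂ p.1 p.2) (Ico 0 t₁ ×ˢ univ))
    (hΦ : ContDiff ℝ 1 Φ) (hΦ0 : ∀ p, 0 ≤ Φ p)
    (hΦfar : ∀ t, 0 ≤ t → ∀ y, R < ‖y - x₀‖ → Φ (t, y) = 0)
    (he : ∀ t y, e t y = ((σ₁ t y - σ₂ t y) ^ 2 + ‖u₁ t y - u₂ t y‖ ^ 2) / 2)
    (hF' : ∀ t y, F' t y = fderiv ℝ Φ (t, y) (1, 0) * e t y + Φ (t, y) *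
      ((σ₁ t y - σ₂ t y) * (deriv (fun s => σ₁ s y) t - deriv (fun s => σ₂ s y) t) +
        ⟪u₁ t y - u₂ t y, deriv (fun s => u₁ s y) t - deriv (fun s => u₂ s y) t⟫))
    {τ : ℝ} (hτ : τ < t₁) :
    (∀ t, 0 ≤ t → ∀ y, R < ‖y - x₀‖ → F' t y = 0) ∧
      ∃ C : ℝ, ∀ t ∈ Ioc 0 τ, t < t₁ → ∀ y, |F' t y| ≤ C := by
  have hDΦ0 : ∀ p, Φ p = 0 → fderiv ℝ Φ p = 0 := fun p hp => fderiv_eq_zero_of_nonneg hΦ0 hp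
  refine ⟨fun t ht y hy => ?_, ?_⟩
  · rw [hF', hΦfar t ht y hy, hDΦ0 _ (hΦfar t ht y hy)]; simp
  -- bounds
  obtain ⟨B₁, -, hB₁⟩ := exists_bound_slab hu₁ hτ x₀ R
  obtain ⟨B₂, -, hB₂⟩ := exists_bound_slab hu₂ hτ x₀ R
  obtain ⟨B₃, -, hB₃⟩ := exists_bound_slab hσ₁ hτ x₀ R
  obtain ⟨B₄, -, hB₄⟩ := exists_bound_slab hσ₂ hτ x₀ R
  have hK : IsCompact (Icc 0 τ ×ˢ closedBall x₀ R) := isCompact_Icc.prod (isCompact_closedBall x₀ R)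
  obtain ⟨C₁'', hC₁''⟩ := hK.exists_bound_of_continuousOn hΦ.continuous.continuousOn
  obtain ⟨C₂'', hC₂''⟩ := hK.exists_bound_of_continuousOn
    (hΦ.continuous_fderiv one_ne_zero).continuousOn
  set C₁ : ℝ := max C₁'' 0 with hC₁def
  set C₂ : ℝ := max C₂'' 0 with hC₂def
  have hC₁ : ∀ p ∈ Icc 0 τ ×ˢ closedBall x₀ R, ‖Φ p‖ ≤ C₁ := fun p hp =>
    (hC₁'' p hp).trans (le_max_left _ _)
  have hC₂ : ∀ p ∈ Icc 0 τ ×ˢ closedBall x₀ R, ‖fderiv ℝ Φ p‖ ≤ C₂ := fun p hp =>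
    (hC₂'' p hp).trans (le_max_left _ _)
  have hC₁0 : 0 ≤ C₁ := le_max_right _ _
  have hC₂0 : 0 ≤ C₂ := le_max_right _ _
  set B : ℝ := max (max B₁ B₂) (max B₃ B₄) with hBdef
  have h1B : B₁ ≤ B := (le_max_left _ _).trans (le_max_left _ _)
  have h2B : B₂ ≤ B := (le_max_right _ _).trans (le_max_left _ _)
  have h3B : B₃ ≤ B := (le_max_left _ _).trans (le_max_right _ _)
  have h4B : B₄ ≤ B := (le_max_right _ _).trans (le_max_right _ _)
  refine ⟨C₂ * (((B + B) ^ 2 + (B + B) ^ 2) / 2) + C₁ * ((B + B) * (B + B) + (B + B) * (B + B)),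
    fun t ht ht₁ y => ?_⟩
  by_cases hy : y ∈ closedBall x₀ R
  · have htI : t ∈ Icc 0 τ := ⟨ht.1.le, ht.2⟩
    have htO : t ∈ Ioo 0 t₁ := ⟨ht.1, ht₁⟩
    have hmem : (t, y) ∈ Icc 0 τ ×ˢ closedBall x₀ R := ⟨htI, hy⟩
    obtain ⟨hu₁v, hu₁d⟩ := hB₁ t htI y hy
    obtain ⟨hu₂v, hu₂d⟩ := hB₂ t htI y hy
    obtain ⟨hσ₁v, hσ₁d⟩ := hB₃ t htI y hy
    obtain ⟨hσ₂v, hσ₂d⟩ := hB₄ t htI y hy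
    have hu₁t := (hu₁d htO).1
    have hu₂t := (hu₂d htO).1
    have hσ₁t := (hσ₁d htO).1
    have hσ₂t := (hσ₂d htO).1
    -- elementary bounds
    have hs : ‖σ₁ t y - σ₂ t y‖ ≤ B + B :=
      (norm_sub_le _ _).trans (add_le_add (hσ₁v.trans h3B) (hσ₂v.trans h4B))
    have hw : ‖u₁ t y - u₂ t y‖ ≤ B + B :=
      (norm_sub_le _ _).trans (add_le_add (hu₁v.trans h1B) (hu₂v.trans h2B))
    have hst : ‖deriv (fun s => σ₁ s y) t - deriv (fun s => σ₂ s y) t‖ ≤ B + B :=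
      (norm_sub_le _ _).trans (add_le_add (hσ₁t.trans h3B) (hσ₂t.trans h4B))
    have hwt : ‖deriv (fun s => u₁ s y) t - deriv (fun s => u₂ s y) t‖ ≤ B + B :=
      (norm_sub_le _ _).trans (add_le_add (hu₁t.trans h1B) (hu₂t.trans h2B))
    have hB0 : 0 ≤ B + B := (norm_nonneg _).trans hs
    have he0 : 0 ≤ e t y := by rw [he]; positivity
    have heB : e t y ≤ ((B + B) ^ 2 + (B + B) ^ 2) / 2 := by
      rw [he]
      have h1 : (σ₁ t y - σ₂ t y) ^ 2 ≤ (B + B) ^ 2 := by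
        rw [← sq_abs, ← Real.norm_eq_abs]; exact pow_le_pow_left₀ (norm_nonneg _) hs 2
      have h2 : ‖u₁ t y - u₂ t y‖ ^ 2 ≤ (B + B) ^ 2 := pow_le_pow_left₀ (norm_nonneg _) hw 2
      linarith
    have hΦt : ‖fderiv ℝ Φ (t, y) (1, 0)‖ ≤ C₂ := (norm_apply_one_zero_le _).trans (hC₂ _ hmem)
    have hΦv : ‖Φ (t, y)‖ ≤ C₁ := hC₁ _ hmem
    have hin : ‖(σ₁ t y - σ₂ t y) * (deriv (fun s => σ₁ s y) t - deriv (fun s => σ₂ s y) t) +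
        ⟪u₁ t y - u₂ t y, deriv (fun s => u₁ s y) t - deriv (fun s => u₂ s y) t⟫‖ ≤
        (B + B) * (B + B) + (B + B) * (B + B) := by
      refine (norm_add_le _ _).trans (add_le_add ?_ ?_)
      · rw [norm_mul]; exact mul_le_mul hs hst (norm_nonneg _) hB0
      · exact (norm_inner_le_norm _ _).trans (mul_le_mul hw hwt (norm_nonneg _) hB0)
    rw [hF', ← Real.norm_eq_abs]
    refine (norm_add_le _ _).trans (add_le_add ?_ ?_)
    · rw [norm_mul, Real.norm_of_nonneg he0]
      exact mul_le_mul hΦt heB he0 hC₂0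
    · rw [norm_mul]
      exact mul_le_mul hΦv hin (norm_nonneg _) hC₁0
  · rw [mem_closedBall, dist_eq_norm, not_le] at hy
    have h0 : F' t y = 0 := by
      rw [hF', hΦfar t ht.1.le y hy, hDΦ0 _ (hΦfar t ht.1.le y hy)]; simp
    rw [h0, abs_zero]
    exact add_nonneg (mul_nonneg hC₂0 (by positivity))
      (mul_nonneg hC₁0 (add_nonneg (mul_self_nonneg _) (mul_self_nonneg _)))


/-- **The weighted energy is continuous on `[0, τ]`** (far-field form), `τ < t₁` (dominated convergence: the
integrand is jointly continuous on the compact `[0, τ] × B̄(x₀, R)` and vanishes off it). [folklore] -/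
theorem continuousOn_weightedEnergy' {R t₁ : ℝ} {x₀ : (EuclideanSpace ℝ ι)} {u₁ u₂ : ℝ → (EuclideanSpace ℝ ι) → (EuclideanSpace ℝ ι)}
    {σ₁ σ₂ : ℝ → (EuclideanSpace ℝ ι) → ℝ} {Φ : ℝ × (EuclideanSpace ℝ ι) → ℝ} {e : ℝ → (EuclideanSpace ℝ ι) → ℝ}
    (hu₁ : ContDiffOn ℝ 1 (fun p : ℝ × (EuclideanSpace ℝ ι) => u₁ p.1 p.2) (Ico 0 t₁ ×ˢ univ))
    (hu₂ : ContDiffOn ℝ 1 (fun p : ℝ × (EuclideanSpace ℝ ι) => u₂ p.1 p.2) (Ico 0 t₁ ×ˢ univ))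
    (hσ₁ : ContDiffOn ℝ 1 (fun p : ℝ × (EuclideanSpace ℝ ι) => σ₁ p.1 p.2) (Ico 0 t₁ ×ˢ univ))
    (hσ₂ : ContDiffOn ℝ 1 (fun p : ℝ × (EuclideanSpace ℝ ι) => σ₂ p.1 p.2) (Ico 0 t₁ ×ˢ univ))
    (hΦ : ContDiff ℝ 1 Φ) (hΦfar : ∀ t, 0 ≤ t → ∀ y, R < ‖y - x₀‖ → Φ (t, y) = 0)
    (he : ∀ t y, e t y = ((σ₁ t y - σ₂ t y) ^ 2 + ‖u₁ t y - u₂ t y‖ ^ 2) / 2)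
    {τ : ℝ} (hτ : τ < t₁) :
    ContinuousOn (fun t => ∫ y, Φ (t, y) * e t y) (Icc 0 τ) := by
  have hK : IsCompact (Icc 0 τ ×ˢ closedBall x₀ R) := isCompact_Icc.prod (isCompact_closedBall x₀ R)
  have hcont := continuousOn_weightedDensity hu₁ hu₂ hσ₁ hσ₂ hΦ he
  have hKS : Icc 0 τ ×ˢ closedBall x₀ R ⊆ Ico 0 t₁ ×ˢ univ :=
    prod_mono (Icc_subset_Ico_right hτ) (subset_univ _)
  obtain ⟨C, hC⟩ := hK.exists_bound_of_continuousOn (hcont.mono hKS)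
  refine continuousOn_of_dominated (bound := (closedBall x₀ R).indicator fun _ => C) ?_ ?_ ?_ ?_
  · intro t ht
    have htI : t ∈ Ico 0 t₁ := ⟨ht.1, ht.2.trans_lt hτ⟩
    exact (hcont.comp_continuous (continuous_const.prodMk continuous_id)
      fun y => ⟨htI, mem_univ _⟩).aestronglyMeasurable
  · intro t ht
    refine Filter.Eventually.of_forall fun y => ?_
    by_cases hy : y ∈ closedBall x₀ R
    · rw [indicator_of_mem hy]
      exact hC (t, y) ⟨ht, hy⟩
    · rw [indicator_of_notMem hy]
      rw [mem_closedBall, dist_eq_norm, not_le] at hy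
      rw [hΦfar t ht.1 y hy, zero_mul, norm_zero]
  · exact (integrableOn_const (hs := measure_closedBall_lt_top.ne)).integrable_indicator
      measurableSet_closedBall
  · refine Filter.Eventually.of_forall fun y => ?_
    exact hcont.comp (continuous_id.prodMk continuous_const).continuousOn
      fun t ht => ⟨⟨ht.1, ht.2.trans_lt hτ⟩, mem_univ _⟩


/-- **The weighted energy identity** (far-field form): `E(τ') − E(0) = ∫₀^{τ'} ∫ ∂ₜ(Φ e) dy dt`, `0 ≤ τ' ≤ τ < t₁`
(fundamental theorem of calculus pointwise in `y`, then Fubini; the time integrand is integrable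
on `(0, τ']`). [cite: Dafermos2005, §5.2, proof of Thm 5.2.1, (5.2.13)–(5.2.14)] -/
theorem weightedEnergy_sub_eq' {R t₁ : ℝ} {x₀ : (EuclideanSpace ℝ ι)} {u₁ u₂ : ℝ → (EuclideanSpace ℝ ι) → (EuclideanSpace ℝ ι)}
    {σ₁ σ₂ : ℝ → (EuclideanSpace ℝ ι) → ℝ} {Φ : ℝ × (EuclideanSpace ℝ ι) → ℝ} {e F' : ℝ → (EuclideanSpace ℝ ι) → ℝ}
    (hu₁ : ContDiffOn ℝ 1 (fun p : ℝ × (EuclideanSpace ℝ ι) => u₁ p.1 p.2) (Ico 0 t₁ ×ˢ univ))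
    (hu₂ : ContDiffOn ℝ 1 (fun p : ℝ × (EuclideanSpace ℝ ι) => u₂ p.1 p.2) (Ico 0 t₁ ×ˢ univ))
    (hσ₁ : ContDiffOn ℝ 1 (fun p : ℝ × (EuclideanSpace ℝ ι) => σ₁ p.1 p.2) (Ico 0 t₁ ×ˢ univ))
    (hσ₂ : ContDiffOn ℝ 1 (fun p : ℝ × (EuclideanSpace ℝ ι) => σ₂ p.1 p.2) (Ico 0 t₁ ×ˢ univ))
    (hΦ : ContDiff ℝ 1 Φ) (hΦ0 : ∀ p, 0 ≤ Φ p)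
    (hΦfar : ∀ t, 0 ≤ t → ∀ y, R < ‖y - x₀‖ → Φ (t, y) = 0)
    (he : ∀ t y, e t y = ((σ₁ t y - σ₂ t y) ^ 2 + ‖u₁ t y - u₂ t y‖ ^ 2) / 2)
    (hF' : ∀ t y, F' t y = fderiv ℝ Φ (t, y) (1, 0) * e t y + Φ (t, y) *
      ((σ₁ t y - σ₂ t y) * (deriv (fun s => σ₁ s y) t - deriv (fun s => σ₂ s y) t) +
        ⟪u₁ t y - u₂ t y, deriv (fun s => u₁ s y) t - deriv (fun s => u₂ s y) t⟫))
    {τ τ' : ℝ} (hτ : τ < t₁) (hτ'0 : 0 ≤ τ') (hτ'τ : τ' ≤ τ) :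
    (∫ y, Φ (τ', y) * e τ' y) - (∫ y, Φ (0, y) * e 0 y) = ∫ t in Ioc 0 τ', ∫ y, F' t y ∧
      IntegrableOn (fun t => ∫ y, F' t y) (Ioc 0 τ') := by
  obtain ⟨hF0, C, hC⟩ := exists_bound_densityDeriv' hu₁ hu₂ hσ₁ hσ₂ hΦ hΦ0 hΦfar he hF' hτ
  have hGc := continuousOn_densityDeriv hu₁ hu₂ hσ₁ hσ₂ hΦ he hF'
  have hDc := continuousOn_weightedDensity hu₁ hu₂ hσ₁ hσ₂ hΦ he
  have hτ't₁ : τ' < t₁ := hτ'τ.trans_lt hτ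
  -- the fundamental theorem of calculus, pointwise in `y`
  have hFTC : ∀ y, ∫ t in (0 : ℝ)..τ', F' t y = Φ (τ', y) * e τ' y - Φ (0, y) * e 0 y := by
    intro y
    apply intervalIntegral.integral_eq_sub_of_hasDerivAt_of_le hτ'0
    · exact hDc.comp (continuous_id.prodMk continuous_const).continuousOn
        fun t ht => ⟨⟨ht.1, ht.2.trans_lt hτ't₁⟩, mem_univ _⟩
    · intro t ht
      exact hasDerivAt_weightedDensity hu₁ hu₂ hσ₁ hσ₂ hΦ he hF' ⟨ht.1, ht.2.trans hτ't₁⟩ y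
    · rw [intervalIntegrable_iff_integrableOn_Ioc_of_le hτ'0]
      refine IntegrableOn.of_bound measure_Ioc_lt_top ?_ C ?_
      · refine ContinuousOn.aestronglyMeasurable ?_ measurableSet_Ioc
        exact hGc.comp (continuous_id.prodMk continuous_const).continuousOn
          fun t ht => ⟨⟨ht.1, ht.2.trans_lt hτ't₁⟩, mem_univ _⟩
      · exact ae_restrict_of_forall_mem measurableSet_Ioc fun t ht => by
          rw [Real.norm_eq_abs]
          exact hC t ⟨ht.1, ht.2.trans hτ'τ⟩ (ht.2.trans_lt hτ't₁) y
  -- integrability on the product `(0, τ'] × ℝᵈ`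
  have hprod : IntegrableOn (fun p : ℝ × (EuclideanSpace ℝ ι) => F' p.1 p.2) (Ioc 0 τ' ×ˢ univ) volume := by
    have h1 : IntegrableOn (fun p : ℝ × (EuclideanSpace ℝ ι) => F' p.1 p.2) (Ioc 0 τ' ×ˢ closedBall x₀ R) volume := by
      refine IntegrableOn.of_bound ?_ ?_ C ?_
      · calc volume (Ioc 0 τ' ×ˢ closedBall x₀ R)
            ≤ volume (Icc 0 τ' ×ˢ closedBall x₀ R) := measure_mono (prod_mono Ioc_subset_Icc_self le_rfl)
          _ < ⊤ := (isCompact_Icc.prod (isCompact_closedBall x₀ R)).measure_lt_top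
      · refine ContinuousOn.aestronglyMeasurable ?_ (measurableSet_Ioc.prod measurableSet_closedBall)
        exact hGc.mono (prod_mono (fun t ht => ⟨ht.1, ht.2.trans_lt hτ't₁⟩) (subset_univ _))
      · exact ae_restrict_of_forall_mem (measurableSet_Ioc.prod measurableSet_closedBall)
          fun p hp => by
            rw [Real.norm_eq_abs]
            exact hC p.1 ⟨hp.1.1, hp.1.2.trans hτ'τ⟩ (hp.1.2.trans_lt hτ't₁) p.2
    refine h1.of_forall_sdiff_eq_zero (measurableSet_Ioc.prod MeasurableSet.univ) fun p hp => ?_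
    have hp1 : p.1 ∈ Ioc 0 τ' := hp.1.1
    have hp2 : p.2 ∉ closedBall x₀ R := fun h => hp.2 ⟨hp1, h⟩
    rw [mem_closedBall, dist_eq_norm, not_le] at hp2
    exact hF0 p.1 hp1.1.le p.2 hp2
  have hprod' : Integrable (Function.uncurry fun t y => F' t y)
      ((volume.restrict (Ioc 0 τ')).prod (volume : Measure (EuclideanSpace ℝ ι))) := by
    rw [← Measure.restrict_univ (μ := (volume : Measure (EuclideanSpace ℝ ι))), Measure.prod_restrict,
      ← Measure.volume_eq_prod]
    exact hprod
  refine ⟨?_, hprod'.integral_prod_left⟩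
  have hEτ : Integrable fun y => Φ (τ', y) * e τ' y :=
    integrable_of_far (hDc.comp_continuous (continuous_const.prodMk continuous_id)
      fun y => ⟨⟨hτ'0, hτ't₁⟩, mem_univ _⟩)
      fun y hy => by rw [hΦfar τ' hτ'0 y hy, zero_mul]
  have hE0 : Integrable fun y => Φ (0, y) * e 0 y :=
    integrable_of_far (hDc.comp_continuous (continuous_const.prodMk continuous_id)
      fun y => ⟨⟨le_rfl, hτ'0.trans_lt hτ't₁⟩, mem_univ _⟩)
      fun y hy => by rw [hΦfar 0 le_rfl y hy, zero_mul]
  calc (∫ y, Φ (τ', y) * e τ' y) - ∫ y, Φ (0, y) * e 0 y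
      = ∫ y, (Φ (τ', y) * e τ' y - Φ (0, y) * e 0 y) := (integral_sub hEτ hE0).symm
    _ = ∫ y, ∫ t in Ioc 0 τ', F' t y := integral_congr_ae (Filter.Eventually.of_forall fun y => by
        simp only
        rw [← hFTC y, intervalIntegral.integral_of_le hτ'0])
    _ = ∫ t in Ioc 0 τ', ∫ y, F' t y := (integral_integral_swap hprod').symm


/-- **The energy method with an abstract weight and a variable speed** `c(t)` (cone
`‖x − x₀‖ + Γ(t) < R`, `Γ ≥ 0`; the recession condition is `∂ₜΦ + c(t)‖∇ₓΦ‖ ≤ 0`). Let `(u₁, σ₁)`, `(u₂, σ₂)` be `C¹` on the slab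
`[0, t₁) × ℝᵈ`, solve the `(u,σ)`-system on the open cone `‖x − x₀‖ + ct < R`, `0 < t < t₁`, with
`‖u₁‖ + |α σ₁| ≤ c` there, and agree at `t = 0` on `‖x − x₀‖ < R`. Let `Φ ≥ 0` be a `C¹` weight
supported in the cone and receding at speed `c` (`∂ₜΦ + c ‖∇ₓΦ‖ ≤ 0`). Then the two solutions agree
wherever `Φ ≠ 0`. [cite: Dafermos2005, §5.2, Thm 5.2.1 and its proof] -/
theorem eqOn_of_weight_var [DecidableEq ι] {α R t₁ : ℝ} {c Γ : ℝ → ℝ} {x₀ : (EuclideanSpace ℝ ι)} {u₁ u₂ : ℝ → (EuclideanSpace ℝ ι) → (EuclideanSpace ℝ ι)}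
    {σ₁ σ₂ : ℝ → (EuclideanSpace ℝ ι) → ℝ} {Φ : ℝ × (EuclideanSpace ℝ ι) → ℝ}
    (hu₁ : ContDiffOn ℝ 1 (fun p : ℝ × (EuclideanSpace ℝ ι) => u₁ p.1 p.2) (Ico 0 t₁ ×ˢ univ))
    (hu₂ : ContDiffOn ℝ 1 (fun p : ℝ × (EuclideanSpace ℝ ι) => u₂ p.1 p.2) (Ico 0 t₁ ×ˢ univ))
    (hσ₁ : ContDiffOn ℝ 1 (fun p : ℝ × (EuclideanSpace ℝ ι) => σ₁ p.1 p.2) (Ico 0 t₁ ×ˢ univ))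
    (hσ₂ : ContDiffOn ℝ 1 (fun p : ℝ × (EuclideanSpace ℝ ι) => σ₂ p.1 p.2) (Ico 0 t₁ ×ˢ univ))
    (hE₁ : ∀ t ∈ Ioo 0 t₁, ∀ x, ‖x - x₀‖ + Γ t < R →
      deriv (fun s => σ₁ s x) t + fderiv ℝ (σ₁ t) x (u₁ t x) +
          α * σ₁ t x * ∑ i, fderiv ℝ (u₁ t) x (EuclideanSpace.single i 1) i = 0 ∧
        deriv (fun s => u₁ s x) t + fderiv ℝ (u₁ t) x (u₁ t x) + (α * σ₁ t x) • gradient (σ₁ t) x = 0)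
    (hE₂ : ∀ t ∈ Ioo 0 t₁, ∀ x, ‖x - x₀‖ + Γ t < R →
      deriv (fun s => σ₂ s x) t + fderiv ℝ (σ₂ t) x (u₂ t x) +
          α * σ₂ t x * ∑ i, fderiv ℝ (u₂ t) x (EuclideanSpace.single i 1) i = 0 ∧
        deriv (fun s => u₂ s x) t + fderiv ℝ (u₂ t) x (u₂ t x) + (α * σ₂ t x) • gradient (σ₂ t) x = 0)
    (hc : ∀ t ∈ Ioo 0 t₁, ∀ x, ‖x - x₀‖ + Γ t < R → ‖u₁ t x‖ + |α * σ₁ t x| ≤ c t)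
    (hΓ0 : ∀ t, 0 ≤ t → 0 ≤ Γ t) (h0 : ∀ x, ‖x - x₀‖ < R → u₁ 0 x = u₂ 0 x ∧ σ₁ 0 x = σ₂ 0 x)
    (hΦ : ContDiff ℝ 1 Φ) (hΦ0 : ∀ p, 0 ≤ Φ p) (hΦs : ∀ p, Φ p ≠ 0 → ‖p.2 - x₀‖ + Γ p.1 < R)
    (hΦd : ∀ p, fderiv ℝ Φ p (1, 0) +
      c p.1 * ‖(fderiv ℝ Φ p).comp (ContinuousLinearMap.inr ℝ ℝ (EuclideanSpace ℝ ι))‖ ≤ 0)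
    {t : ℝ} (ht : t ∈ Ico 0 t₁) {x : (EuclideanSpace ℝ ι)} (hx : Φ (t, x) ≠ 0) :
    u₁ t x = u₂ t x ∧ σ₁ t x = σ₂ t x := by
  -- name the energy density, its weighted time derivative and the weighted energy
  obtain ⟨e, he⟩ : ∃ e : ℝ → (EuclideanSpace ℝ ι) → ℝ,
      ∀ t y, e t y = ((σ₁ t y - σ₂ t y) ^ 2 + ‖u₁ t y - u₂ t y‖ ^ 2) / 2 := ⟨_, fun _ _ => rfl⟩
  obtain ⟨F', hF'⟩ : ∃ F' : ℝ → (EuclideanSpace ℝ ι) → ℝ, ∀ t y, F' t y = fderiv ℝ Φ (t, y) (1, 0) * e t y +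
      Φ (t, y) * ((σ₁ t y - σ₂ t y) * (deriv (fun s => σ₁ s y) t - deriv (fun s => σ₂ s y) t) +
        ⟪u₁ t y - u₂ t y, deriv (fun s => u₁ s y) t - deriv (fun s => u₂ s y) t⟫) :=
    ⟨_, fun _ _ => rfl⟩
  -- it suffices to show that the energy density vanishes at `(t, x)`
  suffices hex : e t x = 0 by
    rw [he] at hex
    have h1 : (σ₁ t x - σ₂ t x) ^ 2 = 0 := by
      nlinarith [sq_nonneg (σ₁ t x - σ₂ t x), sq_nonneg ‖u₁ t x - u₂ t x‖]
    have h2 : ‖u₁ t x - u₂ t x‖ ^ 2 = 0 := by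
      nlinarith [sq_nonneg (σ₁ t x - σ₂ t x), sq_nonneg ‖u₁ t x - u₂ t x‖]
    rw [sq_eq_zero_iff, sub_eq_zero] at h1
    rw [sq_eq_zero_iff, norm_eq_zero, sub_eq_zero] at h2
    exact ⟨h2, h1⟩
  -- `Φ` vanishes in the far field for `t ≥ 0`
  have hΦfar : ∀ t, 0 ≤ t → ∀ y, R < ‖y - x₀‖ → Φ (t, y) = 0 := by
    intro t ht y hy
    by_contra h
    have h1 := hΦs (t, y) h
    have h2 := hΓ0 t ht
    simp only at h1
    linarith
  -- data: the energy density vanishes at `t = 0` wherever `Φ ≠ 0`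
  have he0 : ∀ y, Φ (0, y) * e 0 y = 0 := by
    intro y
    by_cases hy : Φ (0, y) = 0
    · rw [hy, zero_mul]
    · have h := hΦs (0, y) hy
      have hΓ := hΓ0 0 le_rfl
      simp only at h
      obtain ⟨hu, hσ⟩ := h0 y (by linarith)
      rw [he, hu, hσ]; simp
  rcases ht.1.eq_or_lt with h | htpos
  · -- `t = 0`
    subst h
    have h := he0 x
    rcases mul_eq_zero.1 h with h | h
    · exact absurd h hx
    · exact h
  -- `0 < t =: τ`
  set τ := t with hτdef
  have hτ : τ < t₁ := ht.2
  -- uniform bounds on `[0, τ] × B̄(x₀, R)`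
  obtain ⟨B₁, hB₁0, hB₁⟩ := exists_bound_slab hu₁ hτ x₀ R
  obtain ⟨B₂, -, hB₂⟩ := exists_bound_slab hu₂ hτ x₀ R
  obtain ⟨B₃, -, hB₃⟩ := exists_bound_slab hσ₁ hτ x₀ R
  obtain ⟨B₄, -, hB₄⟩ := exists_bound_slab hσ₂ hτ x₀ R
  set B : ℝ := max (max B₁ B₂) (max B₃ B₄) with hBdef
  have h1B : B₁ ≤ B := (le_max_left _ _).trans (le_max_left _ _)
  have h2B : B₂ ≤ B := (le_max_right _ _).trans (le_max_left _ _)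
  have h3B : B₃ ≤ B := (le_max_left _ _).trans (le_max_right _ _)
  have h4B : B₄ ≤ B := (le_max_right _ _).trans (le_max_right _ _)
  have hB0 : 0 ≤ B := hB₁0.trans h1B
  set M : ℝ := B * (Fintype.card ι + |α| + |1 + α| + 2 * |α| * Fintype.card ι + 2) with hM
  have hM0 : 0 ≤ M := by positivity
  -- the weighted energy
  set E : ℝ → ℝ := fun s => ∫ y, Φ (s, y) * e s y with hE
  have hEnn : ∀ s, 0 ≤ E s := fun s => integral_nonneg fun y => mul_nonneg (hΦ0 _)
    (by rw [he]; positivity)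
  have hE0 : E 0 = 0 := by simp only [hE, he0, integral_zero]
  have hEc : ContinuousOn E (Icc 0 τ) :=
    continuousOn_weightedEnergy' hu₁ hu₂ hσ₁ hσ₂ hΦ hΦfar he hτ
  -- ### the slice inequality `∫ ∂ₜ(Φe)(t', ·) ≤ M E(t')` for `0 < t' ≤ τ`
  have hslice : ∀ t' ∈ Ioc 0 τ, ∫ y, F' t' y ≤ M * E t' := by
    intro t' ht'
    have ht'O : t' ∈ Ioo 0 t₁ := ⟨ht'.1, ht'.2.trans_lt hτ⟩
    have ht'I : t' ∈ Icc 0 τ := ⟨ht'.1.le, ht'.2⟩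
    have hcone : ∀ y, Φ (t', y) ≠ 0 → ‖y - x₀‖ + Γ t' < R := fun y hy => hΦs (t', y) hy
    have hball : ∀ y, Φ (t', y) ≠ 0 → y ∈ closedBall x₀ R := fun y hy => by
      rw [mem_closedBall, dist_eq_norm]
      linarith [hcone y hy, hΓ0 t' ht'.1.le]
    have hφ1 : ContDiff ℝ 1 fun y => Φ (t', y) := hΦ.comp (contDiff_const.prodMk contDiff_id)
    have hslice_fderiv : ∀ y, fderiv ℝ (fun y => Φ (t', y)) y =
        (fderiv ℝ Φ (t', y)).comp (ContinuousLinearMap.inr ℝ ℝ (EuclideanSpace ℝ ι)) := fun y =>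
      (hasFDerivAt_slice_right ((hΦ.differentiable one_ne_zero) _).hasFDerivAt).fderiv
    simp only [hE, hF', he]
    refine slice_integral_le (φ := fun y => Φ (t', y)) (ψ := fun y => fderiv ℝ Φ (t', y) (1, 0))
      (x₀ := x₀) (R := R) (c := c t') (a₁ := u₁ t') (a₂ := u₂ t') (b₁ := σ₁ t') (b₂ := σ₂ t')
      (a₁' := fun y => deriv (fun s => u₁ s y) t') (a₂' := fun y => deriv (fun s => u₂ s y) t')
      (b₁' := fun y => deriv (fun s => σ₁ s y) t') (b₂' := fun y => deriv (fun s => σ₂ s y) t')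
      hφ1 (fun y => hΦ0 _) (fun y hy => ?_)
      (((hΦ.continuous_fderiv one_ne_zero).comp (continuous_const.prodMk continuous_id)).clm_apply
        continuous_const)
      (fun y hy => ?_) (fun y => ?_)
      (contDiff_space hu₁ ht'O) (contDiff_space hu₂ ht'O) (contDiff_space hσ₁ ht'O)
      (contDiff_space hσ₂ ht'O)
      (continuous_deriv_time hu₁ ht'O) (continuous_deriv_time hu₂ ht'O)
      (continuous_deriv_time hσ₁ ht'O) (continuous_deriv_time hσ₂ ht'O)
      (fun y hy => ⟨hE₁ t' ht'O y (hcone y hy), hE₂ t' ht'O y (hcone y hy)⟩)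
      (fun y hy => hc t' ht'O y (hcone y hy)) (fun y hy => ?_)
    · -- support in the ball
      linarith [hcone y hy, hΓ0 t' ht'.1.le]
    · -- `∂ₜΦ` vanishes with `Φ`
      rw [fderiv_eq_zero_of_nonneg hΦ0 hy]; simp
    · -- recession condition
      rw [hslice_fderiv y]
      exact hΦd (t', y)
    · -- derivative bounds
      have hy' := hball y hy
      exact ⟨((hB₁ t' ht'I y hy').2 ht'O).2.trans h1B, ((hB₂ t' ht'I y hy').2 ht'O).2.trans h2B,
        ((hB₃ t' ht'I y hy').2 ht'O).2.trans h3B, ((hB₄ t' ht'I y hy').2 ht'O).2.trans h4B⟩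
  -- ### `E(τ') ≤ M ∫₀^{τ'} E` for `0 ≤ τ' ≤ τ`
  have hineq : ∀ τ' ∈ Icc 0 τ, E τ' ≤ M * ∫ s in (0 : ℝ)..τ', E s := by
    intro τ' hτ'
    obtain ⟨hid, hint⟩ := weightedEnergy_sub_eq' hu₁ hu₂ hσ₁ hσ₂ hΦ hΦ0 hΦfar he hF' hτ hτ'.1 hτ'.2
    have hEI : IntegrableOn (fun s => M * E s) (Ioc 0 τ') :=
      ((hEc.mono (Icc_subset_Icc_right hτ'.2)).integrableOn_Icc.mono_set Ioc_subset_Icc_self).const_mul M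
    have hmono : ∫ s in Ioc 0 τ', (∫ y, F' s y) ≤ ∫ s in Ioc 0 τ', M * E s :=
      setIntegral_mono_on hint hEI measurableSet_Ioc fun s hs => hslice s ⟨hs.1, hs.2.trans hτ'.2⟩
    rw [intervalIntegral.integral_of_le hτ'.1, ← integral_const_mul]
    have h : E τ' - E 0 = ∫ s in Ioc 0 τ', ∫ y, F' s y := hid
    rw [hE0, sub_zero] at h
    calc E τ' = ∫ s in Ioc 0 τ', ∫ y, F' s y := h
      _ ≤ _ := hmono
  -- ### Grönwall: `E ≡ 0` on `[0, τ]`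
  have hEr : Continuous ((Icc 0 τ).restrict E) := continuousOn_iff_continuous_restrict.1 hEc
  set Et : ℝ → ℝ := Set.IccExtend htpos.le ((Icc 0 τ).restrict E) with hEt
  have hEtc : Continuous Et := hEr.Icc_extend'
  have hEteq : ∀ s ∈ Icc 0 τ, Et s = E s := fun s hs => by
    rw [hEt, Set.IccExtend_of_mem _ _ hs]; rfl
  set G : ℝ → ℝ := fun r => ∫ s in (0 : ℝ)..r, Et s with hG
  have hGderiv : ∀ r, HasDerivAt G (Et r) r := fun r =>
    intervalIntegral.integral_hasDerivAt_right (hEtc.intervalIntegrable _ _)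
      (hEtc.stronglyMeasurableAtFilter _ _) hEtc.continuousAt
  have hGc : Continuous G := continuous_iff_continuousAt.mpr fun r => (hGderiv r).continuousAt
  have hGE : ∀ r ∈ Icc 0 τ, G r = ∫ s in (0 : ℝ)..r, E s := fun r hr =>
    intervalIntegral.integral_congr fun s hs => hEteq s (by
      rw [uIcc_of_le hr.1] at hs; exact ⟨hs.1, hs.2.trans hr.2⟩)
  have hGnn : ∀ r ∈ Icc 0 τ, 0 ≤ G r := fun r hr => by
    rw [hGE r hr]; exact intervalIntegral.integral_nonneg hr.1 fun s _ => hEnn s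
  have hG0 : ∀ r ∈ Icc 0 τ, G r = 0 :=
    eq_zero_of_abs_deriv_le_mul_abs_self_of_eq_zero_right (K := M) hGc.continuousOn
      (fun r _ => (hGderiv r).hasDerivWithinAt) (by simp [hG]) fun r hr => by
        have hrI : r ∈ Icc 0 τ := ⟨hr.1, hr.2.le⟩
        rw [hEteq r hrI, Real.norm_of_nonneg (hEnn r), Real.norm_of_nonneg (hGnn r hrI), hGE r hrI]
        exact hineq r hrI
  have hEτ : E τ = 0 := by
    have h1 := hineq τ ⟨htpos.le, le_rfl⟩
    rw [← hGE τ ⟨htpos.le, le_rfl⟩, hG0 τ ⟨htpos.le, le_rfl⟩, mul_zero] at h1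
    exact le_antisymm h1 (hEnn τ)
  -- ### conclusion: the (continuous, nonnegative) integrand vanishes identically at time `τ`
  have hslc : Continuous fun y => Φ (τ, y) * e τ y :=
    (continuousOn_weightedDensity hu₁ hu₂ hσ₁ hσ₂ hΦ he).comp_continuous
      (continuous_const.prodMk continuous_id) fun y => ⟨⟨htpos.le, hτ⟩, mem_univ _⟩
  have hsli : Integrable fun y => Φ (τ, y) * e τ y :=
    integrable_of_far hslc fun y hy => by rw [hΦfar τ htpos.le y hy, zero_mul]
  have hnn : 0 ≤ fun y => Φ (τ, y) * e τ y := fun y => mul_nonneg (hΦ0 _) (by rw [he]; positivity)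
  have hae := (integral_eq_zero_iff_of_nonneg hnn hsli).1 hEτ
  have hzero : (fun y => Φ (τ, y) * e τ y) = fun _ => 0 :=
    (hslc.ae_eq_iff_eq volume continuous_const).1 hae
  have hx0 : Φ (τ, x) * e τ x = 0 := congr_fun hzero x
  rcases mul_eq_zero.1 hx0 with h | h
  · exact absurd h hx
  · exact h


/-- The variable-speed cone weight `χ(R − Γ(t) − (ε² + |x − x₀|²)^{1/2})` is `C¹` for `ε ≠ 0`,
`Γ ∈ C¹`. [folklore] -/
theorem contDiff_coneWeightVar {ε R : ℝ} {Γ : ℝ → ℝ} {x₀ : (EuclideanSpace ℝ ι)} (hε : ε ≠ 0)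
    (hΓ : ContDiff ℝ 1 Γ) :
    ContDiff ℝ 1 fun p : ℝ × (EuclideanSpace ℝ ι) =>
      Real.smoothTransition (R - Γ p.1 - √(ε ^ 2 + ‖p.2 - x₀‖ ^ 2)) := by
  refine Real.smoothTransition.contDiff.comp ?_
  refine ((contDiff_const.sub (hΓ.comp contDiff_fst)).sub ?_)
  refine ContDiff.sqrt (contDiff_const.add ((contDiff_norm_sq ℝ).comp (contDiff_snd.sub contDiff_const)))
    fun p => ?_
  positivity

/-- The variable-speed cone weight is supported in the open cone `‖x − x₀‖ + Γ(t) < R`. [folklore] -/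
theorem cone_of_coneWeightVar_ne_zero {ε R : ℝ} {Γ : ℝ → ℝ} {x₀ : (EuclideanSpace ℝ ι)}
    {p : ℝ × (EuclideanSpace ℝ ι)}
    (h : Real.smoothTransition (R - Γ p.1 - √(ε ^ 2 + ‖p.2 - x₀‖ ^ 2)) ≠ 0) :
    ‖p.2 - x₀‖ + Γ p.1 < R := by
  have h1 : ¬(R - Γ p.1 - √(ε ^ 2 + ‖p.2 - x₀‖ ^ 2) ≤ 0) := fun h' =>
    h (Real.smoothTransition.zero_of_nonpos h')
  have h2 := norm_le_sqrt_sq_add ε (p.2 - x₀)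
  linarith

/-- The variable-speed cone weight with `ε = (R − Γ(t) − ‖x − x₀‖)/2` is positive at a point of
the open cone. [folklore] -/
theorem coneWeightVar_pos {R : ℝ} {Γ : ℝ → ℝ} {x₀ : (EuclideanSpace ℝ ι)} {p : ℝ × (EuclideanSpace ℝ ι)}
    (h : ‖p.2 - x₀‖ + Γ p.1 < R) :
    0 < Real.smoothTransition
      (R - Γ p.1 - √(((R - Γ p.1 - ‖p.2 - x₀‖) / 2) ^ 2 + ‖p.2 - x₀‖ ^ 2)) := by
  refine Real.smoothTransition.pos_of_pos ?_
  set δ : ℝ := (R - Γ p.1 - ‖p.2 - x₀‖) / 2 with hδ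
  have hδ0 : 0 < δ := by rw [hδ]; linarith
  have hs : √(δ ^ 2 + ‖p.2 - x₀‖ ^ 2) ≤ δ + ‖p.2 - x₀‖ := by
    rw [Real.sqrt_le_iff]
    constructor
    · positivity
    · nlinarith [norm_nonneg (p.2 - x₀)]
  linarith

/-- **The derivative of the variable-speed cone weight** (`Γ' = c`). [folklore] -/
theorem hasFDerivAt_coneWeightVar {ε R : ℝ} {c Γ : ℝ → ℝ} {x₀ : (EuclideanSpace ℝ ι)} (hε : ε ≠ 0)
    (hΓd : ∀ t, HasDerivAt Γ (c t) t) (p : ℝ × (EuclideanSpace ℝ ι)) :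
    HasFDerivAt (fun q : ℝ × (EuclideanSpace ℝ ι) =>
        Real.smoothTransition (R - Γ q.1 - √(ε ^ 2 + ‖q.2 - x₀‖ ^ 2)))
      (deriv Real.smoothTransition (R - Γ p.1 - √(ε ^ 2 + ‖p.2 - x₀‖ ^ 2)) •
        (-(c p.1 • ContinuousLinearMap.fst ℝ ℝ (EuclideanSpace ℝ ι)) -
          (1 / (2 * √(ε ^ 2 + ‖p.2 - x₀‖ ^ 2))) •
            ((2 : ℕ) • (innerSL ℝ (p.2 - x₀)).comp
              (ContinuousLinearMap.snd ℝ ℝ (EuclideanSpace ℝ ι))))) p := by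
  have hpos : 0 < ε ^ 2 + ‖p.2 - x₀‖ ^ 2 := by positivity
  have h1 : HasFDerivAt (fun q : ℝ × (EuclideanSpace ℝ ι) => ‖q.2 - x₀‖ ^ 2)
      ((2 : ℕ) • (innerSL ℝ (p.2 - x₀)).comp (ContinuousLinearMap.snd ℝ ℝ (EuclideanSpace ℝ ι))) p :=
    ((hasFDerivAt_snd (p := p)).sub_const x₀).norm_sq
  have h2 : HasFDerivAt (fun q : ℝ × (EuclideanSpace ℝ ι) => ε ^ 2 + ‖q.2 - x₀‖ ^ 2)
      ((2 : ℕ) • (innerSL ℝ (p.2 - x₀)).comp (ContinuousLinearMap.snd ℝ ℝ (EuclideanSpace ℝ ι))) p :=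
    h1.const_add _
  have h3 := h2.sqrt hpos.ne'
  have h4 : HasFDerivAt (fun q : ℝ × (EuclideanSpace ℝ ι) => R - Γ q.1)
      (-(c p.1 • ContinuousLinearMap.fst ℝ ℝ (EuclideanSpace ℝ ι))) p := by
    have hf : HasFDerivAt (fun q : ℝ × (EuclideanSpace ℝ ι) => q.1)
        (ContinuousLinearMap.fst ℝ ℝ (EuclideanSpace ℝ ι)) p := hasFDerivAt_fst
    have hΓ : HasFDerivAt (fun q : ℝ × (EuclideanSpace ℝ ι) => Γ q.1)
        (c p.1 • ContinuousLinearMap.fst ℝ ℝ (EuclideanSpace ℝ ι)) p :=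
      (hΓd p.1).comp_hasFDerivAt p hf
    exact hΓ.const_sub R
  have h5 := h4.sub h3
  have hχ : HasDerivAt Real.smoothTransition
      (deriv Real.smoothTransition (R - Γ p.1 - √(ε ^ 2 + ‖p.2 - x₀‖ ^ 2)))
      (R - Γ p.1 - √(ε ^ 2 + ‖p.2 - x₀‖ ^ 2)) :=
    ((Real.smoothTransition.contDiff (n := 1)).differentiable one_ne_zero _).hasDerivAt
  exact hχ.comp_hasFDerivAt p h5

/-- **The variable-speed cone weight recedes at speed `c(t) = Γ'(t) ≥ 0`:**
`∂ₜΦ + c(t) ‖∇ₓΦ‖ ≤ 0`. [folklore] -/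
theorem coneWeightVar_flux_le {ε R : ℝ} {c Γ : ℝ → ℝ} {x₀ : (EuclideanSpace ℝ ι)} (hε : ε ≠ 0)
    (hΓd : ∀ t, HasDerivAt Γ (c t) t) (hc : ∀ t, 0 ≤ c t) (p : ℝ × (EuclideanSpace ℝ ι)) :
    fderiv ℝ (fun q : ℝ × (EuclideanSpace ℝ ι) =>
        Real.smoothTransition (R - Γ q.1 - √(ε ^ 2 + ‖q.2 - x₀‖ ^ 2))) p (1, 0) +
      c p.1 * ‖(fderiv ℝ (fun q : ℝ × (EuclideanSpace ℝ ι) =>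
          Real.smoothTransition (R - Γ q.1 - √(ε ^ 2 + ‖q.2 - x₀‖ ^ 2))) p).comp
            (ContinuousLinearMap.inr ℝ ℝ (EuclideanSpace ℝ ι))‖ ≤ 0 := by
  rw [(hasFDerivAt_coneWeightVar (R := R) (x₀ := x₀) hε hΓd p).fderiv]
  set χ' : ℝ := deriv Real.smoothTransition (R - Γ p.1 - √(ε ^ 2 + ‖p.2 - x₀‖ ^ 2)) with hχ'
  set N : ℝ := √(ε ^ 2 + ‖p.2 - x₀‖ ^ 2) with hN
  have hχ0 : 0 ≤ χ' := Real.smoothTransition.monotone.deriv_nonneg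
  have hN0 : 0 < N := Real.sqrt_pos.mpr (by positivity)
  have hzN : ‖p.2 - x₀‖ ≤ N := norm_le_sqrt_sq_add ε _
  have hc0 := hc p.1
  -- the time derivative
  have ht : (χ' • (-(c p.1 • ContinuousLinearMap.fst ℝ ℝ (EuclideanSpace ℝ ι)) -
      (1 / (2 * N)) • ((2 : ℕ) • (innerSL ℝ (p.2 - x₀)).comp
        (ContinuousLinearMap.snd ℝ ℝ (EuclideanSpace ℝ ι)))))
        ((1 : ℝ), (0 : (EuclideanSpace ℝ ι))) = -(c p.1 * χ') := by
    simp
    ring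
  -- the space derivative
  have hx : ‖(χ' • (-(c p.1 • ContinuousLinearMap.fst ℝ ℝ (EuclideanSpace ℝ ι)) -
      (1 / (2 * N)) • ((2 : ℕ) • (innerSL ℝ (p.2 - x₀)).comp
        (ContinuousLinearMap.snd ℝ ℝ (EuclideanSpace ℝ ι))))).comp
        (ContinuousLinearMap.inr ℝ ℝ (EuclideanSpace ℝ ι))‖ ≤ χ' := by
    refine ContinuousLinearMap.opNorm_le_bound _ hχ0 fun v => ?_
    have hv : ((χ' • (-(c p.1 • ContinuousLinearMap.fst ℝ ℝ (EuclideanSpace ℝ ι)) -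
        (1 / (2 * N)) • ((2 : ℕ) • (innerSL ℝ (p.2 - x₀)).comp
          (ContinuousLinearMap.snd ℝ ℝ (EuclideanSpace ℝ ι))))).comp
          (ContinuousLinearMap.inr ℝ ℝ (EuclideanSpace ℝ ι))) v = -(χ' * (⟪p.2 - x₀, v⟫ / N)) := by
      simp [inner_sub_left]
      left
      field_simp
    rw [hv, norm_neg, norm_mul, Real.norm_of_nonneg hχ0]
    gcongr
    rw [norm_div, Real.norm_of_nonneg hN0.le, div_le_iff₀ hN0]
    calc ‖⟪p.2 - x₀, v⟫‖ ≤ ‖p.2 - x₀‖ * ‖v‖ := norm_inner_le_norm _ _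
      _ ≤ N * ‖v‖ := by gcongr
      _ = ‖v‖ * N := mul_comm _ _
  rw [ht]
  nlinarith [mul_le_mul_of_nonneg_left hx hc0]

/-- **Finite speed of propagation with a variable (integrable) speed — domain of dependence of a
shrinking ball.** As `eqOn_cone_of_eqOn_ball`, but the base radius recedes as `R − Γ(t)` with
`Γ(0) = 0`, `Γ' = c ≥ 0` continuous, and the characteristic speed of the first solution is only
required to satisfy `‖u₁(t,x)‖ + |α σ₁(t,x)| ≤ c(t)` on the (curved) cone `‖x − x₀‖ + Γ(t) < R`: two
`C¹` solutions of the `(u,σ)`-system on that cone with equal data on `‖x − x₀‖ < R` agree on it.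
This is the form needed near an implosion, where the speed `∼ (T−t)^{1/r−1}` is unbounded but
integrable (Cao-Labora–Gómez-Serrano–Shi–Staffilani, Rem. 1.5). The proof is the same weighted
energy argument with the weight `χ(R − Γ(t) − (ε² + |x − x₀|²)^{1/2})`.
[cite: Dafermos2005, §5.2, Thm 5.2.1 and its proof (5.2.10)–(5.2.14)]
[cite: CaolaboraEtAl2025, §1.3 first display and Rem. 1.5] -/
theorem eqOn_cone_of_eqOn_ball_var [DecidableEq ι] {α R t₁ : ℝ} {c Γ : ℝ → ℝ}
    {x₀ : (EuclideanSpace ℝ ι)} {u₁ u₂ : ℝ → (EuclideanSpace ℝ ι) → (EuclideanSpace ℝ ι)}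
    {σ₁ σ₂ : ℝ → (EuclideanSpace ℝ ι) → ℝ}
    (hu₁ : ContDiffOn ℝ 1 (fun p : ℝ × (EuclideanSpace ℝ ι) => u₁ p.1 p.2) (Ico 0 t₁ ×ˢ univ))
    (hu₂ : ContDiffOn ℝ 1 (fun p : ℝ × (EuclideanSpace ℝ ι) => u₂ p.1 p.2) (Ico 0 t₁ ×ˢ univ))
    (hσ₁ : ContDiffOn ℝ 1 (fun p : ℝ × (EuclideanSpace ℝ ι) => σ₁ p.1 p.2) (Ico 0 t₁ ×ˢ univ))
    (hσ₂ : ContDiffOn ℝ 1 (fun p : ℝ × (EuclideanSpace ℝ ι) => σ₂ p.1 p.2) (Ico 0 t₁ ×ˢ univ))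
    (hE₁ : ∀ t ∈ Ioo 0 t₁, ∀ x, ‖x - x₀‖ + Γ t < R →
      deriv (fun s => σ₁ s x) t + fderiv ℝ (σ₁ t) x (u₁ t x) +
          α * σ₁ t x * ∑ i, fderiv ℝ (u₁ t) x (EuclideanSpace.single i 1) i = 0 ∧
        deriv (fun s => u₁ s x) t + fderiv ℝ (u₁ t) x (u₁ t x) + (α * σ₁ t x) • gradient (σ₁ t) x = 0)
    (hE₂ : ∀ t ∈ Ioo 0 t₁, ∀ x, ‖x - x₀‖ + Γ t < R →
      deriv (fun s => σ₂ s x) t + fderiv ℝ (σ₂ t) x (u₂ t x) +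
          α * σ₂ t x * ∑ i, fderiv ℝ (u₂ t) x (EuclideanSpace.single i 1) i = 0 ∧
        deriv (fun s => u₂ s x) t + fderiv ℝ (u₂ t) x (u₂ t x) + (α * σ₂ t x) • gradient (σ₂ t) x = 0)
    (hc : ∀ t ∈ Ioo 0 t₁, ∀ x, ‖x - x₀‖ + Γ t < R → ‖u₁ t x‖ + |α * σ₁ t x| ≤ c t)
    (hcc : Continuous c) (hc0 : ∀ t, 0 ≤ c t) (hΓd : ∀ t, HasDerivAt Γ (c t) t) (hΓ0 : Γ 0 = 0)
    (h0 : ∀ x, ‖x - x₀‖ < R → u₁ 0 x = u₂ 0 x ∧ σ₁ 0 x = σ₂ 0 x)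
    {t : ℝ} (ht : t ∈ Ico 0 t₁) {x : (EuclideanSpace ℝ ι)} (hx : ‖x - x₀‖ + Γ t < R) :
    u₁ t x = u₂ t x ∧ σ₁ t x = σ₂ t x := by
  -- `Γ` is `C¹`, monotone, nonnegative on `t ≥ 0`
  have hΓdiff : Differentiable ℝ Γ := fun s => (hΓd s).differentiableAt
  have hΓderiv : deriv Γ = c := funext fun s => (hΓd s).deriv
  have hΓ1 : ContDiff ℝ 1 Γ := contDiff_one_iff_deriv.2 ⟨hΓdiff, by rw [hΓderiv]; exact hcc⟩
  have hΓmono : Monotone Γ := monotone_of_deriv_nonneg hΓdiff fun s => by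
    rw [hΓderiv]; exact hc0 s
  have hΓnn : ∀ s, 0 ≤ s → 0 ≤ Γ s := fun s hs => by rw [← hΓ0]; exact hΓmono hs
  set ε : ℝ := (R - Γ t - ‖x - x₀‖) / 2 with hε
  have hε0 : 0 < ε := by rw [hε]; linarith
  refine eqOn_of_weight_var hu₁ hu₂ hσ₁ hσ₂ hE₁ hE₂ hc hΓnn h0
    (Φ := fun p : ℝ × (EuclideanSpace ℝ ι) =>
      Real.smoothTransition (R - Γ p.1 - √(ε ^ 2 + ‖p.2 - x₀‖ ^ 2)))
    (contDiff_coneWeightVar hε0.ne' hΓ1) (fun p => Real.smoothTransition.nonneg _)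
    (fun p hp => cone_of_coneWeightVar_ne_zero hp) (fun p => coneWeightVar_flux_le hε0.ne' hΓd hc0 p)
    ht ?_
  have h := coneWeightVar_pos (R := R) (Γ := Γ) (x₀ := x₀) (p := (t, x)) hx
  exact h.ne'

end VariableSpeed

/-! ### Exterior domain of dependence against a constant state -/

section Exterior

/-- **Exterior domain of dependence against a constant state.** Let `(u, σ)` be `C¹` on the slab
`[0, t₁) × E` and solve the `(u, σ)`-system `∂ₜσ + ∇σ·u + ασ div u = 0`,
`∂ₜu + (u·∇)u + ασ∇σ = 0` outside the ball `‖x − x₀‖ ≤ L`, with CONSTANT data `u(0,·) = v`,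
`σ(0,·) = s₀` there. Then `u = v`, `σ = s₀` at every `(t, x)` with
`‖x − x₀‖ > L + (‖v‖ + |αs₀|) t`: the disturbance created inside the ball travels at most at the
characteristic speed `‖v‖ + |αs₀|` of the constant state (Dafermos, Thm 5.2.1, applied on the
balls `B(x, ‖x − x₀‖ − L)` of the exterior region with the constant state as the reference
solution, `eqOn_cone_of_eqOn_ball`). This is the finite-speed-of-propagation step that keeps a
compactly modified datum constant far away, used to periodize whole-space solutions
(Cao-Labora–Gómez-Serrano–Shi–Staffilani, Rem. 1.5).
[cite: Dafermos2005, §5.2, Thm 5.2.1] [cite: CaolaboraEtAl2025, Rem 1.5 p. 7] -/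
theorem eqOn_const_of_exterior [DecidableEq ι] {α L t₁ : ℝ} {x₀ v : EuclideanSpace ℝ ι} {s₀ : ℝ}
    {u : ℝ → EuclideanSpace ℝ ι → EuclideanSpace ℝ ι} {σ : ℝ → EuclideanSpace ℝ ι → ℝ}
    (hu : ContDiffOn ℝ 1 (fun p : ℝ × EuclideanSpace ℝ ι => u p.1 p.2) (Ico 0 t₁ ×ˢ univ))
    (hσ : ContDiffOn ℝ 1 (fun p : ℝ × EuclideanSpace ℝ ι => σ p.1 p.2) (Ico 0 t₁ ×ˢ univ))
    (hE : ∀ t ∈ Ioo 0 t₁, ∀ x, L < ‖x - x₀‖ →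
      deriv (fun s => σ s x) t + fderiv ℝ (σ t) x (u t x) +
          α * σ t x * ∑ i, fderiv ℝ (u t) x (EuclideanSpace.single i 1) i = 0 ∧
        deriv (fun s => u s x) t + fderiv ℝ (u t) x (u t x) + (α * σ t x) • gradient (σ t) x = 0)
    (h0 : ∀ x, L < ‖x - x₀‖ → u 0 x = v ∧ σ 0 x = s₀)
    {t : ℝ} (ht : t ∈ Ico 0 t₁) {x : EuclideanSpace ℝ ι}
    (hx : L + (‖v‖ + |α * s₀|) * t < ‖x - x₀‖) :
    u t x = v ∧ σ t x = s₀ := by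
  have hc0 : 0 ≤ ‖v‖ + |α * s₀| := by positivity
  -- the ball `B(x, ‖x - x₀‖ - L)` lies in the exterior region
  have hball : ∀ z : EuclideanSpace ℝ ι, ‖z - x‖ < ‖x - x₀‖ - L → L < ‖z - x₀‖ := by
    intro z hz
    have h := norm_sub_norm_le (x - x₀) (z - x₀)
    rw [sub_sub_sub_cancel_right, ← norm_sub_rev z x] at h
    linarith
  have key := eqOn_cone_of_eqOn_ball (ι := ι) (α := α) (c := ‖v‖ + |α * s₀|)
    (R := ‖x - x₀‖ - L) (t₁ := t₁) (x₀ := x) (u₁ := fun _ _ => v) (u₂ := u)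
    (σ₁ := fun _ _ => s₀) (σ₂ := σ) contDiffOn_const hu contDiffOn_const hσ
    (fun s _ z _ => by simp [gradient_fun_const])
    (fun s hs z hz => hE s hs z (hball z (by nlinarith [mul_nonneg hc0 hs.1.le])))
    (fun _ _ _ _ => le_rfl) hc0
    (fun z hz => ⟨(h0 z (hball z hz)).1.symm, (h0 z (hball z hz)).2.symm⟩) ht (x := x)
    (by rw [sub_self, norm_zero, zero_add]; linarith)
  exact ⟨key.1.symm, key.2.symm⟩

end Exterior

end IsentropicEuler

end Literature.Analysis.FluidPDE
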